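import Mathlib
import Literature.MathematicalPhysics.QuantumFieldTheory.Dimock2011to13.Phi43PolymerRepresentation
import HarnessLib

/-!
# Dimock, *The renormalization group according to Balaban* I (Rev. Math. Phys. 25 (2013) 1330010; arXiv:1108.1335),
# §2.1–§2.3, §3.1–§3.5, §4.1: the CONCRETE small-field vocabulary on the torus lattices and THEOREM 14 (`lanky`) — the
# single small-field renormalization-group step — typed AS PRINTED, as one closed named fact about Dimock's concrete
# modified densities (hypothesis-free definitions; nothing asserted)

**Citation header.** J. Dimock, *The renormalization group according to Balaban. I. Small fields*, Rev. Math. Phys.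
**25** (2013) 1330010 (= arXiv:1108.1335v2) [Dimock2013]: §1.3 (the scaled model), §2.1 (block averaging: `Q`, `Qᵀ`,
(first0), (understand0), `Q_k`), §2.2 (free flow: `a_k`, `S_k`, `G_k`, `φ_k = a_kG_kQ_kᵀΦ_k`, `Δ_k`), §2.3 (Lemma 3:
`G⁰_{k+1}`, `φ⁰_{k+1}`, `Ψ_k`; Lemma 4: `C_k = (Δ_k + aL⁻²QᵀQ)⁻¹` and `Z_{k+1}`), §2.4 (`δ_α`), §3.1 (`λ_k`, `M`-polymers
`𝒟_k`, locality), §3.2 (Definition 1 `𝒮_k`, Definition 2 `𝓡_k`), §3.3 (Definition 3 `𝒦_k`, `Re 𝒦_k`, the norms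
`‖E(X)‖_k`, `‖E‖_{k,κ}`, `d_M`), §3.5 (normalization, small polymers, `𝒦_k^{norm}`), §4.1 (the modified recursion
(understand) with `χ^w_k`, `χ_k`, `p_{0,k}`, the representation (basic)–(basic3), THEOREM 14 with (recursive) and its
bounds).  Theorem/lemma numbers are those of the arXiv source's shared counter (Theorem 14 = `\label{lanky}`).  Text read
this session from the held corpus copy `paper:arxiv-1108.1335` (TeX chunks p0004–p0016); every docstring below quotes it.

**Why this module (R141 (D) item (8), census `pub/lit-balaban/ym-lit-type-8/CENSUS-DIMOCK-I-III.md` §2 DELTA-1).**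
The lineage `…Dimock2011to13.*` (129 files) reproduces I–III over ABSTRACT carriers: Theorem 14's six bounds are the
hypothesis shape `SmallFieldFlow.StepBounds` over abstract Banach spaces, its recursion is `SmallFieldStepAssembly`,
Theorem 24 is PROVED from those shapes (`SmallFieldFlow.flow_exists_unique`), and `Q`, `G_k`, `C_k^{1/2}`, `𝓡_k`,
normalization live in `BlockAveragingMatrix`/`TorusBlockAveraging`, `FluctuationCovarianceIdentity`/`CovarianceSquareRoot`,
`AnalyticityDomains`, `NormalizationExtraction` over generic index types.  What the tree did not have is Theorem 14 as a
CLOSED statement about Dimock's concrete objects on the tori `𝕋⁰_{𝖬+𝖭−k}`, `𝕋^{−k}_{𝖬+𝖭−k}`.  This module supplies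
exactly that: the concrete vocabulary (hypothesis-free `def`s, Dimock's own coordinates and weights) and the named
fact `Thm14Printed`.  Nothing is asserted; no `_holds`.

**Carriers (declared reading).**  All of Dimock's lattices `𝕋^{−j}_{𝖬+𝖭−k}` have `L^{𝖬+𝖭−(k−j)}` sites per direction;
we index the sites of a torus with `n` sites per direction by the cell's `TPt 3 n = Fin 3 → ZMod n` (unit INTEGER
coordinates) and carry the lattice spacing `η` as an explicit weight: the fine lattice `𝕋^{−k}_{𝖬+𝖭−k}` is
`TPt 3 (L^(𝖬+𝖭))` with `η = L^{−k}`, the unit lattice `𝕋⁰_{𝖬+𝖭−k}` is `TPt 3 (L^(𝖬+𝖭−k))`, and `𝕋¹_{𝖬+𝖭−k}` ∕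
`𝕋⁰_{𝖬+𝖭−k−1}` are both `TPt 3 (L^(𝖬+𝖭−k−1))` (the rescaling `Φ_{k+1,L}(x) = L^{−1/2}Φ_{k+1}(x/L)`, TeX (scaleddensity),
is the map `Φ ↦ L^{−1/2}Φ` on this common index set).  Blocks use the CORNER convention of the lineage
(`TorusBlockAveraging`, reading (i): `B(y) = {x : ⌊x/L⌋ = y}`; the print centres `B(y)` on `y` with `L` odd — the two
differ by a relabelling of the fine torus, cell ruling F3), written modulus-free as `blk B x = ⌊x/B⌋` so that no cast
between `TPt 3 (B·n)` and `TPt 3 n` is needed; `M`-cubes (`M = L^m`) are the blocks of side `L^{k+m}` of the fine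
lattice, indexed by `TPt 3 (L^(𝖬+𝖭−k−m))`, and `M`-polymers are the lineage's `Dimock2011to13.polymers` (non-empty
face-connected families of cubes) with tree length `d_M = TreeLengthTorus.torusTreeLen`.

**What is typed (all `def`s have bodies; the only `Prop`-valued closed definition is the named fact `Thm14Printed`).**
§1 parameters `η = L^{−k}` (`eta`), `λ_k` (`lamK`), `μ̄_k` (`mubarK`), `a_k` (`aK`, `k ≥ 1`), `p_k` (`pK`); §2 the block
map `blk`, `Q_k` (`Qk`), `Q_kᵀ` (`QkT`, the injection — the transpose w.r.t. the WEIGHTED inner products, §2.1, the display defining `Qᵀ`),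
the fine Laplacian `negLap`, `G_k` (`Gk`), `φ_k` (`phiK`), the norms and `S_k` (`Sk`), `V_k` (`Vk`), `Δ_k` (`Deltak`);
§3 Definition 1 `𝒮_k` (`SmallFieldSet`), the torus sup-distance (`tsep`) and Definition 2 `𝓡_k` (`RDom`, STRICT
inequalities as printed, with the Hölder quotient `δ_α` of §2.4); §4 polymer functionals
`E : 𝒟_k × (fields) → ℂ` (`PolyFun`): locality (`IsLocal`), evenness, reality (`Re 𝒦`), invariance under the lattice
symmetries (`IsSymmetric`: cube-lattice translations and signed coordinate permutations, acting compatibly on sites and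
on cubes), analyticity on `𝓡_k` (`DifferentiableOn ℂ`), the weighted sup-norm as the predicate `NormLe E κ B`
(⇔ `‖E‖_{k,κ} ≤ B`), the second derivative `E₂(X,0;f,g)` (`E2`) and «normalized for small polymers» (`IsNormalizedSmall`,
small = `d_M(X) < L`), whence `InK` (= `E ∈ 𝒦_k`) and `InReKnorm` (= `E ∈ Re 𝒦_k^{norm}`); §5 the representation
(basic)–(basic3) as the predicate `HasRep`; §6 the modified step (understand): one-step `Q` (`Q1`), `Q1T`, `Q_{k+1}`
(`QkSucc`), `G⁰_{k+1}` (`G0succ`), `φ⁰_{k+1}` (`phi0succ`), `Ψ_k` (`PsiK`), `D_k = C_k⁻¹ = Δ_k + aL⁻²QᵀQ` (`Dk`),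
`C_k^{−1/2} = CFC.sqrt D_k` (Mathlib's C⋆-square root, as in the lineage's `CovarianceSquareRoot`), `p_{0,k}`, the
Gaussian normaliser `𝒩_{a,Ω} = (2π/a)^{|Ω|/2}` (`gaussNorm`), the modified transformed density `ρ̃_{k+1}` (`rhoTilde`) and
`ρ_{k+1}` (`modStep`), and `Z_{k+1} = Z_k 𝒩⁻¹_{a,𝕋¹}(2π)^{|𝕋⁰|/2}(det C_k)^{1/2}` (`Znext`, I Lemma 4 ∕ III eq. (14)); §7
**`Thm14Printed`** — Theorem 14 as printed, for the steps `k → k+1` with `k ≥ 1` (the start `k = 0`, where `a_0 = ∞`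
formally and `S_0(Φ_0) = ½‖∂Φ_0‖² + ½μ̄_0‖Φ_0‖²`, is the same statement with `φ_0 = Φ_0`; not typed separately).

**Quantifier reading of Theorem 14 (declared).**  Print: *"Let L, M be sufficiently large, let λ_k be sufficiently
small (depending on L, M). Suppose ρ_k(Φ_k) has the representation (basic)–(basic3) for Φ_k ∈ 𝒮_k and |μ_k| ≤ λ_k^{1/2},
‖E_k‖_{k,κ} ≤ 1.  Then ρ_{k+1}(Φ_{k+1}) has a representation of the same form for Φ_{k+1} ∈ 𝒮_{k+1}"* with (recursive)
*"where the 𝓛_i are linear operators which satisfy"* the three `𝒪(1)L^{−ε}` bounds *"and where"* the starred terms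
obey the three `𝒪(1)L³λ_k^{…}` bounds.  Typed as: ONE absolute constant `C` (the six `𝒪(1)`; III §1 Convention: *"𝒪(1) stands for a generic constant
independent of all parameters"*); the fixed parameters `a > 0`, `0 < μ̄ ≤ 1`,
`½ < α < 1`, integers `0 < p₀ < p`, then `ε ∈ (0, ε₀]`, `κ ≥ κ₁`, `L ≥ L₀` odd, `m ≥ m₀` (`M = L^m`), and `λ_k ≤ λ_*`
with each threshold depending on everything before it (the print's "sufficiently"); the maps `𝓛₁, 𝓛₂, 𝓛₃, ε*_k, μ*_k,
E*_k` are quantified AFTER `(L, m, 𝖬, 𝖭, k, λ)` and BEFORE the data `(ρ_k, Z_k, ε_k, μ_k, E_k)` — they are fixed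
operators of the step, the data are arbitrary.  `ρ_k` is ANY real function on unit-lattice fields having the
representation on `𝒮_k` (the step (understand) sees `ρ_k` only through `χ_k ρ_k`).  `Z_{k+1}` is PINNED by the printed
formula (Lemma 4), so the `ε`-recursion keeps its content.  EXPLICIT SIDE CONDITION added (implicit in print): the
`M`-cubes must tile the tori at steps `k` and `k+1`, `m ≤ 𝖬 + 𝖭 − k − 1`.

**HONEST FRAMING / what is NOT here.**  No statement of this file is proved or asserted: `Thm14Printed` is a published,
refereed theorem typed as a named fact (its proof is I §4.2–4.8 = Lemmas 15–22 + App. B–D, reproduced over abstract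
carriers elsewhere in this directory but not connected to these concrete definitions).  Not typed: Theorem 24 ∕ the
counterterm trajectory on these concrete objects (PROVED abstractly: `SmallFieldFlow.flow_exists_unique`), the
extraction `𝓡` and the explicit `𝓛_i` (`NormalizationExtraction`), papers II–III.  `φ⁴₃` is a TEMPLATE model; nothing
here bears on Yang–Mills, a continuum limit or a mass gap.  Junk conventions: `ℕ`-subtraction in exponents is guarded
by the hypotheses `k + 1 ≤ 𝖭`, `m ≤ 𝖬 + 𝖭 − k − 1` inside the fact; `Matrix.inv` of a singular matrix is `0` (never
the case for the printed positive operators, but not proved here); `Real.log`, `Real.rpow` as in Mathlib.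
-/

noncomputable section

open scoped Matrix MatrixOrder ComplexOrder
open Real Finset MeasureTheory Complex
open Literature.MathematicalPhysics.QuantumFieldTheory.Balaban1983to89.TreeLengthTorus (TPt torusTreeLen)

namespace Literature.MathematicalPhysics.QuantumFieldTheory.Dimock2011to13.SmallFieldTheoremPrinted

/-! ## §1. Scaled parameters (I §1.3, §2.2, §3.1, §3.2) -/

/-- The lattice spacing `η = L^{−k}` of `𝕋^{−k}_{𝖬+𝖭−k}`. [cite: Dimock2013, §1.2 ("lattices with spacing L^{−N}") and §2.1] -/
def eta (L k : ℕ) : ℝ := ((L : ℝ) ^ k)⁻¹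

/-- The running coupling `λ_k = L^kλ_0 = L^{−(𝖭−k)}λ` (`k ≤ 𝖭`). [cite: Dimock2013, §3.1 ("λ_k = L^k λ_0 = L^{−(N−k)} λ")] -/
def lamK (L N k : ℕ) (lam : ℝ) : ℝ := ((L : ℝ) ^ (N - k))⁻¹ * lam

/-- The running mass `μ̄_k = L^{2k}μ̄_0 = L^{−2(𝖭−k)}μ̄`. [cite: Dimock2013, §2.2 ("μ̄_k = L^{2k} μ̄_0 = L^{−2(N−k)} μ̄")] -/
def mubarK (L N k : ℕ) (mubar : ℝ) : ℝ := ((L : ℝ) ^ (2 * (N - k)))⁻¹ * mubar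

/-- `a_k = a(1 − L^{−2})/(1 − L^{−2k})` (meaningful for `k ≥ 1`; `a_1 = a`). [cite: Dimock2013, §2.1 Lemma 2 ("a_k = a (1−L^{−2})/(1−L^{−2k})")] -/
def aK (a : ℝ) (L k : ℕ) : ℝ := a * (1 - ((L : ℝ) ^ 2)⁻¹) / (1 - ((L : ℝ) ^ (2 * k))⁻¹)

/-- `p_k = p(λ_k) = (−log λ_k)^p` for a positive integer `p` (also used with the smaller exponent `p₀` for `p_{0,k}`).
[cite: Dimock2013, §3.2 ("p_k = (−log λ_k)^p … for some positive integer p"); §4.1 ("p_{0,k} = (−log λ_k)^{p_0} … p_0 < p")] -/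
def pK (p : ℕ) (lamk : ℝ) : ℝ := (-Real.log lamk) ^ p

/-! ## §2. Block averaging, the fine Laplacian, `G_k`, `φ_k`, `S_k`, `V_k`, `Δ_k` (I §2.1–§2.2) -/

/-- The block map in integer coordinates: `x ↦ ⌊x/B⌋` componentwise (corner convention of the lineage's
`TorusBlockAveraging`/`tcoarse`; the print centres the cubes, `L` odd — a relabelling).  Modulus-free: meaningful when
the source modulus is `B` times the target modulus. [cite: Dimock2013, §2.1 ("B(y) is cubes of L³ sites (L on a side) … centered on y")] -/
def blk (B : ℕ) {n : ℕ} (c : ℕ) (x : TPt 3 n) : TPt 3 c := fun i => (((x i).val / B : ℕ) : ZMod c)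

section Operators

variable (L Mx N k : ℕ) [NeZero L]

/-- `Q_k` as a matrix (fine `𝕋^{−k}_{𝖬+𝖭−k}` → unit `𝕋⁰_{𝖬+𝖭−k}`): `(Q_k f)(y) = L^{−3k} Σ_{x ∈ B_k(y)} f(x)`.
[cite: Dimock2013, §2.1 ("(Q_k f)(y) = L^{−3k} Σ_{x∈B_k(y)} f(x)")] -/
def Qk : Matrix (TPt 3 (L ^ (Mx + N - k))) (TPt 3 (L ^ (Mx + N))) ℝ :=
  Matrix.of fun y x => if blk (L ^ k) (L ^ (Mx + N - k)) x = y then (((L : ℝ) ^ (3 * k))⁻¹) else 0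

/-- `Q_kᵀ`, the transpose of `Q_k` with respect to the WEIGHTED inner products (`∫ = L^{−3k}Σ` on the fine lattice, `Σ`
on the unit lattice): the injection `(Q_kᵀΦ)(x) = Φ(y)` for `x ∈ B_k(y)`. [cite: Dimock2013, §2.1 ("(Qᵀf)(x) = f(y) if x ∈ B(y)")] -/
def QkT : Matrix (TPt 3 (L ^ (Mx + N))) (TPt 3 (L ^ (Mx + N - k))) ℝ :=
  Matrix.of fun x y => if blk (L ^ k) (L ^ (Mx + N - k)) x = y then 1 else 0

/-- `−Δ = ∂*∂` on the fine torus at spacing `η`: `(−Δf)(x) = η^{−2} Σ_μ (2f(x) − f(x+ηe_μ) − f(x−ηe_μ))`.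
[cite: Dimock2013, §1.2 ("(∂_μφ)(x) = (φ(x + L^{−N}e_μ) − φ(x))/L^{−N} … and the Laplacian is Δ = −∂*∂")] -/
def negLap (n : ℕ) (η : ℝ) : Matrix (TPt 3 n) (TPt 3 n) ℝ :=
  Matrix.of fun x y => (η ^ 2)⁻¹ *
    ((if y = x then 6 else 0) - ∑ μ : Fin 3, ((if y = x + Pi.single μ 1 then 1 else 0) + (if y = x - Pi.single μ 1 then 1 else 0)))

/-- `G_k = (−Δ + μ̄_k + a_kQ_kᵀQ_k)^{−1}` on the fine lattice (spacing `L^{−k}`).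
[cite: Dimock2013, §2.2 ("G_k = (−Δ + μ̄_k + a_k Q_kᵀ Q_k)^{−1}")] -/
def Gk (a mubar : ℝ) : Matrix (TPt 3 (L ^ (Mx + N))) (TPt 3 (L ^ (Mx + N))) ℝ :=
  (negLap (L ^ (Mx + N)) (eta L k) + mubarK L N k mubar • (1 : Matrix _ _ ℝ)
    + aK a L k • (QkT L Mx N k * Qk L Mx N k))⁻¹

/-- The minimizer `φ_k(Φ_k) = a_kG_kQ_kᵀΦ_k` of `S_k(Φ_k, ·)`. [cite: Dimock2013, §2.2 ("φ_k(Φ_k) = a_k G_k Q_kᵀ Φ_k")] -/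
def phiK (a mubar : ℝ) (Φ : TPt 3 (L ^ (Mx + N - k)) → ℝ) : TPt 3 (L ^ (Mx + N)) → ℝ :=
  aK a L k • (Gk L Mx N k a mubar *ᵥ (QkT L Mx N k *ᵥ Φ))

/-- `‖Φ‖² = Σ_y Φ(y)²` on a unit lattice (unweighted). [cite: Dimock2013, §1.3 ("the inner product is now on the unit lattice")] -/
def normSqU {n : ℕ} [NeZero n] (Φ : TPt 3 n → ℝ) : ℝ := ∑ y, Φ y ^ 2

/-- `‖φ‖² = ∫φ² = η³Σ_x φ(x)²` on the fine lattice. [cite: Dimock2013, §1.2 eq. (three0) ("⟨u,v⟩ = ∫u(x)v(x)dx ≡ L^{−3N}Σ_x u(x)v(x)")] -/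
def normSqF {n : ℕ} [NeZero n] (η : ℝ) (φ : TPt 3 n → ℝ) : ℝ := η ^ 3 * ∑ x, φ x ^ 2

/-- The forward lattice derivative at spacing `η`: `(∂_μφ)(x) = (φ(x + ηe_μ) − φ(x))/η` (any scalars `𝕜`).
[cite: Dimock2013, §1.2 eq. (lattice1)] -/
def fd {n : ℕ} {𝕜 : Type*} [Field 𝕜] (η : 𝕜) (φ : TPt 3 n → 𝕜) (μ : Fin 3) (x : TPt 3 n) : 𝕜 :=
  (φ (x + Pi.single μ 1) - φ x) / η

/-- `‖∂φ‖² = Σ_μ ∫(∂_μφ)² = η³ Σ_x Σ_μ (∂_μφ)(x)²`. [cite: Dimock2013, §1.2 ("½‖∂φ‖²") and eq. (three0)] -/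
def gradSqF {n : ℕ} [NeZero n] (η : ℝ) (φ : TPt 3 n → ℝ) : ℝ := η ^ 3 * ∑ x, ∑ μ : Fin 3, fd η φ μ x ^ 2

/-- `∫φ⁴ = η³Σ_x φ(x)⁴`. [cite: Dimock2013, §1.2 eq. (def1) ("¼λ∫φ⁴(x)dx")] -/
def quartF {n : ℕ} [NeZero n] (η : ℝ) (φ : TPt 3 n → ℝ) : ℝ := η ^ 3 * ∑ x, φ x ^ 4

/-- The free action `S_k(Φ_k, φ) = (a_k/2)‖Φ_k − Q_kφ‖² + ½‖∂φ‖² + ½μ̄_k‖φ‖²` (first norm on the unit lattice, the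
others at spacing `L^{−k}`). [cite: Dimock2013, §2.2 eq. (norton) and §4.1 eq. (basic2)] -/
def Sk (a mubar : ℝ) (Φ : TPt 3 (L ^ (Mx + N - k)) → ℝ) (φ : TPt 3 (L ^ (Mx + N)) → ℝ) : ℝ :=
  aK a L k / 2 * normSqU (Φ - Qk L Mx N k *ᵥ φ) + 1 / 2 * gradSqF (eta L k) φ
    + 1 / 2 * mubarK L N k mubar * normSqF (eta L k) φ

/-- The potential `V_k(φ) = ε_kVol(𝕋_{𝖬+𝖭−k}) + ½μ_k‖φ‖² + ¼λ_k∫φ⁴`, `Vol(𝕋_{𝖬+𝖭−k}) = L^{3(𝖬+𝖭−k)}`.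
[cite: Dimock2013, §4.1 eq. (basic2)] -/
def Vk (εk μk lamk : ℝ) (φ : TPt 3 (L ^ (Mx + N)) → ℝ) : ℝ :=
  εk * (L : ℝ) ^ (3 * (Mx + N - k)) + 1 / 2 * μk * normSqF (eta L k) φ + 1 / 4 * lamk * quartF (eta L k) φ

/-- `Δ_k = a_k − a_k²Q_kG_kQ_kᵀ`, the operator with `S_k(Φ_k, φ_k) = ½⟨Φ_k, Δ_kΦ_k⟩`. [cite: Dimock2013, §2.2 eq. (spiffy) ("Δ_k = a_k − a_k² Q_k G_k Q_kᵀ")] -/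
def Deltak (a mubar : ℝ) : Matrix (TPt 3 (L ^ (Mx + N - k))) (TPt 3 (L ^ (Mx + N - k))) ℝ :=
  aK a L k • (1 : Matrix _ _ ℝ) - (aK a L k) ^ 2 • (Qk L Mx N k * Gk L Mx N k a mubar * QkT L Mx N k)

end Operators

/-! ## §3. The small-field domain `𝒮_k` and the analyticity domain `𝓡_k` (I §3.2) -/

section Domains

variable (L Mx N k : ℕ) [NeZero L]

/-- **Definition 1 (`𝒮_k`)**, verbatim: *"𝒮_k is all functions Φ_k : 𝕋⁰_{M+N−k} → ℝ such that with φ_k = a_kG_kQ_kᵀΦ_k on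
𝕋^{−k}_{N+M−k}:  |Φ_k − Q_kφ_k| ≤ p_k,  |∂φ_k| ≤ p_k,  |φ_k| ≤ λ_k^{−1/4}p_k"* (pointwise sup bounds).
[cite: Dimock2013, §3.2 Definition 1] -/
def SmallFieldSet (a mubar lam : ℝ) (p : ℕ) : Set (TPt 3 (L ^ (Mx + N - k)) → ℝ) :=
  {Φ | (∀ y, |Φ y - (Qk L Mx N k *ᵥ phiK L Mx N k a mubar Φ) y| ≤ pK p (lamK L N k lam)) ∧
       (∀ x (μ : Fin 3), |fd (eta L k) (phiK L Mx N k a mubar Φ) μ x| ≤ pK p (lamK L N k lam)) ∧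
       (∀ x, |phiK L Mx N k a mubar Φ x| ≤ (lamK L N k lam) ^ (-(1 / 4 : ℝ)) * pK p (lamK L N k lam))}

/-- The periodic sup-distance of two sites in INTEGER units: `max_μ dist_{ℤ/n}(x_μ, x'_μ)` (the print's
`|x − y| = sup_μ|x_μ − y_μ|`, TeX §2.1, on the torus). [cite: Dimock2013, §2.1 ("The distance is |x−y| = sup_μ |x_μ − y_μ|")] -/
def tsep {n : ℕ} (x x' : TPt 3 n) : ℕ :=
  Finset.univ.sup fun μ : Fin 3 => min (x μ - x' μ).val (x' μ - x μ).val

/-- **Definition 2 (`𝓡_k`)**, verbatim: *"Let ε be a fixed small positive number. 𝓡_k is all functions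
φ : 𝕋^{−k}_{N+M−k} → ℂ such that:  |φ| < λ_k^{−1/4−3ε},  |∂φ| < λ_k^{−1/4−2ε},  |δ_α∂φ| < λ_k^{−1/4−ε}"*, with the Hölder
quotient *"(δ_αf)(x,x′) = (f(x) − f(x′))/d(x,x′)^α"* for `d(x,x′) ≤ 1` (`½ < α < 1`), `d` the sup-distance at spacing
`η = L^{−k}`. [cite: Dimock2013, §3.2 Definition 2; §2.4 ("Here δ_α is defined for d(x,x′) ≤ 1 by …")] -/
def RDom (n : ℕ) (η lamk ε α : ℝ) : Set (TPt 3 n → ℂ) :=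
  {φ | (∀ x, ‖φ x‖ < lamk ^ (-(1 / 4 : ℝ) - 3 * ε)) ∧
       (∀ x (μ : Fin 3), ‖fd (η : ℂ) φ μ x‖ < lamk ^ (-(1 / 4 : ℝ) - 2 * ε)) ∧
       (∀ (μ : Fin 3) x x', x ≠ x' → η * (tsep x x' : ℝ) ≤ 1 →
          ‖fd (η : ℂ) φ μ x - fd (η : ℂ) φ μ x'‖ < lamk ^ (-(1 / 4 : ℝ) - ε) * (η * (tsep x x' : ℝ)) ^ α)}

end Domains

/-! ## §4. Localized functionals: `𝒟_k`, `𝒦_k`, `Re 𝒦_k`, `‖·‖_{k,κ}`, normalization, `𝒦_k^{norm}` (I §3.1, §3.3, §3.5) -/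

section Functionals

/-- Polymer functionals `E(X, φ)`: `X` a family of `M`-cubes (indexed by `TPt 3 c`, `c` cubes per direction — the
polymers are the lineage's `Dimock2011to13.polymers c`), `φ` a complex field on the fine lattice `TPt 3 n`.
[cite: Dimock2013, §3.1 ("E_k(φ_k) = Σ_{X∈𝒟_k} E_k(X, φ_k)") and §3.3 Definition 3] -/
abbrev PolyFun (c n : ℕ) : Type := Finset (TPt 3 c) → (TPt 3 n → ℂ) → ℂ

variable {c n : ℕ}

/-- (a.) LOCALITY: *"E(X, φ) only depends on φ in X"* — with `cube : site ↦ its M-cube`. [cite: Dimock2013, §3.3 Definition 3 (a.); §3.1 ("E_k(X, φ_k) only depend on the restriction of φ_k to X")] -/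
def IsLocal (cube : TPt 3 n → TPt 3 c) (E : PolyFun c n) : Prop :=
  ∀ X (φ ψ : TPt 3 n → ℂ), (∀ x, cube x ∈ X → φ x = ψ x) → E X φ = E X ψ

/-- (c.) EVENNESS: *"E(X, φ) is even in φ"*. [cite: Dimock2013, §3.3 Definition 3 (c.)] -/
def IsEven (E : PolyFun c n) : Prop := ∀ X φ, E X (-φ) = E X φ

/-- REALITY, the subspace `Re(𝒦_k) = {E : conj E(φ) = E(conj φ)}` (*"real for real fields φ"*).
[cite: Dimock2013, §3.3 eq. after Definition 3 ("Re(𝒦_k) = {E ∈ 𝒦_k : \overline{E(φ)} = E(\overline{φ})}")] -/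
def IsReal (E : PolyFun c n) : Prop := ∀ X φ, (starRingEnd ℂ) (E X φ) = E X (star φ)

/-- A lattice symmetry datum: a cube-lattice translation `v`, a coordinate permutation `σ` and reflection signs `s`
(the hyperoctahedral group ⋉ translations: *"translations, rotations by π/2, reflections"*). [cite: Dimock2013, §3.3 Definition 3 (d.)] -/
structure LatSym (c : ℕ) where
  /-- translation, in units of the cube side -/
  v : TPt 3 c
  /-- permutation of the three coordinate axes -/
  σ : Equiv.Perm (Fin 3)
  /-- reflections of the axes (`true` = reflect) -/
  s : Fin 3 → Bool

/-- Action on cube indices: `y ↦ (± y_{σ(i)} [reflected as y ↦ −1 − y in the corner convention]) + v`.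
[cite: Dimock2013, §3.3 Definition 3 (d.)] -/
def LatSym.onCube (g : LatSym c) (y : TPt 3 c) : TPt 3 c :=
  fun i => (if g.s i then -1 - y (g.σ i) else y (g.σ i)) + g.v i

/-- Action on fine sites (cube side `B` sites): `x ↦ (± x_{σ(i)} [reflected as −1 − x]) + B·v`, compatible with
`onCube` under `blk B`. [cite: Dimock2013, §3.3 Definition 3 (d.)] -/
def LatSym.onSite (g : LatSym c) (B : ℕ) (x : TPt 3 n) : TPt 3 n :=
  fun i => (if g.s i then -1 - x (g.σ i) else x (g.σ i)) + ((B * (g.v i).val : ℕ) : ZMod n)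

/-- (d.) SYMMETRY: *"E(X, φ) is invariant under lattice symmetries (translations, rotations by π/2, reflections)"* —
`E(g·X, φ ∘ g⁻¹) = E(X, φ)`, stated as `E(g·X, ψ) = E(X, ψ ∘ g)` for all `ψ`. [cite: Dimock2013, §3.3 Definition 3 (d.)] -/
def IsSymmetric (B : ℕ) (E : PolyFun c n) : Prop :=
  ∀ (g : LatSym c) X (ψ : TPt 3 n → ℂ), E (X.image g.onCube) ψ = E X (ψ ∘ g.onSite B)

/-- **The norm bound `‖E‖_{k,κ} ≤ B`** — with `‖E(X)‖_k = sup_{φ∈𝓡_k}|E(X, φ)|` and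
`‖E‖_{k,κ} = sup_X ‖E(X)‖_k e^{κ d_M(X)}` (`d_M` = `torusTreeLen`, the length of the shortest tree joining the cubes of `X`
in units of `M`), stated pointwise (equivalent to the bound on the suprema, and free of `sSup` junk).
[cite: Dimock2013, §3.3 ("‖E(X)‖_k = sup_{φ∈𝓡_k} ‖E(X, φ)‖", "‖E‖_{k,κ} = sup_X ‖E(X)‖_k e^{κ d_M(X)}", "M d_M(X) = the length of the shortest tree in X joining the M-cubes in X")] -/
def NormLe [NeZero c] (R : Set (TPt 3 n → ℂ)) (E : PolyFun c n) (κ B : ℝ) : Prop :=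
  ∀ X ∈ polymers c, ∀ φ ∈ R, ‖E X φ‖ * Real.exp (κ * torusTreeLen X) ≤ B

/-- The second derivative `E₂(X, φ; f₁, f₂) = ∂²/∂t₁∂t₂ E(X, φ + t₁f₁ + t₂f₂)|_{t=0}` (complex parameters; `E` is
analytic). [cite: Dimock2013, §3.5 ("E_n(X, φ; f_1, …, f_n) = ∂^n/∂t_1⋯∂t_n E(X, φ + t_1f_1 + ⋯ + t_nf_n)|_{t_i=0}")] -/
def E2 (E : PolyFun c n) (X : Finset (TPt 3 c)) (φ f₁ f₂ : TPt 3 n → ℂ) : ℂ :=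
  deriv (fun t₁ : ℂ => deriv (fun t₂ : ℂ => E X (φ + t₁ • f₁ + t₂ • f₂)) 0) 0

/-- The coordinate function `x ↦ x_μ` on a polymer, realised relative to a base site `x₀` by the signed periodic
representative (`ZMod.valMinAbs`) at spacing `η` — well defined on polymers that do not wrap around the torus, in
particular on small ones. [cite: Dimock2013, §3.5 ("x_μ means the projection x → x_μ")] -/
def coordFun (η : ℝ) (μ : Fin 3) (x₀ : TPt 3 n) : TPt 3 n → ℂ :=
  fun x => ((η * ((x μ - x₀ μ).valMinAbs : ℝ) : ℝ) : ℂ)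

/-- **NORMALIZATION**, verbatim: *"The functional E ∈ 𝒦_k is said to be normalized if E(X,0) = 0, E₂(X,0;1,1) = 0,
E₂(X,0;1,x_μ) = 0"* (`1` the constant function) — required *"for small polymers X which have d_M(X) < L"*:
`𝒦_k^{norm} = {E ∈ 𝒦_k : E(X, φ) is normalized for small X}`. [cite: Dimock2013, §3.5 (the normalization display; "small polymers X which have d_M(X) < L"; "𝒦_k^{norm} = {E ∈ 𝒦_k : E(X, φ) is normalized for small X}")] -/
def IsNormalizedSmall [NeZero c] (η : ℝ) (Lr : ℝ) (cube : TPt 3 n → TPt 3 c) (E : PolyFun c n) : Prop :=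
  ∀ X ∈ polymers c, torusTreeLen X < Lr →
    E X 0 = 0 ∧ E2 E X 0 (fun _ => 1) (fun _ => 1) = 0 ∧
      ∀ (μ : Fin 3) (x₀ : TPt 3 n), cube x₀ ∈ X → E2 E X 0 (fun _ => 1) (coordFun η μ x₀) = 0

/-- **`E ∈ 𝒦_k`** (Definition 3): (a.) local, (b.) analytic (complex-differentiable on the open set `𝓡_k`) and bounded
on `𝓡_k`, (c.) even, (d.) invariant under the lattice symmetries. [cite: Dimock2013, §3.3 Definition 3] -/
def InK [NeZero c] (R : Set (TPt 3 n → ℂ)) (B : ℕ) (cube : TPt 3 n → TPt 3 c) (E : PolyFun c n) (κ : ℝ) : Prop :=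
  IsLocal cube E ∧ (∀ X ∈ polymers c, DifferentiableOn ℂ (E X) R) ∧ (∃ Bd : ℝ, NormLe R E κ Bd) ∧
    IsEven E ∧ IsSymmetric B E

/-- **`E ∈ Re(𝒦_k^{norm})`** = `𝒦_k^{norm} ∩ Re(𝒦_k)`: in `𝒦_k`, real for real fields, normalized for small polymers.
[cite: Dimock2013, §3.5 ("We also need the real closed subspace Re(𝒦_k^{norm}) = 𝒦_k^{norm} ∩ Re(𝒦_k)")] -/
def InReKnorm [NeZero c] (R : Set (TPt 3 n → ℂ)) (B : ℕ) (cube : TPt 3 n → TPt 3 c) (η Lr : ℝ) (E : PolyFun c n)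
    (κ : ℝ) : Prop :=
  InK R B cube E κ ∧ IsReal E ∧ IsNormalizedSmall η Lr cube E

/-- Linearity of a map on the subspace `𝒦_k` (the `𝓛_i` of Theorem 14 are *"linear operators"*), stated on members of
`𝒦_k` only. [cite: Dimock2013, §4.1 Theorem 14 ("where the 𝓛_i are linear operators")] -/
def IsLinearOn {V : Type*} [AddCommGroup V] [Module ℝ V] (K : PolyFun c n → Prop) (T : PolyFun c n → V) : Prop :=
  ∀ E₁ E₂, K E₁ → K E₂ → ∀ t s : ℝ, T (t • E₁ + s • E₂) = t • T E₁ + s • T E₂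

end Functionals

/-! ## §5. The representation (basic)–(basic3) on `𝒮_k` (I §4.1) -/

section Representation

variable (L Mx N k m : ℕ) [NeZero L]

/-- The `M`-cube (side `M = L^m`, i.e. `L^{k+m}` fine sites) containing a fine site, as an index in
`TPt 3 (L^(𝖬+𝖭−k−m))`. [cite: Dimock2013, §3.1 ("cubes □ with side of length M = L^m … which partition the lattice 𝕋^{−k}_{M+N−k}")] -/
def cubeOf (x : TPt 3 (L ^ (Mx + N))) : TPt 3 (L ^ (Mx + N - k - m)) := blk (L ^ (k + m)) _ x

/-- **The representation (basic)–(basic3)**: for `Φ_k ∈ 𝒮_k`,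
`ρ_k(Φ_k) = Z_k exp(−S_k(Φ_k, φ_k) − V_k(φ_k) + E_k(φ_k))`, `E_k(φ) = Σ_{X∈𝒟_k} E_k(X, φ)` evaluated at the real field
`φ_k = a_kG_kQ_kᵀΦ_k` (real part taken; `E_k` is real on real fields). [cite: Dimock2013, §4.1 eqs. (basic), (basic2), (basic3)] -/
def HasRep (a mubar lam : ℝ) (p : ℕ) (ρ : (TPt 3 (L ^ (Mx + N - k)) → ℝ) → ℝ) (Z εk μk : ℝ)
    (E : PolyFun (L ^ (Mx + N - k - m)) (L ^ (Mx + N))) : Prop :=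
  ∀ Φ ∈ SmallFieldSet L Mx N k a mubar lam p,
    ρ Φ = Z * Real.exp (-(Sk L Mx N k a mubar Φ (phiK L Mx N k a mubar Φ))
            - Vk L Mx N k εk μk (lamK L N k lam) (phiK L Mx N k a mubar Φ)
            + (∑ X ∈ polymers (L ^ (Mx + N - k - m)),
                E X (fun x => ((phiK L Mx N k a mubar Φ x : ℝ) : ℂ))).re)

end Representation

/-! ## §6. The modified renormalization-group step (understand) and `Z_{k+1}` (I §2.1, §2.3, §4.1) -/

section Step

variable (L Mx N k : ℕ) [NeZero L]

/-- One-step block averaging `Q` (unit lattice `𝕋⁰_{𝖬+𝖭−k}` → `L`-lattice `𝕋¹_{𝖬+𝖭−k}`):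
`(QΦ)(y) = L^{−3}Σ_{x∈B(y)}Φ(x)`. [cite: Dimock2013, §2.1 eq. (first0)/("(Qf)(y) = L^{−3} Σ_{x∈B(y)} f(x)")] -/
def Q1 : Matrix (TPt 3 (L ^ (Mx + N - (k + 1)))) (TPt 3 (L ^ (Mx + N - k))) ℝ :=
  Matrix.of fun y x => if blk L (L ^ (Mx + N - (k + 1))) x = y then (((L : ℝ) ^ 3)⁻¹) else 0

/-- `Qᵀ` (transpose w.r.t. `Σ` on `𝕋⁰` and `L³Σ` on `𝕋¹`): the injection `(QᵀΦ)(x) = Φ(y)`, `x ∈ B(y)`.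
[cite: Dimock2013, §2.1 ("(Qᵀf)(x) = f(y) if x ∈ B(y)")] -/
def Q1T : Matrix (TPt 3 (L ^ (Mx + N - k))) (TPt 3 (L ^ (Mx + N - (k + 1)))) ℝ :=
  Matrix.of fun x y => if blk L (L ^ (Mx + N - (k + 1))) x = y then 1 else 0

/-- `Q_{k+1} = QQ_k` from the fine lattice `𝕋^{−k}_{𝖬+𝖭−k}` to `𝕋¹_{𝖬+𝖭−k}` (blocks of `L^{k+1}` sites, weight
`L^{−3(k+1)}`). [cite: Dimock2013, §2.1 ("Let Q_k = Q^k be averaging operator over cubes B_k(y) with L^{3k} sites")] -/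
def QkSucc : Matrix (TPt 3 (L ^ (Mx + N - (k + 1)))) (TPt 3 (L ^ (Mx + N))) ℝ :=
  Matrix.of fun y x => if blk (L ^ (k + 1)) (L ^ (Mx + N - (k + 1))) x = y then (((L : ℝ) ^ (3 * (k + 1)))⁻¹) else 0

/-- `Q_{k+1}ᵀ` (weighted transpose): the injection. [cite: Dimock2013, §2.1 ("(Qᵀf)(x) = f(y) if x ∈ B(y)")] -/
def QkSuccT : Matrix (TPt 3 (L ^ (Mx + N))) (TPt 3 (L ^ (Mx + N - (k + 1)))) ℝ :=
  Matrix.of fun x y => if blk (L ^ (k + 1)) (L ^ (Mx + N - (k + 1))) x = y then 1 else 0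

/-- `G⁰_{k+1} = (−Δ + μ̄_k + a_{k+1}L^{−2}Q_{k+1}ᵀQ_{k+1})^{−1}` on functions on `𝕋^{−k}_{𝖬+𝖭−k}`.
[cite: Dimock2013, §2.3, the display before Lemma 3 ("G⁰_{k+1} = (−Δ + μ̄_k + a_{k+1}L^{−2}Qᵀ_{k+1}Q_{k+1})^{−1}")] -/
def G0succ (a mubar : ℝ) : Matrix (TPt 3 (L ^ (Mx + N))) (TPt 3 (L ^ (Mx + N))) ℝ :=
  (negLap (L ^ (Mx + N)) (eta L k) + mubarK L N k mubar • (1 : Matrix _ _ ℝ)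
    + (aK a L (k + 1) * ((L : ℝ) ^ 2)⁻¹) • (QkSuccT L Mx N k * QkSucc L Mx N k))⁻¹

/-- `φ⁰_{k+1}(Φ_{k+1}) = L^{−2}a_{k+1}G⁰_{k+1}Q_{k+1}ᵀΦ_{k+1}` for `Φ_{k+1}` on `𝕋¹_{𝖬+𝖭−k}` (Lemma 3).
[cite: Dimock2013, §2.3 Lemma 3 eq. (hunger)] -/
def phi0succ (a mubar : ℝ) (Φ₁ : TPt 3 (L ^ (Mx + N - (k + 1))) → ℝ) : TPt 3 (L ^ (Mx + N)) → ℝ :=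
  (((L : ℝ) ^ 2)⁻¹ * aK a L (k + 1)) • (G0succ L Mx N k a mubar *ᵥ (QkSuccT L Mx N k *ᵥ Φ₁))

/-- The free minimizer in `Φ_k` (Lemma 3, eq. (kingmaker)):
`Ψ_k(Φ_{k+1}, φ⁰_{k+1}) = Q_kφ⁰_{k+1} − (aL^{−2}/(a_k + aL^{−2}))QᵀQ_{k+1}φ⁰_{k+1} + (aL^{−2}/(a_k + aL^{−2}))QᵀΦ_{k+1}`,
evaluated at `φ⁰_{k+1} = φ⁰_{k+1}(Φ_{k+1})`. [cite: Dimock2013, §2.3 Lemma 3 eq. (kingmaker); §4.1 ("With the free minimizer Ψ_k = Ψ_k(Φ_{k+1}, φ⁰_{k+1}) defined in (kingmaker)")] -/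
def PsiK (a mubar : ℝ) (Φ₁ : TPt 3 (L ^ (Mx + N - (k + 1))) → ℝ) : TPt 3 (L ^ (Mx + N - k)) → ℝ :=
  let φ0 := phi0succ L Mx N k a mubar Φ₁
  let r : ℝ := (a * ((L : ℝ) ^ 2)⁻¹) / (aK a L k + a * ((L : ℝ) ^ 2)⁻¹)
  Qk L Mx N k *ᵥ φ0 - r • (Q1T L Mx N k *ᵥ (QkSucc L Mx N k *ᵥ φ0)) + r • (Q1T L Mx N k *ᵥ Φ₁)

/-- `D_k = C_k^{−1} = Δ_k + (a/L²)QᵀQ` on unit-lattice fields (Lemma 4: *"C_k = (Δ_k + (a/L²)QᵀQ)^{−1}"*), the Hessian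
of `J` in `Φ_k` w.r.t. the (unweighted) unit-lattice inner product. [cite: Dimock2013, §2.3 Lemma 4 ("C_k = (Δ_k + (a/L²)QᵀQ)^{−1}")] -/
def Dk (a mubar : ℝ) : Matrix (TPt 3 (L ^ (Mx + N - k))) (TPt 3 (L ^ (Mx + N - k))) ℝ :=
  Deltak L Mx N k a mubar + (a * ((L : ℝ) ^ 2)⁻¹) • (Q1T L Mx N k * Q1 L Mx N k)

/-- The Gaussian normaliser `𝒩_{a,Ω} = ∫exp(−½a|Φ|²)dΦ = (2π/a)^{|Ω|/2}`. [cite: Dimock2013, §2.1 footnote ("𝒩_{a,Ω} = (2π/a)^{|Ω|/2}")] -/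
def gaussNorm (a : ℝ) (card : ℕ) : ℝ := (2 * Real.pi / a) ^ ((card : ℝ) / 2)

/-- **The modified transformed density (understand)**, for `Φ_{k+1} : 𝕋¹_{𝖬+𝖭−k} → ℝ`:
`ρ̃_{k+1}(Φ_{k+1}) = 𝒩^{−1}_{aL,𝕋¹} ∫ exp(−½aL|Φ_{k+1} − QΦ_k|²) χ(|C_k^{−1/2}(Φ_k − Ψ_k)| ≤ p_{0,k}) χ(Φ_k ∈ 𝒮_k) ρ_k(Φ_k) dΦ_k`
(the second, unweighted form of (first0); `C_k^{−1/2}` = the positive square root `CFC.sqrt D_k`; `|·|` the sup norm;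
`p_{0,k} = (−log λ_k)^{p₀}`). [cite: Dimock2013, §4.1 eq. (understand) and the displays "χ^w_k(W) = χ(|W| ≤ p_{0,k}), χ_k(Φ_k) = χ(Φ_k ∈ 𝒮_k)", "p_{0,k} = p_0(λ_k) = (−log λ_k)^{p_0}"] -/
def rhoTilde (a mubar lam : ℝ) (p p₀ : ℕ) (ρ : (TPt 3 (L ^ (Mx + N - k)) → ℝ) → ℝ)
    (Φ₁ : TPt 3 (L ^ (Mx + N - (k + 1))) → ℝ) : ℝ :=
  (gaussNorm (a * L) (Fintype.card (TPt 3 (L ^ (Mx + N - (k + 1))))))⁻¹ *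
    ∫ Φ : TPt 3 (L ^ (Mx + N - k)) → ℝ,
      Real.exp (-(1 / 2 * (a * L) * normSqU (Φ₁ - Q1 L Mx N k *ᵥ Φ))) *
        Set.indicator {Φ' | ∀ x, |(CFC.sqrt (Dk L Mx N k a mubar) *ᵥ (Φ' - PsiK L Mx N k a mubar Φ₁)) x|
                          ≤ pK p₀ (lamK L N k lam)} (fun _ => (1 : ℝ)) Φ *
        Set.indicator (SmallFieldSet L Mx N k a mubar lam p) (fun _ => (1 : ℝ)) Φ * ρ Φ

/-- **The modified density after the step**, for `Φ_{k+1} : 𝕋⁰_{𝖬+𝖭−k−1} → ℝ`: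
`ρ_{k+1}(Φ_{k+1}) = ρ̃_{k+1}(Φ_{k+1,L}) L^{−|𝕋¹_{𝖬+𝖭−k}|/2}` with `Φ_{k+1,L}(x) = L^{−1/2}Φ_{k+1}(x/L)` (on the common index
set: `Φ ↦ L^{−1/2}Φ`). [cite: Dimock2013, §4.1 (the display after (understand)); §2.1 eq. (scaleddensity)] -/
def modStep (a mubar lam : ℝ) (p p₀ : ℕ) (ρ : (TPt 3 (L ^ (Mx + N - k)) → ℝ) → ℝ)
    (Φ : TPt 3 (L ^ (Mx + N - (k + 1))) → ℝ) : ℝ :=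
  rhoTilde L Mx N k a mubar lam p p₀ ρ ((((L : ℝ) ^ (1 / 2 : ℝ))⁻¹) • Φ) *
    ((L : ℝ) ^ ((Fintype.card (TPt 3 (L ^ (Mx + N - (k + 1)))) : ℝ) / 2))⁻¹

/-- **`Z_{k+1} = Z_k 𝒩^{−1}_{a,𝕋¹_{𝖬+𝖭−k}} (2π)^{|𝕋⁰_{𝖬+𝖭−k}|/2} (det C_k)^{1/2}`** — the global normalisation factor
(I Lemma 4 with `𝒩^{−1}_{aL}L^{−|𝕋¹|/2} = 𝒩^{−1}_a`; III Theorem 1 item 1 eq. (14)); `det C_k = (det D_k)^{−1}`.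
[cite: Dimock2013, §2.3 Lemma 4; Dimock2013BalabanIII, Theorem 1 item 1 eq. (14)] -/
def Znext (a mubar Z : ℝ) : ℝ :=
  Z * (gaussNorm a (Fintype.card (TPt 3 (L ^ (Mx + N - (k + 1))))))⁻¹ *
    (2 * Real.pi) ^ ((Fintype.card (TPt 3 (L ^ (Mx + N - k))) : ℝ) / 2) *
    ((Dk L Mx N k a mubar).det)⁻¹ ^ (1 / 2 : ℝ)

end Step

/-! ## §7. THEOREM 14 (`lanky`) as printed — the named fact -/

section Theorem14

/-- The data of one step at `(L, 𝖬, 𝖭, k, m)`: the space predicates at steps `k` and `k+1` packaged for readability —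
`KSet j κ E` := `E ∈ 𝒦_j` (domain `𝓡_j`, cube side `L^{j+m}`), `KnormSet j κ E` := `E ∈ Re 𝒦_j^{norm}`,
`NLe j κ E B` := `‖E‖_{j,κ} ≤ B`, for `j = k` (fine spacing `L^{−k}`) and `j = k + 1` (spacing `L^{−(k+1)}`).
[cite: Dimock2013, §3.3 Definition 3; §3.5 ("𝒦_k^{norm}")] -/
def KSet (L Mx N m j : ℕ) [NeZero L] (lam ε α κ : ℝ)
    (E : PolyFun (L ^ (Mx + N - j - m)) (L ^ (Mx + N))) : Prop :=
  InK (RDom (L ^ (Mx + N)) (eta L j) (lamK L N j lam) ε α) (L ^ (j + m)) (cubeOf L Mx N j m) E κ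

/-- `KnormSet j κ E` := `E ∈ Re 𝒦_j^{norm}` at step `j` (domain `𝓡_j`, cube side `L^{j+m}`, spacing `L^{−j}`,
small = `d_M < L`). [cite: Dimock2013, §3.5 ("Re(𝒦_k^{norm}) = 𝒦_k^{norm} ∩ Re(𝒦_k)")] -/
def KnormSet (L Mx N m j : ℕ) [NeZero L] (lam ε α κ : ℝ)
    (E : PolyFun (L ^ (Mx + N - j - m)) (L ^ (Mx + N))) : Prop :=
  InReKnorm (RDom (L ^ (Mx + N)) (eta L j) (lamK L N j lam) ε α) (L ^ (j + m)) (cubeOf L Mx N j m) (eta L j) L E κ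

/-- `NLe j κ E B` := `‖E‖_{j,κ} ≤ B` at step `j` (sup over `𝓡_j` and over the `M`-polymers, weight `e^{κ d_M(X)}`).
[cite: Dimock2013, §3.3 ("‖E‖_{k,κ} = sup_X ‖E(X)‖_k e^{κ d_M(X)}")] -/
def NLe (L Mx N m j : ℕ) [NeZero L] (lam ε α κ : ℝ)
    (E : PolyFun (L ^ (Mx + N - j - m)) (L ^ (Mx + N))) (B : ℝ) : Prop :=
  NormLe (RDom (L ^ (Mx + N)) (eta L j) (lamK L N j lam) ε α) E κ B

/-- **THEOREM 14 of [Dimock2013] (`\label{lanky}`), AS PRINTED — the single small-field renormalization-group step.**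
*"Let L, M be sufficiently large, let λ_k be sufficiently small (depending on L, M). Suppose ρ_k(Φ_k) has the
representation (basic)–(basic3) for Φ_k ∈ 𝒮_k and |μ_k| ≤ λ_k^{1/2}, ‖E_k‖_{k,κ} ≤ 1.  Then ρ_{k+1}(Φ_{k+1}) has a
representation of the same form for Φ_{k+1} ∈ 𝒮_{k+1}. The bounds are not the same but we do have
ε_{k+1} = L³ε_k + 𝓛₁E_k + ε_k^*(λ_k, μ_k, E_k),  μ_{k+1} = L²μ_k + 𝓛₂E_k + μ_k^*(λ_k, μ_k, E_k),  λ_{k+1} = Lλ_k,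
E_{k+1} = 𝓛₃E_k + E^*_k(λ_k, μ_k, E_k)  where the 𝓛_i are linear operators which satisfy
|𝓛₁E_k| ≤ 𝒪(1)L^{−ε}‖E_k‖_{k,κ},  |𝓛₂E_k| ≤ 𝒪(1)L^{−ε}λ_k^{1/2+6ε}‖E_k‖_{k,κ},  ‖𝓛₃E_k‖_{k+1,κ} ≤ 𝒪(1)L^{−ε}‖E_k‖_{k,κ}
and where  |ε_k^*| ≤ 𝒪(1)L³λ_k^{1/4−10ε},  |μ_k^*| ≤ 𝒪(1)L³λ_k^{3/4−4ε},  ‖E^*_k‖_{k+1,κ} ≤ 𝒪(1)L³λ_k^{1/4−10ε}."*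
Here `ρ_{k+1} = modStep … ρ_k` is the MODIFIED step (understand) applied to `ρ_k`, `Z_{k+1} = Znext … Z_k` (Lemma 4),
"representation of the same form" = `HasRep` at `k+1` with `E_{k+1} ∈ Re 𝒦_{k+1}^{norm}`; steps `k ≥ 1`; quantifier
reading, carriers and the explicit tiling side condition `m ≤ 𝖬 + 𝖭 − k − 1` as declared in the module docstring.
A published, refereed theorem typed as a named fact; NOT proved here, NOT asserted.
[cite: Dimock2013, §4.1 Theorem 14 (TeX \label{lanky}) with eq. (recursive) and the two bound displays; representation (basic)–(basic3); step (understand)] -/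
def Thm14Printed : Prop :=
  ∃ C : ℝ, 0 < C ∧
  ∀ (a mubar α : ℝ) (p p₀ : ℕ), 0 < a → 0 < mubar → mubar ≤ 1 → 1 / 2 < α → α < 1 → 0 < p₀ → p₀ < p →
  ∃ ε₀ : ℝ, 0 < ε₀ ∧ ∀ ε : ℝ, 0 < ε → ε ≤ ε₀ →
  ∃ κ₁ : ℝ, ∀ κ : ℝ, κ₁ ≤ κ →
  ∃ L₀ : ℕ, ∀ (L : ℕ) [NeZero L], L₀ ≤ L → Odd L →
  ∃ m₀ : ℕ, ∀ m : ℕ, m₀ ≤ m →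
  ∃ lamStar : ℝ, 0 < lamStar ∧
  ∀ (Mx N k : ℕ) (lam : ℝ), 1 ≤ k → k + 1 ≤ N → m ≤ Mx + N - (k + 1) → 0 < lam → lamK L N k lam ≤ lamStar →
  -- the step's fixed operators: 𝓛₁, 𝓛₂, 𝓛₃ linear on 𝒦_k, and the starred maps (λ_k is fixed here, so they take (μ_k, E_k))
  ∃ (L1 L2 : PolyFun (L ^ (Mx + N - k - m)) (L ^ (Mx + N)) → ℝ)
    (L3 : PolyFun (L ^ (Mx + N - k - m)) (L ^ (Mx + N)) → PolyFun (L ^ (Mx + N - (k + 1) - m)) (L ^ (Mx + N)))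
    (epsStar muStar : ℝ → PolyFun (L ^ (Mx + N - k - m)) (L ^ (Mx + N)) → ℝ)
    (EStar : ℝ → PolyFun (L ^ (Mx + N - k - m)) (L ^ (Mx + N)) → PolyFun (L ^ (Mx + N - (k + 1) - m)) (L ^ (Mx + N))),
    IsLinearOn (KSet L Mx N m k lam ε α κ) L1 ∧ IsLinearOn (KSet L Mx N m k lam ε α κ) L2 ∧
    IsLinearOn (KSet L Mx N m k lam ε α κ) L3 ∧
    -- the bounds on the linear operators
    (∀ E B, KSet L Mx N m k lam ε α κ E → NLe L Mx N m k lam ε α κ E B →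
        |L1 E| ≤ C * (L : ℝ) ^ (-ε) * B ∧
        |L2 E| ≤ C * (L : ℝ) ^ (-ε) * (lamK L N k lam) ^ (1 / 2 + 6 * ε) * B ∧
        NLe L Mx N m (k + 1) lam ε α κ (L3 E) (C * (L : ℝ) ^ (-ε) * B)) ∧
    -- the bounds on the starred terms, for data in the hypothesis class
    (∀ μk E, |μk| ≤ (lamK L N k lam) ^ (1 / 2 : ℝ) → KnormSet L Mx N m k lam ε α κ E →
        NLe L Mx N m k lam ε α κ E 1 →
        |epsStar μk E| ≤ C * (L : ℝ) ^ 3 * (lamK L N k lam) ^ (1 / 4 - 10 * ε) ∧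
        |muStar μk E| ≤ C * (L : ℝ) ^ 3 * (lamK L N k lam) ^ (3 / 4 - 4 * ε) ∧
        NLe L Mx N m (k + 1) lam ε α κ (EStar μk E) (C * (L : ℝ) ^ 3 * (lamK L N k lam) ^ (1 / 4 - 10 * ε))) ∧
    -- the step: representation at k ⟹ representation at k+1 with the recursion (recursive)
    ∀ (ρ : (TPt 3 (L ^ (Mx + N - k)) → ℝ) → ℝ) (Z εk μk : ℝ) (E : PolyFun (L ^ (Mx + N - k - m)) (L ^ (Mx + N))),
      |μk| ≤ (lamK L N k lam) ^ (1 / 2 : ℝ) → KnormSet L Mx N m k lam ε α κ E → NLe L Mx N m k lam ε α κ E 1 →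
      HasRep L Mx N k m a mubar lam p ρ Z εk μk E →
      KnormSet L Mx N m (k + 1) lam ε α κ (L3 E + EStar μk E) ∧
      HasRep L Mx N (k + 1) m a mubar lam p (modStep L Mx N k a mubar lam p p₀ ρ) (Znext L Mx N k a mubar Z)
        ((L : ℝ) ^ 3 * εk + L1 E + epsStar μk E) ((L : ℝ) ^ 2 * μk + L2 E + muStar μk E) (L3 E + EStar μk E)

end Theorem14

/-! ## §8 (v1.1, append-only). The start `k = 0`, the iterated modified densities `ρ_k`, and THEOREM 14 iterated
along THEOREM 24's counterterm trajectory — the small-field theorem of part I as one closed named fact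

Every v1 declaration above is byte-identical.  Printed text used here (corpus chunks p0016, p0021–p0023 of
`paper:arxiv-1108.1335`), verbatim: §4.1 *"The starting point is still the density ρ_0(Φ_0) = exp(−S_0(Φ_0) − V_0(Φ_0))
where … S_0(Φ_0) = ½‖∂Φ_0‖² + ½μ̄_0‖Φ_0‖², V_0(Φ_0) = ε_0Vol(𝕋⁰_{𝖬+𝖭}) + ½μ_0‖Φ_0‖² + ¼λ_0Σ_xΦ_0(x)⁴.  But now instead
of (kth) we add some characteristic functions and define ρ_k recursively as follows"* (the step (understand)); §5
*"Thus the equations of interest are (recursive3) … Keep in mind that the quantities ε_k, μ_k, λ_k, E_k determine a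
density ρ_k on the lattice 𝕋⁰_{𝖬+𝖭−k} as given by (basic) … Our goal is to show that for any 𝖭 we can choose the initial
point so that the solution exists for k = 0, 1, …, K with K = 𝖭 − Δ and Δ ≥ 0 independent of 𝖭 … we look for solutions
ε_k, μ_k, E_k for k = 0, 1, 2, …, K satisfying ε_K = 0, μ_K = 0, E_0 = 0 (bc).  This is non-perturbative
renormalization - the initial values for ε, μ will depend on K and hence N"*, *"0 < β < ¼ − 10ε"*, *"λ_K = λ^𝖭_K =
L^{−(𝖭−K)}λ = L^{−Δ}λ is sufficiently small. This can be arranged either by taking λ small (in which case we can take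
Δ = 0 and K = 𝖭), or more generally by taking Δ large"*; THEOREM 24 (`\label{gsf}`): *"Let λ_K = L^{−Δ}λ be sufficiently
small. Then for N ≥ Δ there is a unique sequence ε_k, μ_k, E_k for k = 0, 1, 2, …, K = 𝖭 − Δ satisfying the dynamical
equation (recursive3), the boundary conditions (bc), and |μ_k| ≤ λ_k^{½+β}, ‖E_k‖_{k,κ} ≤ λ_k^β.  Furthermore
|ε_k| ≤ 𝒪(1)λ_k^β."*

What is added: the `k = 0` objects (at `k = 0` one has formally `a_0 = ∞`, `Q_0 = 1`, `φ_0 = Φ_0`, so the generic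
`aK ∕ phiK ∕ Sk ∕ SmallFieldSet ∕ PsiK ∕ Dk ∕ Znext` of §§2–6 are NOT used at `k = 0`): `S0`, `rho0`, `SmallFieldSet0`
(Definition 1 with `φ_0 = Φ_0`: the first condition is void), `D0 = Δ_0 + aL⁻²QᵀQ` with `Δ_0 = −Δ + μ̄_0`, `Ψ_0 = φ⁰_1`
(Lemma 3 with `a_0 = ∞`), the first modified step `modStep0` and `Znext0`; the ITERATED modified densities
`modDensity k` ((understand) applied `k` times to `ρ_0`); and the named fact **`SmallFieldTrajectoryPrinted`** =
Theorem 14 iterated from `ρ_0` along the counterterm trajectory of Theorem 24 (existence part; uniqueness not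
re-typed), i.e. the content of part I for the concrete modified model: for every cut-off there are initial counterterms
`(ε^𝖭_0, μ^𝖭_0)` such that for ALL `1 ≤ k ≤ K` the modified density `ρ_k` restricted to `𝒮_k` has the representation
(basic)–(basic3) with `E_k ∈ Re 𝒦_k^{norm}`, `‖E_k‖_{k,κ} ≤ λ_k^β`, `|μ_k| ≤ λ_k^{½+β}`, `|ε_k| ≤ 𝒪(1)λ_k^β`, and
`ε_K = μ_K = 0` (the recursion (recursive3) linking consecutive `(ε_k, μ_k, E_k)` is not re-encoded — only its printed consequences, the bounds and the representations, are; a weakening).  A published theorem (Theorems 14 + 24 of [Dimock2013]) typed as a named fact; NOT proved, NOT asserted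
(Theorem 24's dynamical-systems part is PROVED abstractly in `…Dimock2011to13.SmallFieldFlow.flow_exists_unique`; the
concrete analytic input, Theorem 14 = `Thm14Printed` above, is not). -/

section Trajectory

variable (L Mx N : ℕ) [NeZero L]

/-- `S_0(Φ_0) = ½‖∂Φ_0‖² + ½μ̄_0‖Φ_0‖²` on the unit lattice `𝕋⁰_{𝖬+𝖭}` (spacing `1`). [cite: Dimock2013, §4.1 ("S_0(Φ_0) = ½‖∂Φ_0‖² + ½ μ̄_0 ‖Φ_0‖²")] -/
def S0 (mubar : ℝ) (Φ : TPt 3 (L ^ (Mx + N - 0)) → ℝ) : ℝ :=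
  1 / 2 * gradSqF 1 Φ + 1 / 2 * mubarK L N 0 mubar * normSqF 1 Φ

/-- The starting density `ρ_0(Φ_0) = exp(−S_0(Φ_0) − V_0(Φ_0))`, `V_0 = ε_0Vol + ½μ_0‖Φ_0‖² + ¼λ_0ΣΦ_0⁴` with the initial
counterterms `(ε_0, μ_0) = (ε^𝖭_0, μ^𝖭_0)` and `λ_0 = L^{−𝖭}λ`. [cite: Dimock2013, §4.1 ("ρ_0(Φ_0) = exp(−S_0(Φ_0) − V_0(Φ_0))"); §1.3] -/
def rho0 (mubar lam ε0 μ0 : ℝ) (Φ : TPt 3 (L ^ (Mx + N - 0)) → ℝ) : ℝ :=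
  Real.exp (-(S0 L Mx N mubar Φ + Vk L Mx N 0 ε0 μ0 (lamK L N 0 lam) Φ))

/-- `𝒮_0` — Definition 1 at `k = 0`, where `φ_0 = Φ_0` (so `|Φ_0 − Q_0φ_0| ≤ p_0` is void): `|∂Φ_0| ≤ p_0`,
`|Φ_0| ≤ λ_0^{−1/4}p_0`. [cite: Dimock2013, §3.2 Definition 1 (k = 0); §4.1 ("The starting point is still the density ρ_0")] -/
def SmallFieldSet0 (lam : ℝ) (p : ℕ) : Set (TPt 3 (L ^ (Mx + N - 0)) → ℝ) :=
  {Φ | (∀ x (μ : Fin 3), |fd (1 : ℝ) Φ μ x| ≤ pK p (lamK L N 0 lam)) ∧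
       (∀ x, |Φ x| ≤ (lamK L N 0 lam) ^ (-(1 / 4 : ℝ)) * pK p (lamK L N 0 lam))}

/-- `D_0 = C_0^{−1} = Δ_0 + (a/L²)QᵀQ` with `Δ_0 = −Δ + μ̄_0` (the Hessian of `S_0`; Lemma 4 at `k = 0`).
[cite: Dimock2013, §2.3 Lemma 4 ("C_k = (Δ_k + (a/L²)QᵀQ)^{−1}") at k = 0; §2.2 eq. (spiffy)] -/
def D0 (a mubar : ℝ) : Matrix (TPt 3 (L ^ (Mx + N - 0))) (TPt 3 (L ^ (Mx + N - 0))) ℝ :=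
  negLap (L ^ (Mx + N - 0)) 1 + mubarK L N 0 mubar • (1 : Matrix _ _ ℝ)
    + (a * ((L : ℝ) ^ 2)⁻¹) • (Q1T L Mx N 0 * Q1 L Mx N 0)

/-- **The first modified step** (understand) at `k = 0`: as `rhoTilde`/`modStep` but with `𝒮_0`, `C_0^{−1/2} = CFC.sqrt D_0`
and the free minimizer `Ψ_0(Φ_1) = φ⁰_1(Φ_1) = L^{−2}a_1G⁰_1Q_1ᵀΦ_1` (Lemma 3 with `a_0 = ∞`, `Q_0 = 1`).
[cite: Dimock2013, §4.1 eq. (understand) (k = 0); §2.3 Lemma 3 eqs. (hunger), (kingmaker)] -/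
def modStep0 (a mubar lam : ℝ) (p p₀ : ℕ) (ρ : (TPt 3 (L ^ (Mx + N - 0)) → ℝ) → ℝ)
    (Φ : TPt 3 (L ^ (Mx + N - (0 + 1))) → ℝ) : ℝ :=
  let Φ₁ : TPt 3 (L ^ (Mx + N - (0 + 1))) → ℝ := (((L : ℝ) ^ (1 / 2 : ℝ))⁻¹) • Φ
  (gaussNorm (a * L) (Fintype.card (TPt 3 (L ^ (Mx + N - (0 + 1))))))⁻¹ *
    (∫ Φ0 : TPt 3 (L ^ (Mx + N - 0)) → ℝ,
      Real.exp (-(1 / 2 * (a * L) * normSqU (Φ₁ - Q1 L Mx N 0 *ᵥ Φ0))) *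
        Set.indicator {Φ' | ∀ x, |(CFC.sqrt (D0 L Mx N a mubar) *ᵥ (Φ' - phi0succ L Mx N 0 a mubar Φ₁)) x|
                          ≤ pK p₀ (lamK L N 0 lam)} (fun _ => (1 : ℝ)) Φ0 *
        Set.indicator (SmallFieldSet0 L Mx N lam p) (fun _ => (1 : ℝ)) Φ0 * ρ Φ0) *
    ((L : ℝ) ^ ((Fintype.card (TPt 3 (L ^ (Mx + N - (0 + 1)))) : ℝ) / 2))⁻¹

/-- `Z_1 = Z_0 𝒩^{−1}_{a,𝕋¹}(2π)^{|𝕋⁰_{𝖬+𝖭}|/2}(det C_0)^{1/2}` with `Z_0 = 1`, `C_0 = D_0^{−1}`. [cite: Dimock2013, §2.3 Lemma 4 (k = 0); Dimock2013BalabanIII, Theorem 1 item 1 eq. (14) ("Z_0 = 1")] -/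
def Znext0 (a mubar : ℝ) : ℝ :=
  (gaussNorm a (Fintype.card (TPt 3 (L ^ (Mx + N - (0 + 1))))))⁻¹ *
    (2 * Real.pi) ^ ((Fintype.card (TPt 3 (L ^ (Mx + N - 0))) : ℝ) / 2) *
    ((D0 L Mx N a mubar).det)⁻¹ ^ (1 / 2 : ℝ)

/-- **The modified densities `ρ_k`, `k = 0, 1, 2, …`**: `ρ_0 = exp(−S_0 − V_0)` and `ρ_{k+1}` = the modified step
(understand) applied to `ρ_k` (*"define ρ_k recursively as follows"*). [cite: Dimock2013, §4.1 eq. (understand) ("we add some characteristic functions and define ρ_k recursively")] -/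
def modDensity (a mubar lam : ℝ) (p p₀ : ℕ) (ε0 μ0 : ℝ) :
    (k : ℕ) → ((TPt 3 (L ^ (Mx + N - k)) → ℝ) → ℝ)
  | 0 => rho0 L Mx N mubar lam ε0 μ0
  | 1 => modStep0 L Mx N a mubar lam p p₀ (rho0 L Mx N mubar lam ε0 μ0)
  | k + 2 => modStep L Mx N (k + 1) a mubar lam p p₀ (modDensity a mubar lam p p₀ ε0 μ0 (k + 1))

/-- The normalisation sequence `Z_k` of the trajectory: `Z_0 = 1`, `Z_1 = Znext0`, `Z_{k+2} = Znext (k+1) Z_{k+1}`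
(I Lemma 4 ∕ III (14)). [cite: Dimock2013, §2.3 Lemma 4; Dimock2013BalabanIII, Theorem 1 item 1 eq. (14)] -/
def Zseq (a mubar : ℝ) : ℕ → ℝ
  | 0 => 1
  | 1 => Znext0 L Mx N a mubar
  | k + 2 => Znext L Mx N (k + 1) a mubar (Zseq a mubar (k + 1))

end Trajectory

/-- **THEOREMS 14 + 24 of [Dimock2013] combined, AS PRINTED, on the concrete modified model — the small-field theorem of
part I.**  With `K = 𝖭 − Δ` and `λ_K = L^{−Δ}λ` sufficiently small (depending on `L, M`; `0 < β < ¼ − 10ε`): there are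
initial counterterms `(ε_0, μ_0) = (ε^𝖭_0, μ^𝖭_0)` (*"the initial values for ε, μ will depend on K and hence N"*) and a
sequence `(ε_k, μ_k, E_k)_{0≤k≤K}` with `E_0 = 0`, `ε_K = 0`, `μ_K = 0` (bc), `|μ_k| ≤ λ_k^{½+β}`, `‖E_k‖_{k,κ} ≤ λ_k^β`,
`|ε_k| ≤ 𝒪(1)λ_k^β` (Theorem 24), such that for every `1 ≤ k ≤ K` the modified density `ρ_k = modDensity … k` has, for
`Φ_k ∈ 𝒮_k`, the representation (basic)–(basic3) `ρ_k(Φ_k) = Z_k exp(−S_k(Φ_k, φ_k) − V_k(φ_k) + E_k(φ_k))` with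
`E_k ∈ Re 𝒦_k^{norm}` and `Z_k = Zseq … k` (Theorem 14 iterated from `ρ_0`, whose hypotheses `|μ_k| ≤ λ_k^{1/2}`,
`‖E_k‖_{k,κ} ≤ 1` hold along the trajectory: *"well within the allowed region"*).  Quantifier reading as for
`Thm14Printed`; the smallness is on `λ_K` only (uniform in `𝖬`, `𝖭`); explicit side conditions `Δ ≤ 𝖭` (print: "for
N ≥ Δ") and `m ≤ 𝖬 + Δ` (the `M`-cubes tile the last torus `𝕋_{𝖬+Δ}`; implicit in print).  Uniqueness of the trajectory
is not re-typed.  A published, refereed theorem typed as a named fact; NOT proved here, NOT asserted.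
[cite: Dimock2013, §5 Theorem 24 (TeX \label{gsf}) with (bc), (recursive3), eq. (somewhat) and "|ε_k| ≤ 𝒪(1)λ_k^β"; §4.1 Theorem 14 (\label{lanky}); §5 ("the quantities ε_k, μ_k, λ_k, E_k determine a density ρ_k … as given by (basic)")] -/
def SmallFieldTrajectoryPrinted : Prop :=
  ∃ C : ℝ, 0 < C ∧
  ∀ (a mubar α : ℝ) (p p₀ : ℕ), 0 < a → 0 < mubar → mubar ≤ 1 → 1 / 2 < α → α < 1 → 0 < p₀ → p₀ < p →
  ∃ ε₀ : ℝ, 0 < ε₀ ∧ ∀ ε : ℝ, 0 < ε → ε ≤ ε₀ →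
  ∀ β : ℝ, 0 < β → β < 1 / 4 - 10 * ε →
  ∃ κ₁ : ℝ, ∀ κ : ℝ, κ₁ ≤ κ →
  ∃ L₀ : ℕ, ∀ (L : ℕ) [NeZero L], L₀ ≤ L → Odd L →
  ∃ m₀ : ℕ, ∀ m : ℕ, m₀ ≤ m →
  ∃ lamStar : ℝ, 0 < lamStar ∧
  ∀ (Mx N Δ : ℕ) (lam : ℝ), 0 < lam → Δ ≤ N → m ≤ Mx + Δ → lamK L N (N - Δ) lam ≤ lamStar →
  ∃ (eps mu : ℕ → ℝ) (E : (k : ℕ) → PolyFun (L ^ (Mx + N - k - m)) (L ^ (Mx + N))),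
    -- boundary conditions (bc) and Theorem 24's bounds along 0 ≤ k ≤ K = N − Δ
    E 0 = 0 ∧ eps (N - Δ) = 0 ∧ mu (N - Δ) = 0 ∧
    (∀ k, k ≤ N - Δ →
        |mu k| ≤ (lamK L N k lam) ^ (1 / 2 + β) ∧ |eps k| ≤ C * (lamK L N k lam) ^ β ∧
        NLe L Mx N m k lam ε α κ (E k) ((lamK L N k lam) ^ β)) ∧
    -- Theorem 14 iterated from ρ_0 along the trajectory: the representation (basic)–(basic3) of the modified
    -- densities for 1 ≤ k ≤ K (the recursion (recursive3) itself is not re-encoded — only its consequences)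
    (∀ k, 1 ≤ k → k ≤ N - Δ →
        KnormSet L Mx N m k lam ε α κ (E k) ∧
        HasRep L Mx N k m a mubar lam p (modDensity L Mx N a mubar lam p p₀ (eps 0) (mu 0) k)
          (Zseq L Mx N a mubar k) (eps k) (mu k) (E k))

/-! ## §9 (v1.2, append-only). PROVED API for the concrete vocabulary: the printed algebra of I §2.1–2.2 and §5 on the
torus objects, non-vacuity of the spaces, and the endpoint corollary of `SmallFieldTrajectoryPrinted`

Every v1 ∕ v1.1 declaration above is byte-identical; this section adds THEOREMS only (no `def`, no named fact, no
`_holds` of the two facts).  Printed text used (corpus `paper:arxiv-1108.1335`, chunks p0005–p0006, p0016, p0022),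
verbatim: §2.1 *"Then QQᵀ=I while QᵀQ is a projection operator onto the range of Qᵀ which is functions constant on the
cubes"*, *"The various averaging operators can be composed into a single averaging operation over large cubes. Let
Q_k = Q^k be averaging operator over cubes B_k(y) with L^{3k} sites (L^k on a side)"*, *"taking account that
𝒩^{−1}_{aL,𝕋¹}L^{−|𝕋¹|/2} = 𝒩^{−1}_{a,𝕋¹}"*; Lemma 2 *"a_k = a(1−L^{−2})/(1−L^{−2k})"* and, in its proof, *"Now define
a_{k+1} = a_k a/(a_k + aL^{−2})"*; Theorem 14 (recursive) *"λ_{k+1} = Lλ_k"*; §5 *"λ_K = λ^N_K = L^{−(N−K)}λ = L^{−Δ}λ"*,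
*"we have λ_k ≤ λ_K small and |μ_k|λ_k^{−1/2} ≤ λ_k^β, ‖E_k‖_{k,κ} ≤ λ_k^β which is well within the allowed region
|μ_k|λ_k^{−1/2} ≤ 1, ‖E_k‖_{k,κ} ≤ 1"*, *"Then at k = K we are on the lattice 𝕋⁰_{𝖬+𝖭−K} = 𝕋⁰_{𝖬+Δ} and can make
estimates on ρ_K uniformly in 𝖭 (for small fields)"*.

**What is proved.**  (a) Block algebra on the concrete tori, in Dimock's WEIGHTED normalisation (`Qk` carries `L^{−3k}`,
`QkT` is the bare injection — not the isometric `TorusBlockAveraging.Qt` of the lineage): the corner block maps compose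
across scales (`blk_blk`, `blk_succ`: `⌊⌊x/L^k⌋/L⌋ = ⌊x/L^{k+1}⌋` — statable because `blk` is modulus-free;
`TorusBlockAveraging` records composition as not claimed for `tcoarse`), hence **`Q_{k+1} = QQ_k`**
(`QkSucc_eq_Q1_mul_Qk`) and `Q_{k+1}ᵀ = Q_kᵀQᵀ` (`QkSuccT_eq_QkT_mul_Q1T`); the cubes have exactly `B³` ∕ `L^{3k}`
sites (`card_filter_div_eq`, `card_filter_blk`), hence **`QQᵀ = I`** for the three averaging ∕ injection pairs of this
file (`Q1_mul_Q1T`, `Qk_mul_QkT`, `QkSucc_mul_QkSuccT`, from the generic `avg_mul_inj`), `QᵀQ` idempotent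
(`Q1T_mul_Q1_idem`, `QkT_mul_Qk_idem`) with range exactly the block-constant functions (`QkT_mul_Qk_mulVec`,
`QkT_mul_Qk_mulVec_eq_self_iff`).  (b) Parameter algebra: `eta_zero ∕ eta_succ`, `lamK_succ` (λ_{k+1} = Lλ_k),
`lamK_top` (λ_𝖭 = λ), `lamK_zero`, `lamK_end` (λ_K = L^{−Δ}λ), `lamK_mono` (λ_k ≤ λ_K), `lamK_nonneg ∕ lamK_pos`,
`mubarK_succ` (μ̄_{k+1} = L²μ̄_k), `aK_one` (a_1 = a), `aK_pos`, `aK_succ` (Lemma 2's recursion), `gaussNorm_pos`,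
`gaussNorm_scale` (𝒩^{−1}_{aL}L^{−|Ω|/2} = 𝒩^{−1}_a, the identity behind `Znext`).  (c) Unfolding of the trajectory
(`Zseq_zero ∕ one ∕ succ_succ`, `modDensity_zero ∕ one ∕ succ_succ`).  (d) Non-vacuity: `0 ∈ 𝒮_k` (`zero_mem_SmallFieldSet`,
`zero_mem_SmallFieldSet0`), `0 ∈ 𝓡_k` (`zero_mem_RDom`, via `tsep_pos`), `0 ∈ 𝒦_k`, `0 ∈ Re 𝒦_k^{norm}` (`InK_zero`,
`InReKnorm_zero`, `KSet_zero`, `KnormSet_zero`: the boundary condition `E_0 = 0` of (bc) is an admissible point of the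
space), `NormLe` ∕ `NLe` monotone in the bound and antitone in `κ`, and `within_thm14_region` (Theorem 24's bounds ⟹
Theorem 14's hypotheses once `0 < λ_k ≤ 1`, `β ≥ 0`).  (e) **`SmallFieldTrajectoryPrinted.endpoint`** — the corollary a
consumer cites by name: at `k = K = 𝖭 − Δ ≥ 1` the `K`-fold modified density has the representation (basic)–(basic3)
with `ε_K = μ_K = 0` (no energy ∕ mass counterterm left: *"the total mass at level K is then μ̄_K"*) and
`‖E_K‖_{K,κ} ≤ λ_K^β`, smallness imposed on `λ_K = L^{−Δ}λ` only, i.e. uniformly in `𝖭`; PROVED from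
`(h : SmallFieldTrajectoryPrinted)`, nothing asserted unconditionally.

**HONEST FRAMING.**  These are elementary identities and sanity statements about the hypothesis-free definitions of
§§1–8 and one proved implication from a named fact; they do not prove Theorem 14 or Theorem 24 (whose named facts stay
unasserted), do not touch papers II–III, and bear on nothing Yang–Mills.  R141 (D) item (8), seat ym-lit-type-8 gen 2. -/

open Literature.MathematicalPhysics.QuantumFieldTheory.Balaban1983to89.TreeLengthTorus (torusTreeLen_nonneg)

section ParameterAlgebra

/-- `η_0 = 1` (the unit lattice). [cite: Dimock2013, §2.1] -/
theorem eta_zero (L : ℕ) : eta L 0 = 1 := by simp [eta]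

/-- `η_{k+1} = η_k / L`. [cite: Dimock2013, §2.1] -/
theorem eta_succ (L k : ℕ) : eta L (k + 1) = eta L k / L := by
  rw [eta, eta, pow_succ, mul_inv, div_eq_mul_inv]

/-- **`λ_{k+1} = Lλ_k`** for `k + 1 ≤ 𝖭`. [cite: Dimock2013, §4.1 Theorem 14 eq. (recursive) ("λ_{k+1} = Lλ_k"); §3.1] -/
theorem lamK_succ (L N k : ℕ) [NeZero L] (lam : ℝ) (hk : k + 1 ≤ N) :
    lamK L N (k + 1) lam = L * lamK L N k lam := by
  unfold lamK
  have hL : (L : ℝ) ≠ 0 := by exact_mod_cast NeZero.ne L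
  have : N - k = (N - (k + 1)) + 1 := by omega
  rw [this, pow_succ, mul_inv]
  field_simp

/-- `λ_𝖭 = λ` (the bare coupling at the top scale). [cite: Dimock2013, §3.1 ("λ_k = L^{−(N−k)} λ")] -/
theorem lamK_top (L N : ℕ) (lam : ℝ) : lamK L N N lam = lam := by simp [lamK]

/-- `λ_0 = L^{−𝖭}λ`. [cite: Dimock2013, §5 ("λ_0 = λ_0^N = L^{−N}λ")] -/
theorem lamK_zero (L N : ℕ) (lam : ℝ) : lamK L N 0 lam = ((L : ℝ) ^ N)⁻¹ * lam := by simp [lamK]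

/-- **`λ_K = L^{−Δ}λ`** at `K = 𝖭 − Δ`. [cite: Dimock2013, §5 ("λ_K = λ^N_K = L^{−(N−K)}λ = L^{−Δ}λ")] -/
theorem lamK_end (L N Δ : ℕ) (lam : ℝ) (hΔ : Δ ≤ N) : lamK L N (N - Δ) lam = ((L : ℝ) ^ Δ)⁻¹ * lam := by
  simp [lamK, Nat.sub_sub_self hΔ]

/-- `λ_k ≤ λ_K` for `k ≤ K` (`L ≥ 1`, `λ ≥ 0`). [cite: Dimock2013, §5 ("we have λ_k ≤ λ_K small")] -/
theorem lamK_mono (L N k K : ℕ) (lam : ℝ) (hL : 1 ≤ L) (hlam : 0 ≤ lam) (hk : k ≤ K) :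
    lamK L N k lam ≤ lamK L N K lam := by
  unfold lamK
  apply mul_le_mul_of_nonneg_right _ hlam
  have hL' : (1 : ℝ) ≤ L := by exact_mod_cast hL
  apply inv_anti₀ (pow_pos (by linarith) _)
  exact pow_le_pow_right₀ hL' (Nat.sub_le_sub_left hk N)

/-- `0 ≤ λ_k` for `λ ≥ 0`. [cite: Dimock2013, §3.1 ("λ_k = L^{−(N−k)} λ")] -/
theorem lamK_nonneg (L N k : ℕ) {lam : ℝ} (hlam : 0 ≤ lam) : 0 ≤ lamK L N k lam := by
  unfold lamK; positivity

/-- `0 < λ_k` for `λ > 0`, `L ≥ 1`. [cite: Dimock2013, §3.1 ("λ_k = L^{−(N−k)} λ")] -/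
theorem lamK_pos (L N k : ℕ) [NeZero L] {lam : ℝ} (hlam : 0 < lam) : 0 < lamK L N k lam := by
  unfold lamK
  have hL : (0 : ℝ) < L := by exact_mod_cast Nat.pos_of_ne_zero (NeZero.ne L)
  positivity

/-- **`μ̄_{k+1} = L²μ̄_k`** for `k + 1 ≤ 𝖭`. [cite: Dimock2013, §2.2 ("μ̄_k = L^{2k} μ̄_0")] -/
theorem mubarK_succ (L N k : ℕ) [NeZero L] (mubar : ℝ) (hk : k + 1 ≤ N) :
    mubarK L N (k + 1) mubar = (L : ℝ) ^ 2 * mubarK L N k mubar := by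
  unfold mubarK
  have hL : (L : ℝ) ≠ 0 := by exact_mod_cast NeZero.ne L
  have : 2 * (N - k) = 2 * (N - (k + 1)) + 2 := by omega
  rw [this, pow_add, mul_inv]
  field_simp

/-- **`a_1 = a`** (`L > 1`). [cite: Dimock2013, §2.1 Lemma 2 ("a_k = a (1−L^{−2})/(1−L^{−2k})")] -/
theorem aK_one (a : ℝ) (L : ℕ) (hL : 1 < L) : aK a L 1 = a := by
  unfold aK
  have hL2 : (1 : ℝ) < (L : ℝ) ^ 2 := by exact_mod_cast Nat.one_lt_pow two_ne_zero hL
  have h2 : (L : ℝ) ^ 2 - 1 ≠ 0 := ne_of_gt (by linarith)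
  rw [mul_one]
  field_simp

/-- `0 < a_k` for `a > 0`, `L > 1`, `k ≥ 1`. [cite: Dimock2013, §2.1 Lemma 2] -/
theorem aK_pos {a : ℝ} {L k : ℕ} (ha : 0 < a) (hL : 1 < L) (hk : 1 ≤ k) : 0 < aK a L k := by
  unfold aK
  have hL2 : (1 : ℝ) < (L : ℝ) ^ 2 := by exact_mod_cast Nat.one_lt_pow two_ne_zero hL
  have hq0 : 0 < ((L : ℝ) ^ 2)⁻¹ := by positivity
  have hq1 : ((L : ℝ) ^ 2)⁻¹ < 1 := inv_lt_one_of_one_lt₀ hL2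
  have e1 : ((L : ℝ) ^ (2 * k))⁻¹ = (((L : ℝ) ^ 2)⁻¹) ^ k := by rw [pow_mul, inv_pow]
  rw [e1]
  have hk1 : (((L : ℝ) ^ 2)⁻¹) ^ k < 1 := pow_lt_one₀ hq0.le hq1 (by omega)
  apply div_pos (mul_pos ha (by linarith)) (by linarith)

/-- **`a_{k+1} = a_k a/(a_k + aL^{−2})`** (`L > 1`, `k ≥ 1`) — the recursion in the proof of Lemma 2.
[cite: Dimock2013, §2.1, proof of Lemma 2 ("Now define a_{k+1} = a_k a/(a_k + aL^{−2})")] -/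
theorem aK_succ (a : ℝ) (L k : ℕ) (hL : 1 < L) (hk : 1 ≤ k) :
    aK a L (k + 1) = aK a L k * a / (aK a L k + a * ((L : ℝ) ^ 2)⁻¹) := by
  unfold aK
  have hL2 : (1 : ℝ) < (L : ℝ) ^ 2 := by exact_mod_cast Nat.one_lt_pow two_ne_zero hL
  have hq0 : 0 < ((L : ℝ) ^ 2)⁻¹ := by positivity
  have hq1 : ((L : ℝ) ^ 2)⁻¹ < 1 := inv_lt_one_of_one_lt₀ hL2
  have e1 : ((L : ℝ) ^ (2 * k))⁻¹ = (((L : ℝ) ^ 2)⁻¹) ^ k := by rw [pow_mul, inv_pow]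
  have e2 : ((L : ℝ) ^ (2 * (k + 1)))⁻¹ = (((L : ℝ) ^ 2)⁻¹) ^ (k + 1) := by rw [pow_mul, inv_pow]
  rw [e1, e2]
  generalize ((L : ℝ) ^ 2)⁻¹ = q at hq0 hq1 ⊢
  have hk1 : 1 - q ^ k ≠ 0 := by
    have := pow_lt_one₀ hq0.le hq1 (by omega : k ≠ 0); linarith
  have hk2 : 1 - q ^ (k + 1) ≠ 0 := by
    have := pow_lt_one₀ hq0.le hq1 (by omega : k + 1 ≠ 0); linarith
  rcases eq_or_ne a 0 with rfl | ha
  · simp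
  have hA : a * (1 - q) / (1 - q ^ k) + a * q = a * (1 - q ^ (k + 1)) / (1 - q ^ k) := by
    rw [div_add' _ _ _ hk1]
    congr 1
    ring
  have hden : a * (1 - q) / (1 - q ^ k) + a * q ≠ 0 := by
    rw [hA, div_ne_zero_iff]
    exact ⟨mul_ne_zero ha hk2, hk1⟩
  rw [div_eq_div_iff hk2 hden, hA]
  ring

/-- `𝒩_{a,Ω} > 0` for `a > 0`. [cite: Dimock2013, §2.1 footnote ("𝒩_{a,Ω} = (2π/a)^{|Ω|/2}")] -/
theorem gaussNorm_pos {a : ℝ} (ha : 0 < a) (card : ℕ) : 0 < gaussNorm a card := by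
  unfold gaussNorm; positivity

/-- **`𝒩⁻¹_{aL,Ω} L^{−|Ω|/2} = 𝒩⁻¹_{a,Ω}`** — the identity behind `Z_{k+1}` (`Znext` uses `𝒩_a`, the step (understand)
uses `𝒩_{aL}` and the rescaling factor `L^{−|𝕋¹|/2}`). [cite: Dimock2013, §2.1 ("taking account that 𝒩^{−1}_{aL,𝕋¹_{M+N}} L^{−|𝕋¹_{M+N}|/2} = 𝒩^{−1}_{a,𝕋¹_{M+N}}")] -/
theorem gaussNorm_scale {a : ℝ} {L : ℕ} (ha : 0 < a) (hL : 0 < L) (card : ℕ) :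
    (gaussNorm (a * L) card)⁻¹ * ((L : ℝ) ^ ((card : ℝ) / 2))⁻¹ = (gaussNorm a card)⁻¹ := by
  unfold gaussNorm
  have hL' : (0 : ℝ) < L := by exact_mod_cast hL
  rw [← mul_inv, ← Real.mul_rpow (by positivity) hL'.le]
  congr 2
  field_simp

end ParameterAlgebra

section TrajectoryUnfolding

variable (L Mx N : ℕ) [NeZero L] (a mubar lam : ℝ) (p p₀ : ℕ) (ε0 μ0 : ℝ)

/-- `Z_0 = 1`. [cite: Dimock2013BalabanIII, Theorem 1 item 1 eq. (14) ("Z_0 = 1")] -/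
@[simp] theorem Zseq_zero : Zseq L Mx N a mubar 0 = 1 := rfl

/-- `Z_1 = Z_0 𝒩⁻¹_{a,𝕋¹}(2π)^{|𝕋⁰|/2}(det C_0)^{1/2}`. [cite: Dimock2013, §2.3 Lemma 4 (k = 0)] -/
@[simp] theorem Zseq_one : Zseq L Mx N a mubar 1 = Znext0 L Mx N a mubar := rfl

/-- `Z_{k+2} = Znext_{k+1}(Z_{k+1})`. [cite: Dimock2013, §2.3 Lemma 4] -/
theorem Zseq_succ_succ (k : ℕ) :
    Zseq L Mx N a mubar (k + 2) = Znext L Mx N (k + 1) a mubar (Zseq L Mx N a mubar (k + 1)) := rfl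

/-- `ρ_0 = exp(−S_0 − V_0)`. [cite: Dimock2013, §4.1 ("The starting point is still the density ρ_0")] -/
@[simp] theorem modDensity_zero :
    modDensity L Mx N a mubar lam p p₀ ε0 μ0 0 = rho0 L Mx N mubar lam ε0 μ0 := rfl

/-- `ρ_1` = the first modified step applied to `ρ_0`. [cite: Dimock2013, §4.1 eq. (understand) (k = 0)] -/
@[simp] theorem modDensity_one :
    modDensity L Mx N a mubar lam p p₀ ε0 μ0 1 = modStep0 L Mx N a mubar lam p p₀ (rho0 L Mx N mubar lam ε0 μ0) := rfl

/-- `ρ_{k+2}` = the modified step at level `k+1` applied to `ρ_{k+1}`. [cite: Dimock2013, §4.1 eq. (understand)] -/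
theorem modDensity_succ_succ (k : ℕ) :
    modDensity L Mx N a mubar lam p p₀ ε0 μ0 (k + 2)
      = modStep L Mx N (k + 1) a mubar lam p p₀ (modDensity L Mx N a mubar lam p p₀ ε0 μ0 (k + 1)) := rfl

end TrajectoryUnfolding

section BlockAlgebra

/-- The integer coordinate of a block index: `(blk B c x)_i = ⌊x_i/B⌋` whenever `⌊x_i/B⌋ < c`. [cite: Dimock2013, §2.1 ("B(y) is cubes of L³ sites (L on a side)")] -/
theorem blk_val (B c : ℕ) {n : ℕ} (x : TPt 3 n) (i : Fin 3) (h : (x i).val / B < c) :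
    ((blk B c x) i).val = (x i).val / B := by
  simp only [blk]
  rw [ZMod.val_natCast, Nat.mod_eq_of_lt h]

/-- **Block maps compose**: `⌊⌊x/B⌋/B'⌋ = ⌊x/(BB')⌋` componentwise (no overflow at the intermediate modulus).
[cite: Dimock2013, §2.1 ("The various averaging operators can be composed into a single averaging operation over large cubes. Let Q_k = Q^k")] -/
theorem blk_blk (B B' c c' : ℕ) {n : ℕ} (x : TPt 3 n) (h : ∀ i, (x i).val / B < c) :
    blk B' c' (blk B c x) = blk (B * B') c' x := by
  funext i
  simp only [blk]
  rw [ZMod.val_natCast, Nat.mod_eq_of_lt (h i), Nat.div_div_eq_div_mul]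

/-- On the fine torus `𝕋^{−k}_{𝖬+𝖭−k}` (`L^{𝖬+𝖭}` sites per direction): the `L^{k+1}`-block of `x` is the `L`-block of
its `L^k`-block, `k ≤ 𝖬 + 𝖭`, any target modulus. [cite: Dimock2013, §2.1 ("Let Q_k = Q^k be averaging operator over cubes B_k(y) with L^{3k} sites")] -/
theorem blk_succ {L Mx N : ℕ} [NeZero L] (k c' : ℕ) (hk : k ≤ Mx + N) (x : TPt 3 (L ^ (Mx + N))) :
    blk L c' (blk (L ^ k) (L ^ (Mx + N - k)) x) = blk (L ^ (k + 1)) c' x := by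
  rw [blk_blk, pow_succ]
  intro i
  apply Nat.div_lt_of_lt_mul
  rw [← pow_add, Nat.add_sub_cancel' hk]
  exact ZMod.val_lt (x i)

variable (L Mx N : ℕ) [NeZero L]

/-- **`Q_{k+1} = QQ_k`** on the concrete tori (Dimock's weights `L^{−3}·L^{−3k} = L^{−3(k+1)}`), `k ≤ 𝖬 + 𝖭`.
[cite: Dimock2013, §2.1 ("Let Q_k = Q^k be averaging operator over cubes B_k(y) with L^{3k} sites (L^k on a side)")] -/
theorem QkSucc_eq_Q1_mul_Qk (k : ℕ) (hk : k ≤ Mx + N) :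
    QkSucc L Mx N k = Q1 L Mx N k * Qk L Mx N k := by
  ext y x
  simp only [QkSucc, Q1, Qk, Matrix.mul_apply, Matrix.of_apply, mul_ite, mul_zero, Finset.sum_ite_eq,
    Finset.mem_univ, if_true]
  rw [blk_succ k _ hk x]
  split_ifs
  · rw [← mul_inv, ← pow_add]; ring_nf
  · simp

/-- **`Q_{k+1}ᵀ = Q_kᵀQᵀ`** (the injections compose), `k ≤ 𝖬 + 𝖭`. [cite: Dimock2013, §2.1 ("Q_k = Q^k"; "(Qᵀf)(x) = f(y) if x ∈ B(y)")] -/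
theorem QkSuccT_eq_QkT_mul_Q1T (k : ℕ) (hk : k ≤ Mx + N) :
    QkSuccT L Mx N k = QkT L Mx N k * Q1T L Mx N k := by
  ext x y
  simp only [QkSuccT, Q1T, QkT, Matrix.mul_apply, Matrix.of_apply, ite_mul, one_mul, zero_mul,
    Finset.sum_ite_eq, Finset.mem_univ, if_true]
  rw [blk_succ k _ hk x]

/-- One coordinate: the sites `t ∈ ℤ/n` with `⌊t/B⌋ ≡ s`, `n = Bc`, number exactly `B`. [cite: Dimock2013, §2.1 ("B(y) is cubes of L³ sites (L on a side)")] -/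
theorem card_filter_div_eq (B c n : ℕ) [NeZero n] [NeZero c] (hn : n = B * c) (s : ZMod c) :
    (Finset.univ.filter (fun t : ZMod n => ((t.val / B : ℕ) : ZMod c) = s)).card = B := by
  classical
  have hB : 0 < B := by
    rcases Nat.eq_zero_or_pos B with h | h
    · exact absurd (by simpa [h] using hn) (NeZero.ne n)
    · exact h
  have hs : s.val < c := ZMod.val_lt s
  have himg : Finset.univ.filter (fun t : ZMod n => ((t.val / B : ℕ) : ZMod c) = s)
      = (Finset.range B).image (fun r => ((s.val * B + r : ℕ) : ZMod n)) := by
    ext t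
    simp only [Finset.mem_filter, Finset.mem_univ, true_and, Finset.mem_image, Finset.mem_range]
    constructor
    · intro ht
      refine ⟨t.val % B, Nat.mod_lt _ hB, ?_⟩
      have h1 : t.val / B < c := Nat.div_lt_of_lt_mul (lt_of_lt_of_eq (ZMod.val_lt t) hn)
      have h2 : t.val / B = s.val := by
        have := congrArg ZMod.val ht
        rwa [ZMod.val_natCast, Nat.mod_eq_of_lt h1] at this
      have h3 : s.val * B + t.val % B = t.val := by
        rw [← h2]; exact Nat.div_add_mod' (ZMod.val t) B
      rw [h3, ZMod.natCast_zmod_val]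
    · rintro ⟨r, hr, rfl⟩
      have hlt : s.val * B + r < n := by
        rw [hn]
        calc s.val * B + r < s.val * B + B := by omega
          _ = (s.val + 1) * B := by ring
          _ ≤ c * B := Nat.mul_le_mul_right _ (by omega)
          _ = B * c := by ring
      rw [ZMod.val_natCast, Nat.mod_eq_of_lt hlt]
      have : (s.val * B + r) / B = s.val := by
        rw [Nat.add_comm, Nat.add_mul_div_right _ _ hB, Nat.div_eq_of_lt hr, zero_add]
      rw [this, ZMod.natCast_zmod_val]
  rw [himg, Finset.card_image_of_injOn, Finset.card_range]
  intro r hr r' hr' h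
  simp only [Finset.coe_range, Set.mem_Iio] at hr hr'
  have hlt : ∀ r, r < B → s.val * B + r < n := by
    intro r hr
    rw [hn]
    calc s.val * B + r < s.val * B + B := by omega
      _ = (s.val + 1) * B := by ring
      _ ≤ c * B := Nat.mul_le_mul_right _ (by omega)
      _ = B * c := by ring
  have h1 := congrArg ZMod.val h
  simp only [ZMod.val_natCast, Nat.mod_eq_of_lt (hlt r hr), Nat.mod_eq_of_lt (hlt r' hr')] at h1
  omega

/-- **`#B(y) = B³` exactly**: the fibre of the block map `blk B c` on `(ℤ/n)³`, `n = Bc`, has `B³` sites — *"B(y) is cubes of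
L³ sites (L on a side)"*, *"cubes B_k(y) with L^{3k} sites (L^k on a side)"*. [cite: Dimock2013, §2.1] -/
theorem card_filter_blk (B c n : ℕ) [NeZero n] [NeZero c] (hn : n = B * c) (y : TPt 3 c) :
    (Finset.univ.filter (fun x : TPt 3 n => blk B c x = y)).card = B ^ 3 := by
  classical
  have hset : Finset.univ.filter (fun x : TPt 3 n => blk B c x = y)
      = Fintype.piFinset (fun i => Finset.univ.filter (fun t : ZMod n => ((t.val / B : ℕ) : ZMod c) = y i)) := by
    ext x
    simp only [Finset.mem_filter, Finset.mem_univ, true_and, Fintype.mem_piFinset, blk, funext_iff]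
  rw [hset, Fintype.card_piFinset]
  simp only [card_filter_div_eq B c n hn, Finset.prod_const, Finset.card_univ, Fintype.card_fin]

/-- Generic form of *"QQᵀ = I"*: (weight-`w` block average) × (injection) `= wB³·1` on `(ℤ/c)³`, `n = Bc`.
[cite: Dimock2013, §2.1 ("Then QQᵀ = I")] -/
theorem avg_mul_inj (B c n : ℕ) [NeZero n] [NeZero c] (hn : n = B * c) (w : ℝ) :
    (Matrix.of fun (y : TPt 3 c) (x : TPt 3 n) => if blk B c x = y then w else 0) *
      (Matrix.of fun (x : TPt 3 n) (y : TPt 3 c) => if blk B c x = y then (1 : ℝ) else 0)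
    = (w * (B : ℝ) ^ 3) • (1 : Matrix (TPt 3 c) (TPt 3 c) ℝ) := by
  classical
  have hsum : ∀ y y' : TPt 3 c,
      (∑ x : TPt 3 n, (if blk B c x = y then w else 0) * (if blk B c x = y' then (1 : ℝ) else 0))
        = if y = y' then w * (B : ℝ) ^ 3 else 0 := by
    intro y y'
    split_ifs with h
    · subst h
      have hx : ∀ x : TPt 3 n, (if blk B c x = y then w else 0) * (if blk B c x = y then (1 : ℝ) else 0)
          = if blk B c x = y then w else 0 := by
        intro x; split_ifs <;> simp
      simp_rw [hx]
      rw [Finset.sum_ite, Finset.sum_const_zero, add_zero, Finset.sum_const, card_filter_blk B c n hn y,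
        nsmul_eq_mul]
      push_cast; ring
    · apply Finset.sum_eq_zero
      intro x _
      split_ifs with h1 h2
      · exact absurd (h1.symm.trans h2) h
      all_goals simp
  ext y y'
  rw [Matrix.mul_apply, Matrix.smul_apply, Matrix.one_apply]
  simp only [Matrix.of_apply]
  rw [hsum, smul_eq_mul, mul_ite, mul_one, mul_zero]

/-- **`QQᵀ = I`** for the one-step pair (`Q1`, `Q1T`) at level `k` (`k + 1 ≤ 𝖬 + 𝖭`), in Dimock's weighted normalisation.
[cite: Dimock2013, §2.1 ("Then QQᵀ = I")] -/
theorem Q1_mul_Q1T (k : ℕ) (hk : k + 1 ≤ Mx + N) : Q1 L Mx N k * Q1T L Mx N k = 1 := by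
  have hL : (L : ℝ) ≠ 0 := by exact_mod_cast NeZero.ne L
  have hn : L ^ (Mx + N - k) = L * L ^ (Mx + N - (k + 1)) := by
    rw [← pow_succ']; congr 1; omega
  have h := avg_mul_inj L (L ^ (Mx + N - (k + 1))) (L ^ (Mx + N - k)) hn (((L : ℝ) ^ 3)⁻¹)
  rw [inv_mul_cancel₀ (pow_ne_zero 3 hL), one_smul] at h
  exact h

/-- **`Q_kQ_kᵀ = I`** (`k ≤ 𝖬 + 𝖭`): the `L^k`-cubes have exactly `L^{3k}` sites. [cite: Dimock2013, §2.1 ("QQᵀ = I"; "Q_k = Q^k … cubes B_k(y) with L^{3k} sites")] -/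
theorem Qk_mul_QkT (k : ℕ) (hk : k ≤ Mx + N) : Qk L Mx N k * QkT L Mx N k = 1 := by
  have hL : (L : ℝ) ≠ 0 := by exact_mod_cast NeZero.ne L
  have hn : L ^ (Mx + N) = L ^ k * L ^ (Mx + N - k) := by rw [← pow_add, Nat.add_sub_cancel' hk]
  have h := avg_mul_inj (L ^ k) (L ^ (Mx + N - k)) (L ^ (Mx + N)) hn (((L : ℝ) ^ (3 * k))⁻¹)
  have hw : ((L : ℝ) ^ (3 * k))⁻¹ * ((L ^ k : ℕ) : ℝ) ^ 3 = 1 := by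
    push_cast
    rw [← pow_mul, mul_comm k 3, inv_mul_cancel₀ (pow_ne_zero _ hL)]
  rw [hw, one_smul] at h
  exact h

/-- **`Q_{k+1}Q_{k+1}ᵀ = I`** (`k + 1 ≤ 𝖬 + 𝖭`). [cite: Dimock2013, §2.1 ("QQᵀ = I"; "Q_k = Q^k")] -/
theorem QkSucc_mul_QkSuccT (k : ℕ) (hk : k + 1 ≤ Mx + N) : QkSucc L Mx N k * QkSuccT L Mx N k = 1 := by
  have hL : (L : ℝ) ≠ 0 := by exact_mod_cast NeZero.ne L
  have hn : L ^ (Mx + N) = L ^ (k + 1) * L ^ (Mx + N - (k + 1)) := by rw [← pow_add, Nat.add_sub_cancel' hk]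
  have h := avg_mul_inj (L ^ (k + 1)) (L ^ (Mx + N - (k + 1))) (L ^ (Mx + N)) hn (((L : ℝ) ^ (3 * (k + 1)))⁻¹)
  have hw : ((L : ℝ) ^ (3 * (k + 1)))⁻¹ * ((L ^ (k + 1) : ℕ) : ℝ) ^ 3 = 1 := by
    push_cast
    rw [← pow_mul, mul_comm (k + 1) 3, inv_mul_cancel₀ (pow_ne_zero _ hL)]
  rw [hw, one_smul] at h
  exact h

/-- **`QᵀQ` is a projection**: `(QᵀQ)² = QᵀQ`. [cite: Dimock2013, §2.1 ("QᵀQ is a projection operator onto the range of Qᵀ which is functions constant on the cubes")] -/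
theorem Q1T_mul_Q1_idem (k : ℕ) (hk : k + 1 ≤ Mx + N) :
    (Q1T L Mx N k * Q1 L Mx N k) * (Q1T L Mx N k * Q1 L Mx N k) = Q1T L Mx N k * Q1 L Mx N k := by
  rw [Matrix.mul_assoc, ← Matrix.mul_assoc (Q1 L Mx N k), Q1_mul_Q1T L Mx N k hk, Matrix.one_mul]

/-- `Q_kᵀQ_k` is a projection. [cite: Dimock2013, §2.1] -/
theorem QkT_mul_Qk_idem (k : ℕ) (hk : k ≤ Mx + N) :
    (QkT L Mx N k * Qk L Mx N k) * (QkT L Mx N k * Qk L Mx N k) = QkT L Mx N k * Qk L Mx N k := by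
  rw [Matrix.mul_assoc, ← Matrix.mul_assoc (Qk L Mx N k), Qk_mul_QkT L Mx N k hk, Matrix.one_mul]

/-- The matrix of `Q_kᵀQ_k`: `(Q_kᵀQ_k)(x, x′) = L^{−3k}·[x′ ∈ B_k(x)]`. [cite: Dimock2013, §2.1] -/
theorem QkT_mul_Qk_apply (k : ℕ) (x x' : TPt 3 (L ^ (Mx + N))) :
    (QkT L Mx N k * Qk L Mx N k) x x' =
      if blk (L ^ k) (L ^ (Mx + N - k)) x' = blk (L ^ k) (L ^ (Mx + N - k)) x then ((L : ℝ) ^ (3 * k))⁻¹ else 0 := by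
  simp only [QkT, Qk, Matrix.mul_apply, Matrix.of_apply, ite_mul, one_mul, zero_mul, Finset.sum_ite_eq,
    Finset.mem_univ, if_true]

/-- `(Q_kᵀQ_kf)(x)` is the average of `f` over the `L^k`-cube of `x`. [cite: Dimock2013, §2.1] -/
theorem QkT_mul_Qk_mulVec (k : ℕ) (f : TPt 3 (L ^ (Mx + N)) → ℝ) (x : TPt 3 (L ^ (Mx + N))) :
    ((QkT L Mx N k * Qk L Mx N k) *ᵥ f) x =
      ((L : ℝ) ^ (3 * k))⁻¹ *
        ∑ x' ∈ Finset.univ.filter (fun x' => blk (L ^ k) (L ^ (Mx + N - k)) x' = blk (L ^ k) (L ^ (Mx + N - k)) x),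
          f x' := by
  simp only [Matrix.mulVec, dotProduct, QkT_mul_Qk_apply, ite_mul, zero_mul, Finset.sum_ite, Finset.sum_const_zero,
    add_zero, Finset.mul_sum]

/-- **`QᵀQ` projects onto the functions constant on the cubes**: `Q_kᵀQ_kf = f` iff `f` is constant on every `L^k`-cube
(`k ≤ 𝖬 + 𝖭`). [cite: Dimock2013, §2.1 ("QᵀQ is a projection operator onto the range of Qᵀ which is functions constant on the cubes")] -/
theorem QkT_mul_Qk_mulVec_eq_self_iff (k : ℕ) (hk : k ≤ Mx + N) (f : TPt 3 (L ^ (Mx + N)) → ℝ) :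
    (QkT L Mx N k * Qk L Mx N k) *ᵥ f = f ↔
      ∀ x x', blk (L ^ k) (L ^ (Mx + N - k)) x = blk (L ^ k) (L ^ (Mx + N - k)) x' → f x = f x' := by
  have hL : (L : ℝ) ≠ 0 := by exact_mod_cast NeZero.ne L
  have hn : L ^ (Mx + N) = L ^ k * L ^ (Mx + N - k) := by rw [← pow_add, Nat.add_sub_cancel' hk]
  constructor
  · intro h x x' hxx'
    have hx := congrFun h x
    have hx' := congrFun h x'
    rw [QkT_mul_Qk_mulVec] at hx hx'
    rw [← hx, ← hx', hxx']
  · intro h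
    funext x
    rw [QkT_mul_Qk_mulVec]
    have hc : ∑ x' ∈ Finset.univ.filter
          (fun x' : TPt 3 (L ^ (Mx + N)) => blk (L ^ k) (L ^ (Mx + N - k)) x' = blk (L ^ k) (L ^ (Mx + N - k)) x), f x'
        = ∑ x' ∈ Finset.univ.filter
          (fun x' : TPt 3 (L ^ (Mx + N)) => blk (L ^ k) (L ^ (Mx + N - k)) x' = blk (L ^ k) (L ^ (Mx + N - k)) x),
            f x := by
      apply Finset.sum_congr rfl
      intro x' hx'
      rw [Finset.mem_filter] at hx'
      exact (h x x' hx'.2.symm).symm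
    rw [hc, Finset.sum_const, card_filter_blk (L ^ k) (L ^ (Mx + N - k)) (L ^ (Mx + N)) hn, nsmul_eq_mul]
    push_cast
    rw [← mul_assoc, ← pow_mul, mul_comm k 3, inv_mul_cancel₀ (pow_ne_zero _ hL), one_mul]

end BlockAlgebra

section NonVacuity

variable (L Mx N k : ℕ) [NeZero L]

/-- `φ_k(0) = 0` (`φ_k = a_kG_kQ_kᵀΦ_k` is linear). [cite: Dimock2013, §2.2 ("φ_k(Φ_k) = a_k G_k Q_kᵀ Φ_k")] -/
@[simp] theorem phiK_zero (a mubar : ℝ) : phiK L Mx N k a mubar 0 = 0 := by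
  simp [phiK]

/-- `p_k ≥ 0` when `0 ≤ λ_k ≤ 1`. [cite: Dimock2013, §3.2 ("p_k = (−log λ_k)^p")] -/
theorem pK_nonneg (p : ℕ) {lamk : ℝ} (h0 : 0 ≤ lamk) (h1 : lamk ≤ 1) : 0 ≤ pK p lamk :=
  pow_nonneg (neg_nonneg.mpr (Real.log_nonpos h0 h1)) p

/-- **`𝒮_k` is non-empty**: the zero field is a small field (`0 < λ_k ≤ 1`). [cite: Dimock2013, §3.2 Definition 1] -/
theorem zero_mem_SmallFieldSet (a mubar lam : ℝ) (p : ℕ) (h0 : 0 ≤ lamK L N k lam) (h1 : lamK L N k lam ≤ 1) :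
    (0 : TPt 3 (L ^ (Mx + N - k)) → ℝ) ∈ SmallFieldSet L Mx N k a mubar lam p := by
  have hp := pK_nonneg p h0 h1
  refine ⟨fun y => ?_, fun x μ => ?_, fun x => ?_⟩
  · simpa using hp
  · simpa [fd] using hp
  · simp only [phiK_zero, Pi.zero_apply, abs_zero]
    exact mul_nonneg (Real.rpow_nonneg h0 _) hp

omit [NeZero L] in
/-- `𝒮_0` is non-empty. [cite: Dimock2013, §3.2 Definition 1 (k = 0)] -/
theorem zero_mem_SmallFieldSet0 (lam : ℝ) (p : ℕ) (h0 : 0 ≤ lamK L N 0 lam) (h1 : lamK L N 0 lam ≤ 1) :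
    (0 : TPt 3 (L ^ (Mx + N - 0)) → ℝ) ∈ SmallFieldSet0 L Mx N lam p := by
  have hp := pK_nonneg p h0 h1
  refine ⟨fun x μ => ?_, fun x => ?_⟩
  · simpa [fd] using hp
  · simp only [Pi.zero_apply, abs_zero]
    exact mul_nonneg (Real.rpow_nonneg h0 _) hp

/-- Distinct torus sites are at sup-distance `≥ 1` (integer units). [cite: Dimock2013, §2.1 ("The distance is |x−y| = sup_μ |x_μ − y_μ|")] -/
theorem tsep_pos {n : ℕ} {x x' : TPt 3 n} (h : x ≠ x') : 0 < tsep x x' := by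
  obtain ⟨μ, hμ⟩ : ∃ μ, x μ ≠ x' μ := Function.ne_iff.mp h
  unfold tsep
  have h1 : 0 < min (x μ - x' μ).val (x' μ - x μ).val := by
    apply lt_min
    · rw [Nat.pos_iff_ne_zero, ne_eq, ZMod.val_eq_zero, sub_eq_zero]; exact hμ
    · rw [Nat.pos_iff_ne_zero, ne_eq, ZMod.val_eq_zero, sub_eq_zero]; exact Ne.symm hμ
  exact lt_of_lt_of_le h1 (Finset.le_sup (f := fun μ : Fin 3 => min (x μ - x' μ).val (x' μ - x μ).val)
    (Finset.mem_univ μ))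

/-- **`𝓡_k` is non-empty**: the zero field lies in the analyticity domain (`λ_k > 0`, `η > 0`). [cite: Dimock2013, §3.2 Definition 2] -/
theorem zero_mem_RDom (n : ℕ) (η lamk ε α : ℝ) (hη : 0 < η) (h0 : 0 < lamk) :
    (0 : TPt 3 n → ℂ) ∈ RDom n η lamk ε α := by
  refine ⟨fun x => ?_, fun x μ => ?_, fun μ x x' hxx' _ => ?_⟩
  · simpa using Real.rpow_pos_of_pos h0 _
  · simpa [fd] using Real.rpow_pos_of_pos h0 _
  · simp only [fd, Pi.zero_apply, sub_self, zero_div, norm_zero]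
    exact mul_pos (Real.rpow_pos_of_pos h0 _)
      (Real.rpow_pos_of_pos (mul_pos hη (by exact_mod_cast tsep_pos hxx')) _)

variable {c n : ℕ}

/-- The second derivative of the zero functional vanishes. [cite: Dimock2013, §3.5 ("E_n(X, φ; f_1, …, f_n) = ∂^n/∂t_1⋯∂t_n E(X, φ + t_1f_1 + ⋯ + t_nf_n)|_{t_i=0}")] -/
@[simp] theorem E2_zero (X : Finset (TPt 3 c)) (φ f₁ f₂ : TPt 3 n → ℂ) : E2 (0 : PolyFun c n) X φ f₁ f₂ = 0 := by
  simp [E2]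

/-- `‖0‖_{k,κ} ≤ B` for every `B ≥ 0`. [cite: Dimock2013, §3.3 ("‖E‖_{k,κ} = sup_X ‖E(X)‖_k e^{κ d_M(X)}")] -/
theorem NormLe_zero [NeZero c] (R : Set (TPt 3 n → ℂ)) (κ B : ℝ) (hB : 0 ≤ B) : NormLe R (0 : PolyFun c n) κ B := by
  intro X _ φ _
  simpa using hB

/-- Monotonicity of the norm bound in `B`. [cite: Dimock2013, §3.3] -/
theorem NormLe.mono [NeZero c] {R : Set (TPt 3 n → ℂ)} {E : PolyFun c n} {κ B B' : ℝ} (h : NormLe R E κ B)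
    (hBB' : B ≤ B') : NormLe R E κ B' :=
  fun X hX φ hφ => (h X hX φ hφ).trans hBB'

/-- The weighted norms decrease in `κ`: `‖E‖_{k,κ'} ≤ ‖E‖_{k,κ}` for `κ' ≤ κ` (`d_M ≥ 0`). [cite: Dimock2013, §3.3] -/
theorem NormLe.anti [NeZero c] {R : Set (TPt 3 n → ℂ)} {E : PolyFun c n} {κ κ' B : ℝ} (h : NormLe R E κ B)
    (hκ : κ' ≤ κ) : NormLe R E κ' B := by
  intro X hX φ hφ
  refine le_trans ?_ (h X hX φ hφ)
  apply mul_le_mul_of_nonneg_left _ (norm_nonneg _)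
  exact Real.exp_le_exp.mpr (mul_le_mul_of_nonneg_right hκ (torusTreeLen_nonneg X))

/-- **`0 ∈ 𝒦_k`**. [cite: Dimock2013, §3.3 Definition 3] -/
theorem InK_zero [NeZero c] (R : Set (TPt 3 n → ℂ)) (B : ℕ) (cube : TPt 3 n → TPt 3 c) (κ : ℝ) :
    InK R B cube (0 : PolyFun c n) κ := by
  refine ⟨fun X φ ψ _ => rfl, fun X _ => ?_, ⟨0, NormLe_zero R κ 0 le_rfl⟩, fun X φ => rfl, fun g X ψ => rfl⟩
  simp

/-- **`0 ∈ Re 𝒦_k^{norm}`** — the boundary condition `E_0 = 0` of (bc) lies in the space. [cite: Dimock2013, §3.5; §5 eq. (bc) ("E_0 = 0")] -/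
theorem InReKnorm_zero [NeZero c] (R : Set (TPt 3 n → ℂ)) (B : ℕ) (cube : TPt 3 n → TPt 3 c) (η Lr κ : ℝ) :
    InReKnorm R B cube η Lr (0 : PolyFun c n) κ := by
  refine ⟨InK_zero R B cube κ, fun X φ => by simp, fun X _ _ => ⟨rfl, E2_zero _ _ _ _, fun μ x₀ _ => E2_zero _ _ _ _⟩⟩

/-- `0 ∈ 𝒦_j` at every step `j`. [cite: Dimock2013, §3.3 Definition 3] -/
theorem KSet_zero (m j : ℕ) (lam ε α κ : ℝ) : KSet L Mx N m j lam ε α κ 0 := InK_zero _ _ _ _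

/-- `0 ∈ Re 𝒦_j^{norm}` at every step `j` (so `E_0 = 0` is an admissible start). [cite: Dimock2013, §5 eq. (bc)] -/
theorem KnormSet_zero (m j : ℕ) (lam ε α κ : ℝ) : KnormSet L Mx N m j lam ε α κ 0 := InReKnorm_zero _ _ _ _ _ _

/-- `‖0‖_{j,κ} ≤ B` for `B ≥ 0`. [cite: Dimock2013, §3.3 ("‖E‖_{k,κ}")] -/
theorem NLe_zero (m j : ℕ) (lam ε α κ : ℝ) {B : ℝ} (hB : 0 ≤ B) : NLe L Mx N m j lam ε α κ 0 B :=
  NormLe_zero _ _ _ hB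

variable {L Mx N}

/-- Monotonicity of `NLe` in the bound. [cite: Dimock2013, §3.3 ("‖E‖_{k,κ}")] -/
theorem NLe.mono {m j : ℕ} {lam ε α κ : ℝ} {E : PolyFun (L ^ (Mx + N - j - m)) (L ^ (Mx + N))} {B B' : ℝ}
    (h : NLe L Mx N m j lam ε α κ E B) (hBB' : B ≤ B') : NLe L Mx N m j lam ε α κ E B' :=
  NormLe.mono h hBB'

/-- **The trajectory stays "well within the allowed region"**: Theorem 24's bounds `|μ_k| ≤ λ_k^{½+β}`,
`‖E_k‖_{k,κ} ≤ λ_k^β` imply Theorem 14's hypotheses `|μ_k| ≤ λ_k^{1/2}`, `‖E_k‖_{k,κ} ≤ 1` once `0 < λ_k ≤ 1`, `β ≥ 0`.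
[cite: Dimock2013, §5 ("which is well within the allowed region |μ_k|λ_k^{−1/2} ≤ 1, ‖E_k‖_{k,κ} ≤ 1")] -/
theorem within_thm14_region {m j : ℕ} {lam ε α κ β μ : ℝ} {E : PolyFun (L ^ (Mx + N - j - m)) (L ^ (Mx + N))}
    (h0 : 0 < lamK L N j lam) (h1 : lamK L N j lam ≤ 1) (hβ : 0 ≤ β)
    (hμ : |μ| ≤ (lamK L N j lam) ^ (1 / 2 + β)) (hE : NLe L Mx N m j lam ε α κ E ((lamK L N j lam) ^ β)) :
    |μ| ≤ (lamK L N j lam) ^ (1 / 2 : ℝ) ∧ NLe L Mx N m j lam ε α κ E 1 := by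
  constructor
  · exact hμ.trans (Real.rpow_le_rpow_of_exponent_ge h0 h1 (by linarith))
  · exact hE.mono (Real.rpow_le_one h0.le h1 hβ)

end NonVacuity

/-! ### §9.5 Consumer corollary: the endpoint of the trajectory, uniformly in `𝖭` -/

/-- **COROLLARY of `SmallFieldTrajectoryPrinted` (PROVED from it): the ENDPOINT `k = K = 𝖭 − Δ`, uniformly in the
cut-off `𝖭`.**  Verbatim context: *"Then at k = K we are on the lattice 𝕋⁰_{𝖬+𝖭−K} = 𝕋⁰_{𝖬+Δ} and can make estimates on
ρ_K uniformly in 𝖭 (for small fields)"*, *"ε_K = 0, μ_K = 0 … Note that the total mass at level K is then μ̄_K + μ_K =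
μ̄_K"* (§5).  Statement: under the quantifier prefix of `SmallFieldTrajectoryPrinted` (smallness on `λ_K = L^{−Δ}λ` only)
and `K ≥ 1`, there are initial counterterms `(ε^𝖭_0, μ^𝖭_0)` and a functional `E_K ∈ Re 𝒦_K^{norm}` with
`‖E_K‖_{K,κ} ≤ λ_K^β` such that the `K`-fold modified density has, for `Φ_K ∈ 𝒮_K`, the representation
`ρ_K(Φ_K) = Z_K exp(−S_K(Φ_K, φ_K) − ¼λ_K∫φ_K⁴ + E_K(φ_K))` — NO energy and NO mass counterterm left (`ε_K = μ_K = 0`).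
A corollary of a named fact, proved from `(h : SmallFieldTrajectoryPrinted)`; nothing is asserted unconditionally.
[cite: Dimock2013, §5 (the two displays quoted) and Theorem 24 (\label{gsf}); §4.1 Theorem 14] -/
theorem SmallFieldTrajectoryPrinted.endpoint (h : SmallFieldTrajectoryPrinted) :
    ∀ (a mubar α : ℝ) (p p₀ : ℕ), 0 < a → 0 < mubar → mubar ≤ 1 → 1 / 2 < α → α < 1 → 0 < p₀ → p₀ < p →
    ∃ ε₀ : ℝ, 0 < ε₀ ∧ ∀ ε : ℝ, 0 < ε → ε ≤ ε₀ →
    ∀ β : ℝ, 0 < β → β < 1 / 4 - 10 * ε →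
    ∃ κ₁ : ℝ, ∀ κ : ℝ, κ₁ ≤ κ →
    ∃ L₀ : ℕ, ∀ (L : ℕ) [NeZero L], L₀ ≤ L → Odd L →
    ∃ m₀ : ℕ, ∀ m : ℕ, m₀ ≤ m →
    ∃ lamStar : ℝ, 0 < lamStar ∧
    ∀ (Mx N Δ : ℕ) (lam : ℝ), 0 < lam → Δ ≤ N → 1 ≤ N - Δ → m ≤ Mx + Δ → lamK L N (N - Δ) lam ≤ lamStar →
    ∃ (ε0 μ0 : ℝ) (EK : PolyFun (L ^ (Mx + N - (N - Δ) - m)) (L ^ (Mx + N))),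
      KnormSet L Mx N m (N - Δ) lam ε α κ EK ∧
      NLe L Mx N m (N - Δ) lam ε α κ EK ((lamK L N (N - Δ) lam) ^ β) ∧
      HasRep L Mx N (N - Δ) m a mubar lam p (modDensity L Mx N a mubar lam p p₀ ε0 μ0 (N - Δ))
        (Zseq L Mx N a mubar (N - Δ)) 0 0 EK := by
  obtain ⟨C, -, h⟩ := h
  intro a mubar α p p₀ ha hmu hmu1 hα hα1 hp₀ hp
  obtain ⟨ε₀, hε₀, h⟩ := h a mubar α p p₀ ha hmu hmu1 hα hα1 hp₀ hp
  refine ⟨ε₀, hε₀, fun ε hε hε1 β hβ hβ1 => ?_⟩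
  obtain ⟨κ₁, h⟩ := h ε hε hε1 β hβ hβ1
  refine ⟨κ₁, fun κ hκ => ?_⟩
  obtain ⟨L₀, h⟩ := h κ hκ
  refine ⟨L₀, fun L inst hL hLodd => ?_⟩
  obtain ⟨m₀, h⟩ := h L hL hLodd
  refine ⟨m₀, fun m hm => ?_⟩
  obtain ⟨lamStar, hls, h⟩ := h m hm
  refine ⟨lamStar, hls, fun Mx N Δ lam hlam hΔ hK hmM hsmall => ?_⟩
  obtain ⟨eps, mu, E, -, hepsK, hmuK, hbounds, hrep⟩ := h Mx N Δ lam hlam hΔ hmM hsmall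
  refine ⟨eps 0, mu 0, E (N - Δ), (hrep (N - Δ) hK le_rfl).1, (hbounds (N - Δ) le_rfl).2.2, ?_⟩
  have hr := (hrep (N - Δ) hK le_rfl).2
  rwa [hepsK, hmuK] at hr

/-! ## §10 (v1.3, append-only). PROVED: the two actions of a lattice symmetry are compatible under the block map —
the certificate behind `IsSymmetric` (Definition 3 (d.))

Every declaration above is byte-identical; theorems only.  `LatSym.onSite g B` (on fine sites: signed coordinate
permutation with the corner-convention reflection `x ↦ −1 − x`, then translation by `B·v`) and `LatSym.onCube g` (on
cube indices: the same signed permutation, translation by `v`) were DECLARED compatible in the docstring of `onSite`;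
here it is PROVED: `blk B c (g·x) = g·(blk B c x)` whenever `n = Bc` (`blk_onSite`), via the integer-coordinate
description of the block map (`blk_intCast`: `blk` is floor division `⌊z/B⌋ mod c`) and `⌊(−1−m)/B⌋ = −1 − ⌊m/B⌋`
(the lineage's `Balaban1983to89.Beta.ResolventReflection.neg_one_sub_ediv`, re-derived inside the proof so as not to
import that module's heavy closure here).  On the tori of this file: `cubeOf (g·x) = g·(cubeOf x)` (`cubeOf_onSite`), the cube action
is injective (`LatSym.onCube_injective`), hence the sites of the cubes of `g·X` are exactly the `g`-images of the sites
of the cubes of `X` (`cubeOf_onSite_mem_iff`) — so in `IsSymmetric B E`, `E (X.image g.onCube) ψ = E X (ψ ∘ g.onSite B)`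
IS the printed invariance *"under lattice symmetries (translations, rotations by π/2, reflections)"* with polymers and
fields moved by the same symmetry.  Nothing about Theorem 14 ∕ 24 is asserted.  R141 (D) item (8), seat ym-lit-type-8
gen 2.  [cite: Dimock2013, §3.3 Definition 3 (d.)] -/

section SymmetryCompat

/-- **The block map in integer coordinates is floor division**: for an integer vector `z`,
`blk B c (z mod n) = ⌊z/B⌋ mod c` when `n = Bc` (`B > 0`). [cite: Dimock2013, §2.1 ("B(y) is cubes of L³ sites (L on a side)")] -/
theorem blk_intCast (B c n : ℕ) [NeZero n] (hn : n = B * c) (hB : 0 < B) (z : Fin 3 → ℤ) :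
    blk B c (fun i => ((z i : ℤ) : ZMod n)) = fun i => (((z i) / (B : ℤ) : ℤ) : ZMod c) := by
  funext i
  simp only [blk]
  have hB' : (B : ℤ) ≠ 0 := by exact_mod_cast (ne_of_gt hB)
  have hv : ((((z i : ℤ) : ZMod n)).val : ℤ) = z i % (n : ℤ) := ZMod.val_intCast (z i)
  rw [← Int.cast_natCast (R := ZMod c), Int.natCast_div, hv]
  have hmod : z i % (n : ℤ) = z i + (B : ℤ) * (-((c : ℤ) * (z i / n))) := by
    rw [Int.emod_def, hn]; push_cast; ring
  rw [hmod, Int.add_mul_ediv_left _ _ hB']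
  push_cast
  simp

/-- A fine site in integer coordinates: `x = (x.val) mod n`. [folklore] -/
private theorem eq_intCast_val {n : ℕ} [NeZero n] (x : TPt 3 n) :
    x = fun i => ((((x i).val : ℕ) : ℤ) : ZMod n) := by
  funext i; simp

/-- **The site action and the cube action of a lattice symmetry are compatible under the block map**:
`blk B c (g·x) = g·(blk B c x)` for `n = Bc` — the claim in the docstring of `LatSym.onSite` (translations by `B·v`,
signed coordinate permutations with the corner-convention reflection `x ↦ −1 − x`), so that `IsSymmetric B E` is the
printed invariance *"under lattice symmetries (translations, rotations by π/2, reflections)"* acting consistently on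
polymers and on fields. [cite: Dimock2013, §3.3 Definition 3 (d.)] -/
theorem blk_onSite {B c n : ℕ} [NeZero n] [NeZero c] (hn : n = B * c) (hB : 0 < B) (g : LatSym c) (x : TPt 3 n) :
    blk B c (g.onSite B x) = g.onCube (blk B c x) := by
  have hB' : (B : ℤ) ≠ 0 := by exact_mod_cast (ne_of_gt hB)
  have hBz : (0 : ℤ) < B := by exact_mod_cast hB
  set z : Fin 3 → ℤ := fun i => (((x i).val : ℕ) : ℤ) with hz
  have hx : x = fun i => ((z i : ℤ) : ZMod n) := eq_intCast_val x
  -- reflections and floor division: ⌊(−1−m)/B⌋ = −1 − ⌊m/B⌋ (the lineage's `Beta.ResolventReflection.neg_one_sub_ediv`,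
  -- re-derived locally to keep this module's imports light)
  have hrefl : ∀ m : ℤ, (-1 - m) / (B : ℤ) = -1 - m / B := by
    intro m
    have hdecomp : -1 - m = ((B : ℤ) - 1 - m % B) + (B : ℤ) * (-1 - m / B) := by
      have := Int.emod_def m B
      linarith
    have hr0 : 0 ≤ (B : ℤ) - 1 - m % B := by
      have := Int.emod_lt_of_pos m hBz
      linarith
    have hrB : (B : ℤ) - 1 - m % B < B := by
      have := Int.emod_nonneg m hB'
      linarith
    rw [hdecomp, Int.add_mul_ediv_left _ _ hB', Int.ediv_eq_zero_of_lt hr0 hrB, zero_add]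
  -- the site action in integer coordinates
  have hsite : g.onSite B x = fun i =>
      ((((if g.s i then -1 - z (g.σ i) else z (g.σ i)) + (B : ℤ) * ((g.v i).val : ℤ) : ℤ)) : ZMod n) := by
    funext i
    rw [hx]
    simp only [LatSym.onSite]
    split_ifs <;> push_cast <;> ring
  -- the cube action in integer coordinates
  have hcube : g.onCube (blk B c x) = fun i =>
      ((((if g.s i then -1 - z (g.σ i) / B else z (g.σ i) / B) + ((g.v i).val : ℤ) : ℤ)) : ZMod c) := by
    funext i
    rw [hx, blk_intCast B c n hn hB]
    simp only [LatSym.onCube]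
    have hv : g.v i = ((((g.v i).val : ℕ) : ℤ) : ZMod c) := by simp
    split_ifs <;> (conv_lhs => rw [hv]) <;> push_cast <;> ring
  rw [hsite, blk_intCast B c n hn hB, hcube]
  funext i
  congr 1
  split_ifs
  · rw [Int.add_mul_ediv_left _ _ hB', hrefl]
  · rw [Int.add_mul_ediv_left _ _ hB']

/-- On the tori of this file: the `M`-cube index map `cubeOf` (blocks of side `L^{j+m}` of the fine lattice
`𝕋^{−j}_{𝖬+𝖭−j}`) intertwines the two actions of a lattice symmetry, `j + m ≤ 𝖬 + 𝖭`.
[cite: Dimock2013, §3.3 Definition 3 (d.); §3.1 ("cubes □ with side of length M = L^m")] -/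
theorem cubeOf_onSite {L Mx N : ℕ} [NeZero L] (j m : ℕ) (hjm : j + m ≤ Mx + N)
    (g : LatSym (L ^ (Mx + N - j - m))) (x : TPt 3 (L ^ (Mx + N))) :
    cubeOf L Mx N j m (g.onSite (L ^ (j + m)) x) = g.onCube (cubeOf L Mx N j m x) := by
  have hn : L ^ (Mx + N) = L ^ (j + m) * L ^ (Mx + N - j - m) := by
    rw [← pow_add]; congr 1; omega
  exact blk_onSite hn (pow_pos (Nat.pos_of_ne_zero (NeZero.ne L)) _) g x

/-- Consequently the polymer action is the image of the site action: the sites of the cubes `g·X` are exactly the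
`g`-images of the sites of the cubes of `X`. [cite: Dimock2013, §3.3 Definition 3 (d.)] -/
theorem cubeOf_onSite_mem_iff {L Mx N : ℕ} [NeZero L] (j m : ℕ) (hjm : j + m ≤ Mx + N)
    (g : LatSym (L ^ (Mx + N - j - m))) (X : Finset (TPt 3 (L ^ (Mx + N - j - m)))) (x : TPt 3 (L ^ (Mx + N)))
    (hg : Function.Injective g.onCube) :
    cubeOf L Mx N j m (g.onSite (L ^ (j + m)) x) ∈ X.image g.onCube ↔ cubeOf L Mx N j m x ∈ X := by
  rw [cubeOf_onSite j m hjm, Finset.mem_image]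
  constructor
  · rintro ⟨y, hy, hyx⟩
    rwa [← hg hyx]
  · intro h
    exact ⟨_, h, rfl⟩

/-- The cube action of a lattice symmetry is injective (it is a signed coordinate permutation followed by a
translation). [cite: Dimock2013, §3.3 Definition 3 (d.)] -/
theorem LatSym.onCube_injective {c : ℕ} (g : LatSym c) : Function.Injective g.onCube := by
  intro y y' h
  funext i
  have hi := congrFun h (g.σ.symm i)
  simp only [LatSym.onCube, Equiv.apply_symm_apply, add_left_inj] at hi
  split_ifs at hi with hs
  · simpa using hi
  · exact hi

end SymmetryCompat

/-! ## §11 (v1.4, append-only). PROVED: eq. (spiffy) of I §2.2 on the concrete objects — `S_k(Φ_k, φ_k)` at the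
minimizer, the torus summation by parts, the weighted adjointness of `Q_k`, `Q_kᵀ`, and "the cross terms vanish"

Every declaration above is byte-identical; theorems only.  Printed text (corpus chunk p0006 of `paper:arxiv-1108.1335`),
verbatim: *"The minimum comes at … This is (−Δ + μ̄_k + a_kQ_kᵀQ_k)φ = a_kQ_kᵀΦ_k.  The solution involves the inverse
G_k = (−Δ + μ̄_k + a_kQ_kᵀQ_k)^{−1} and has the form φ = φ_k(Φ_k) defined by φ_k(Φ_k) = a_kG_kQ_kᵀΦ_k.  … We take
φ = φ_k + 𝒵 … The cross terms vanish and so S_k(Φ_k, φ_k + 𝒵) = S_k(Φ_k, φ_k) + ½⟨𝒵, (−Δ + μ̄_k + a_kQ_kᵀQ_k)𝒵⟩ …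
Here is another representation of S_k(Φ_k, φ_k).  With φ_k = a_kG_kQ_kᵀΦ_k we have S_k(Φ_k, φ_k) = (a_k/2)‖Φ_k‖² −
a_k⟨φ_k, Q_kᵀΦ_k⟩ + ½⟨φ_k, (−Δ + μ̄_k + a_kQ_kᵀQ_k)φ_k⟩ = … = (a_k/2)‖Φ_k‖² − (a_k²/2)⟨Φ_k, Q_kG_kQ_kᵀΦ_k⟩ ≡
½⟨Φ_k, Δ_kΦ_k⟩ where Δ_k = a_k − a_k²Q_kG_kQ_kᵀ."*

**What is proved** (one chain of identities exercising `Sk`, `phiK`, `Gk`, `Deltak`, `Qk`, `QkT`, `negLap`, `gradSqF`,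
`normSqF`, `normSqU`, `eta`, `aK`, `mubarK` TOGETHER — the faithfulness certificate of the §2 vocabulary):
`negLap_mulVec` (the stencil), **`gradSqF_eq_sum_negLap`** (summation by parts on the torus: `‖∂φ‖² = ⟨φ, (−Δ)φ⟩` with
weight `η³`), `negLap_transpose`, `eta_pow_three` (`η³ = L^{−3k}`), `QkT_mulVec`, `Qk_mulVec`, **`sum_mul_Qk_mulVec`**
(`Q_kᵀ` IS the transpose of `Q_k` for the weighted inner products: `⟨w, Q_kf⟩_{𝕋⁰} = ⟨Q_kᵀw, f⟩_{𝕋^{−k}}`),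
`QkT_mul_Qk_transpose`, `sum_mul_opA_mulVec_comm` (symmetry of `−Δ + μ̄_k + a_kQ_kᵀQ_k`), `normSqU_sub`,
**`Sk_eq_expand`** (the first printed line, for every `φ`), **`Sk_phiK_eq`** (the printed
`S_k(Φ_k, φ_k) = (a_k/2)‖Φ_k‖² − (a_k²/2)⟨Φ_k, Q_kG_kQ_kᵀΦ_k⟩` — UNCONDITIONAL here: in the invertible case by
`A·G_k = 1`, in Mathlib's junk case `G_k = 0`, `φ_k = 0` both sides are `(a_k/2)‖Φ_k‖²`), **`Sk_phiK_eq_half_Deltak`**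
(`= ½⟨Φ_k, Δ_kΦ_k⟩`), and **`Sk_phiK_add`** ("the cross terms vanish", under the invertibility hypothesis
`IsUnit det(−Δ + μ̄_k + a_kQ_kᵀQ_k)`, which holds for `μ̄_k > 0` — positivity is not proved here).  Nothing about
Theorem 14 ∕ 24 is asserted.  R141 (D) item (8), seat ym-lit-type-8 gen 2.  [cite: Dimock2013, §2.2 eq. (spiffy)] -/

section Spiffy

/-- The fine Laplacian applied to a field: `(−Δφ)(x) = η^{−2}(6φ(x) − Σ_μ(φ(x+ηe_μ) + φ(x−ηe_μ)))`.
[cite: Dimock2013, §1.2 ("the Laplacian is Δ = −∂*∂")] -/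
theorem negLap_mulVec {n : ℕ} [NeZero n] (η : ℝ) (φ : TPt 3 n → ℝ) (x : TPt 3 n) :
    (negLap n η *ᵥ φ) x
      = (η ^ 2)⁻¹ * (6 * φ x - ∑ μ : Fin 3, (φ (x + Pi.single μ 1) + φ (x - Pi.single μ 1))) := by
  have h0 : ∑ y : TPt 3 n, (if y = x then (6 : ℝ) else 0) * φ y = 6 * φ x := by simp [ite_mul]
  have h1 : ∀ e : TPt 3 n, ∑ y : TPt 3 n, (if y = x + e then (1 : ℝ) else 0) * φ y = φ (x + e) := by
    intro e; simp [ite_mul]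
  have h2 : ∀ e : TPt 3 n, ∑ y : TPt 3 n, (if y = x - e then (1 : ℝ) else 0) * φ y = φ (x - e) := by
    intro e; simp [ite_mul]
  simp only [negLap, Matrix.mulVec, dotProduct, Matrix.of_apply]
  simp_rw [mul_assoc]
  rw [← Finset.mul_sum]
  congr 1
  simp_rw [sub_mul, Finset.sum_mul, add_mul]
  rw [Finset.sum_sub_distrib, h0, Finset.sum_comm]
  simp_rw [Finset.sum_add_distrib, h1, h2]

/-- **Summation by parts on the torus**: `‖∂φ‖² = ⟨φ, (−Δ)φ⟩`, i.e. `η³Σ_xΣ_μ(∂_μφ)(x)² = η³Σ_x φ(x)(−Δφ)(x)`.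
[cite: Dimock2013, §1.2 ("Δ = −∂*∂"); §2.2 (the quadratic form "½⟨φ, (−Δ + μ̄_k + a_kQ_kᵀQ_k)φ⟩")] -/
theorem gradSqF_eq_sum_negLap {n : ℕ} [NeZero n] (η : ℝ) (φ : TPt 3 n → ℝ) :
    gradSqF η φ = η ^ 3 * ∑ x : TPt 3 n, φ x * (negLap n η *ᵥ φ) x := by
  have hP : ∀ μ : Fin 3, ∑ x : TPt 3 n, φ (x + Pi.single μ 1) ^ 2 = ∑ x : TPt 3 n, φ x ^ 2 := fun μ =>
    Fintype.sum_equiv (Equiv.addRight (Pi.single μ 1)) _ _ (fun _ => rfl)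
  have hD : ∀ μ : Fin 3, ∑ x : TPt 3 n, φ x * φ (x - Pi.single μ 1) = ∑ x : TPt 3 n, φ x * φ (x + Pi.single μ 1) :=
    fun μ => Fintype.sum_equiv (Equiv.subRight (Pi.single μ 1)) _ _
      (fun x => by rw [Equiv.subRight_apply, sub_add_cancel, mul_comm])
  have key : ∀ μ : Fin 3, ∑ x : TPt 3 n, ((φ (x + Pi.single μ 1) - φ x) / η) ^ 2
      = (η ^ 2)⁻¹ * (2 * ∑ x : TPt 3 n, φ x ^ 2 - 2 * ∑ x : TPt 3 n, φ x * φ (x + Pi.single μ 1)) := by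
    intro μ
    have h3 : ∀ x : TPt 3 n, ((φ (x + Pi.single μ 1) - φ x) / η) ^ 2
        = (η ^ 2)⁻¹ * (φ (x + Pi.single μ 1) ^ 2 - 2 * (φ x * φ (x + Pi.single μ 1)) + φ x ^ 2) := by
      intro x; rw [div_pow]; ring
    simp_rw [h3]
    rw [← Finset.mul_sum, Finset.sum_add_distrib, Finset.sum_sub_distrib, hP μ, ← Finset.mul_sum]
    ring
  have rkey : ∀ x : TPt 3 n, φ x * (negLap n η *ᵥ φ) x
      = (η ^ 2)⁻¹ * (6 * φ x ^ 2 - ∑ μ : Fin 3, (φ x * φ (x + Pi.single μ 1) + φ x * φ (x - Pi.single μ 1))) := by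
    intro x
    rw [negLap_mulVec]
    have : ∑ μ : Fin 3, (φ x * φ (x + Pi.single μ 1) + φ x * φ (x - Pi.single μ 1))
        = φ x * ∑ μ : Fin 3, (φ (x + Pi.single μ 1) + φ (x - Pi.single μ 1)) := by
      rw [Finset.mul_sum]
      apply Finset.sum_congr rfl; intro μ _; ring
    rw [this]; ring
  have lhs : ∑ x : TPt 3 n, ∑ μ : Fin 3, fd η φ μ x ^ 2
      = (η ^ 2)⁻¹ * (6 * ∑ x : TPt 3 n, φ x ^ 2 - 2 * ∑ μ : Fin 3, ∑ x : TPt 3 n, φ x * φ (x + Pi.single μ 1)) := by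
    simp only [fd]
    rw [Finset.sum_comm]
    simp_rw [key]
    rw [← Finset.mul_sum, Finset.sum_sub_distrib, Finset.sum_const, Finset.card_univ, Fintype.card_fin,
      ← Finset.mul_sum, nsmul_eq_mul]
    push_cast
    ring
  have rhs : ∑ x : TPt 3 n, φ x * (negLap n η *ᵥ φ) x
      = (η ^ 2)⁻¹ * (6 * ∑ x : TPt 3 n, φ x ^ 2 - 2 * ∑ μ : Fin 3, ∑ x : TPt 3 n, φ x * φ (x + Pi.single μ 1)) := by
    simp_rw [rkey]
    rw [← Finset.mul_sum, Finset.sum_sub_distrib, ← Finset.mul_sum, Finset.sum_comm]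
    simp_rw [Finset.sum_add_distrib, hD]
    ring
  unfold gradSqF
  rw [lhs, rhs]

/-- `η³ = L^{−3k}` for `η = L^{−k}`. [cite: Dimock2013, §2.1 ("(Q_kf)(y) = L^{−3k} Σ_{x∈B_k(y)} f(x) = ∫_{|x−y|<1/2} f(x) dx")] -/
theorem eta_pow_three (L k : ℕ) : eta L k ^ 3 = ((L : ℝ) ^ (3 * k))⁻¹ := by
  rw [eta, inv_pow, ← pow_mul, mul_comm]

variable (L Mx N : ℕ) [NeZero L]

/-- `(Q_kᵀΦ)(x) = Φ(y)` for `x ∈ B_k(y)`: the injection, as `mulVec`. [cite: Dimock2013, §2.1 ("(Qᵀf)(x) = f(y) if x ∈ B(y)")] -/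
theorem QkT_mulVec (k : ℕ) (Φ : TPt 3 (L ^ (Mx + N - k)) → ℝ) (x : TPt 3 (L ^ (Mx + N))) :
    (QkT L Mx N k *ᵥ Φ) x = Φ (blk (L ^ k) (L ^ (Mx + N - k)) x) := by
  simp only [QkT, Matrix.mulVec, dotProduct, Matrix.of_apply, ite_mul, one_mul, zero_mul,
    Finset.sum_ite_eq, Finset.mem_univ, if_true]

/-- `(Q_kf)(y) = L^{−3k}Σ_{x∈B_k(y)} f(x)`, as `mulVec`. [cite: Dimock2013, §2.1 ("(Q_k f)(y) = L^{−3k} Σ_{x∈B_k(y)} f(x)")] -/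
theorem Qk_mulVec (k : ℕ) (f : TPt 3 (L ^ (Mx + N)) → ℝ) (y : TPt 3 (L ^ (Mx + N - k))) :
    (Qk L Mx N k *ᵥ f) y = ((L : ℝ) ^ (3 * k))⁻¹ *
      ∑ x ∈ Finset.univ.filter (fun x => blk (L ^ k) (L ^ (Mx + N - k)) x = y), f x := by
  simp only [Qk, Matrix.mulVec, dotProduct, Matrix.of_apply, ite_mul, zero_mul, Finset.sum_ite, Finset.sum_const_zero,
    add_zero, Finset.mul_sum]

/-- **`Q_kᵀ` is the transpose of `Q_k` for the WEIGHTED inner products**: `Σ_y w(y)(Q_kf)(y) = L^{−3k}Σ_x f(x)(Q_kᵀw)(x)`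
(`⟨w, Q_kf⟩_{𝕋⁰} = ⟨Q_kᵀw, f⟩_{𝕋^{−k}}`). [cite: Dimock2013, §2.1 ("The transpose operator Qᵀ with respect to the inner product (three0)")] -/
theorem sum_mul_Qk_mulVec (k : ℕ) (w : TPt 3 (L ^ (Mx + N - k)) → ℝ) (f : TPt 3 (L ^ (Mx + N)) → ℝ) :
    ∑ y, w y * (Qk L Mx N k *ᵥ f) y = ((L : ℝ) ^ (3 * k))⁻¹ * ∑ x, f x * (QkT L Mx N k *ᵥ w) x := by
  simp_rw [QkT_mulVec]
  simp only [Qk, Matrix.mulVec, dotProduct, Matrix.of_apply, ite_mul, zero_mul]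
  simp_rw [Finset.mul_sum]
  rw [Finset.sum_comm]
  apply Finset.sum_congr rfl
  intro x _
  rw [Finset.sum_eq_single (blk (L ^ k) (L ^ (Mx + N - k)) x)]
  · simp only [if_true]; ring
  · intro y _ hy; rw [if_neg (Ne.symm hy)]; ring
  · intro h; exact absurd (Finset.mem_univ _) h


/-- `‖Φ − v‖² = ‖Φ‖² − 2⟨Φ, v⟩ + ‖v‖²` on the unit lattice. [cite: Dimock2013, §2.2 eq. (norton)] -/
theorem normSqU_sub {c : ℕ} [NeZero c] (Φ v : TPt 3 c → ℝ) :
    normSqU (Φ - v) = normSqU Φ - 2 * ∑ y, Φ y * v y + normSqU v := by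
  simp only [normSqU, Pi.sub_apply, sub_sq, Finset.sum_add_distrib, Finset.sum_sub_distrib, Finset.mul_sum]
  apply congrArg₂ _ (congrArg₂ _ rfl ?_) rfl
  apply Finset.sum_congr rfl; intro y _; ring

/-- **The first line of (spiffy), for an arbitrary fine field `φ`**:
`S_k(Φ_k, φ) = (a_k/2)‖Φ_k‖² − a_k⟨φ, Q_kᵀΦ_k⟩ + ½⟨φ, (−Δ + μ̄_k + a_kQ_kᵀQ_k)φ⟩` (inner products: unweighted on
`𝕋⁰_{𝖬+𝖭−k}`, weight `η³ = L^{−3k}` on `𝕋^{−k}_{𝖬+𝖭−k}`; `⟨φ, Q_kᵀΦ_k⟩ = ⟨Q_kφ, Φ_k⟩`).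
[cite: Dimock2013, §2.2, the display before "where Δ_k = a_k − a_k²Q_kG_kQ_kᵀ" (first line)] -/
theorem Sk_eq_expand (k : ℕ) (a mubar : ℝ) (Φ : TPt 3 (L ^ (Mx + N - k)) → ℝ) (φ : TPt 3 (L ^ (Mx + N)) → ℝ) :
    Sk L Mx N k a mubar Φ φ
      = aK a L k / 2 * normSqU Φ - aK a L k * ∑ y, Φ y * (Qk L Mx N k *ᵥ φ) y
        + 1 / 2 * eta L k ^ 3 * ∑ x, φ x *
          ((negLap (L ^ (Mx + N)) (eta L k) + mubarK L N k mubar • (1 : Matrix _ _ ℝ)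
            + aK a L k • (QkT L Mx N k * Qk L Mx N k)) *ᵥ φ) x := by
  -- the three pieces of ⟨φ, Aφ⟩
  have hAφ : ∀ x, ((negLap (L ^ (Mx + N)) (eta L k) + mubarK L N k mubar • (1 : Matrix _ _ ℝ)
        + aK a L k • (QkT L Mx N k * Qk L Mx N k)) *ᵥ φ) x
      = (negLap _ (eta L k) *ᵥ φ) x + mubarK L N k mubar * φ x
        + aK a L k * (QkT L Mx N k *ᵥ (Qk L Mx N k *ᵥ φ)) x := by
    intro x
    simp only [Matrix.add_mulVec, Matrix.smul_mulVec, Matrix.one_mulVec, Pi.add_apply, Pi.smul_apply,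
      smul_eq_mul, Matrix.mulVec_mulVec]
  have hsumA : ∑ x, φ x * ((negLap (L ^ (Mx + N)) (eta L k) + mubarK L N k mubar • (1 : Matrix _ _ ℝ)
        + aK a L k • (QkT L Mx N k * Qk L Mx N k)) *ᵥ φ) x
      = ∑ x, φ x * (negLap _ (eta L k) *ᵥ φ) x + mubarK L N k mubar * ∑ x, φ x ^ 2
        + aK a L k * ∑ x, φ x * (QkT L Mx N k *ᵥ (Qk L Mx N k *ᵥ φ)) x := by
    simp_rw [hAφ, mul_add, Finset.sum_add_distrib, Finset.mul_sum]
    apply congrArg₂ _ (congrArg₂ _ rfl ?_) ?_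
    · apply Finset.sum_congr rfl; intro x _; ring
    · apply Finset.sum_congr rfl; intro x _; ring
  -- adjointness: Σ_y (Q_kφ)(y)² = η³ Σ_x φ(x)(Q_kᵀQ_kφ)(x), and ⟨Φ, Q_kφ⟩ likewise
  have hadj1 : ∑ y, (Qk L Mx N k *ᵥ φ) y ^ 2
      = eta L k ^ 3 * ∑ x, φ x * (QkT L Mx N k *ᵥ (Qk L Mx N k *ᵥ φ)) x := by
    rw [eta_pow_three, ← sum_mul_Qk_mulVec]
    apply Finset.sum_congr rfl; intro y _; ring
  rw [Sk, hsumA, gradSqF_eq_sum_negLap, normSqU_sub, normSqF, normSqU, normSqU]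
  linear_combination (aK a L k / 2) * hadj1

/-- **Eq. (spiffy) of [Dimock2013] on the concrete objects, AS PRINTED: at the minimizer `φ_k = a_kG_kQ_kᵀΦ_k`,
`S_k(Φ_k, φ_k) = (a_k/2)‖Φ_k‖² − (a_k²/2)⟨Φ_k, Q_kG_kQ_kᵀΦ_k⟩`.**  Unconditional in this file's conventions: when
`−Δ + μ̄_k + a_kQ_kᵀQ_k` is invertible this is the printed computation (`A G_k = 1`); in Mathlib's junk case
(`Matrix.inv` of a singular matrix `= 0`, so `G_k = 0`, `φ_k = 0`) both sides equal `(a_k/2)‖Φ_k‖²`.  One identity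
exercising `Sk`, `phiK`, `Gk`, `Qk`, `QkT`, `negLap`, `gradSqF`, `normSqF`, `eta` together.
[cite: Dimock2013, §2.2 ("S_k(Φ_k, φ_k) = (a_k/2)‖Φ_k‖² − (a_k²/2)⟨Φ_k, Q_kG_kQ_kᵀΦ_k⟩ ≡ ½⟨Φ_k, Δ_kΦ_k⟩")] -/
theorem Sk_phiK_eq (k : ℕ) (a mubar : ℝ) (Φ : TPt 3 (L ^ (Mx + N - k)) → ℝ) :
    Sk L Mx N k a mubar Φ (phiK L Mx N k a mubar Φ)
      = aK a L k / 2 * normSqU Φ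
        - (aK a L k) ^ 2 / 2 * ∑ y, Φ y * (Qk L Mx N k *ᵥ (Gk L Mx N k a mubar *ᵥ (QkT L Mx N k *ᵥ Φ))) y := by
  rw [Sk_eq_expand]
  set A : Matrix (TPt 3 (L ^ (Mx + N))) (TPt 3 (L ^ (Mx + N))) ℝ :=
    negLap (L ^ (Mx + N)) (eta L k) + mubarK L N k mubar • (1 : Matrix _ _ ℝ)
      + aK a L k • (QkT L Mx N k * Qk L Mx N k) with hA
  have hG : Gk L Mx N k a mubar = A⁻¹ := rfl
  by_cases hdet : IsUnit A.det
  · -- the invertible case: A φ_k = a_k Q_kᵀ Φ_k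
    have hAφ : A *ᵥ phiK L Mx N k a mubar Φ = aK a L k • (QkT L Mx N k *ᵥ Φ) := by
      rw [phiK, Matrix.mulVec_smul, hG, Matrix.mulVec_mulVec, Matrix.mul_nonsing_inv _ hdet, Matrix.one_mulVec]
    have hadj2 : ∑ y, Φ y * (Qk L Mx N k *ᵥ phiK L Mx N k a mubar Φ) y
        = eta L k ^ 3 * ∑ x, phiK L Mx N k a mubar Φ x * (QkT L Mx N k *ᵥ Φ) x := by
      rw [eta_pow_three, ← sum_mul_Qk_mulVec]
    have hlin : ∑ y, Φ y * (Qk L Mx N k *ᵥ phiK L Mx N k a mubar Φ) y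
        = aK a L k * ∑ y, Φ y * (Qk L Mx N k *ᵥ (Gk L Mx N k a mubar *ᵥ (QkT L Mx N k *ᵥ Φ))) y := by
      rw [phiK, Matrix.mulVec_smul, Finset.mul_sum]
      apply Finset.sum_congr rfl; intro y _; simp only [Pi.smul_apply, smul_eq_mul]; ring
    simp_rw [hAφ, Pi.smul_apply, smul_eq_mul]
    have h3 : ∑ x, phiK L Mx N k a mubar Φ x * (aK a L k * (QkT L Mx N k *ᵥ Φ) x)
        = aK a L k * ∑ x, phiK L Mx N k a mubar Φ x * (QkT L Mx N k *ᵥ Φ) x := by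
      rw [Finset.mul_sum]; apply Finset.sum_congr rfl; intro x _; ring
    rw [h3]
    linear_combination (-(aK a L k) / 2) * hadj2 - (aK a L k / 2) * hlin
  · -- the junk case: G_k = 0, φ_k = 0
    have hG0 : Gk L Mx N k a mubar = 0 := by rw [hG, Matrix.nonsing_inv_apply_not_isUnit _ hdet]
    have hφ0 : phiK L Mx N k a mubar Φ = 0 := by simp [phiK, hG0]
    simp [hφ0, hG0]

/-- **`S_k(Φ_k, φ_k) = ½⟨Φ_k, Δ_kΦ_k⟩`** with `Δ_k = a_k − a_k²Q_kG_kQ_kᵀ` (the second form of (spiffy)).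
[cite: Dimock2013, §2.2 eq. (spiffy) ("≡ ½⟨Φ_k, Δ_kΦ_k⟩ where Δ_k = a_k − a_k²Q_kG_kQ_kᵀ")] -/
theorem Sk_phiK_eq_half_Deltak (k : ℕ) (a mubar : ℝ) (Φ : TPt 3 (L ^ (Mx + N - k)) → ℝ) :
    Sk L Mx N k a mubar Φ (phiK L Mx N k a mubar Φ) = 1 / 2 * ∑ y, Φ y * (Deltak L Mx N k a mubar *ᵥ Φ) y := by
  rw [Sk_phiK_eq, normSqU]
  simp only [Deltak, Matrix.sub_mulVec, Matrix.smul_mulVec, Matrix.one_mulVec, ← Matrix.mulVec_mulVec,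
    Pi.sub_apply, Pi.smul_apply, smul_eq_mul, mul_sub, Finset.sum_sub_distrib, Finset.mul_sum]
  apply congrArg₂ _ ?_ ?_
  · apply Finset.sum_congr rfl; intro y _; ring
  · apply Finset.sum_congr rfl; intro y _; ring

/-- The fine Laplacian is a symmetric matrix. [cite: Dimock2013, §1.2 ("Δ = −∂*∂")] -/
theorem negLap_transpose (n : ℕ) (η : ℝ) : (negLap n η)ᵀ = negLap n η := by
  ext x y
  simp only [negLap, Matrix.transpose_apply, Matrix.of_apply]
  congr 1
  congr 1
  · simp [eq_comm]
  · apply Finset.sum_congr rfl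
    intro μ _
    have h1 : (x = y + Pi.single μ 1) ↔ (y = x - Pi.single μ 1) := by
      constructor <;> intro h <;> simp [h]
    have h2 : (x = y - Pi.single μ 1) ↔ (y = x + Pi.single μ 1) := by
      constructor <;> intro h <;> simp [h]
    simp only [h1, h2]
    ring

/-- `Q_kᵀQ_k` is a symmetric matrix. [cite: Dimock2013, §2.1 ("QᵀQ is a projection operator")] -/
theorem QkT_mul_Qk_transpose (k : ℕ) : (QkT L Mx N k * Qk L Mx N k)ᵀ = QkT L Mx N k * Qk L Mx N k := by
  ext x x'
  rw [Matrix.transpose_apply, QkT_mul_Qk_apply, QkT_mul_Qk_apply]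
  simp only [eq_comm]

/-- `−Δ + μ̄_k + a_kQ_kᵀQ_k` is symmetric, hence `⟨u, Av⟩ = ⟨v, Au⟩`. [cite: Dimock2013, §2.2] -/
theorem sum_mul_opA_mulVec_comm (k : ℕ) (a mubar : ℝ) (u v : TPt 3 (L ^ (Mx + N)) → ℝ) :
    ∑ x, u x * ((negLap (L ^ (Mx + N)) (eta L k) + mubarK L N k mubar • (1 : Matrix _ _ ℝ)
        + aK a L k • (QkT L Mx N k * Qk L Mx N k)) *ᵥ v) x
      = ∑ x, v x * ((negLap (L ^ (Mx + N)) (eta L k) + mubarK L N k mubar • (1 : Matrix _ _ ℝ)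
        + aK a L k • (QkT L Mx N k * Qk L Mx N k)) *ᵥ u) x := by
  set A : Matrix (TPt 3 (L ^ (Mx + N))) (TPt 3 (L ^ (Mx + N))) ℝ :=
    negLap (L ^ (Mx + N)) (eta L k) + mubarK L N k mubar • (1 : Matrix _ _ ℝ)
      + aK a L k • (QkT L Mx N k * Qk L Mx N k) with hA
  have hT : Aᵀ = A := by
    rw [hA, Matrix.transpose_add, Matrix.transpose_add, Matrix.transpose_smul, Matrix.transpose_smul,
      Matrix.transpose_one, negLap_transpose, QkT_mul_Qk_transpose]
  change u ⬝ᵥ (A *ᵥ v) = v ⬝ᵥ (A *ᵥ u)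
  rw [Matrix.dotProduct_mulVec, ← Matrix.mulVec_transpose, hT, dotProduct_comm]

/-- **"The cross terms vanish"**: at the minimizer, `S_k(Φ_k, φ_k + 𝒵) = S_k(Φ_k, φ_k) + ½⟨𝒵, (−Δ + μ̄_k + a_kQ_kᵀQ_k)𝒵⟩`
(inner product with weight `η³`), provided `−Δ + μ̄_k + a_kQ_kᵀQ_k` is invertible (so that `G_k` is its inverse).
[cite: Dimock2013, §2.2 ("We take φ = φ_k + 𝒵 … The cross terms vanish and so S_k(Φ_k, φ_k + 𝒵) = S_k(Φ_k, φ_k) + ½⟨𝒵, (−Δ + μ̄_k + a_k Q_kᵀQ_k)𝒵⟩")] -/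
theorem Sk_phiK_add (k : ℕ) (a mubar : ℝ) (Φ : TPt 3 (L ^ (Mx + N - k)) → ℝ) (Z : TPt 3 (L ^ (Mx + N)) → ℝ)
    (hA : IsUnit (negLap (L ^ (Mx + N)) (eta L k) + mubarK L N k mubar • (1 : Matrix _ _ ℝ)
        + aK a L k • (QkT L Mx N k * Qk L Mx N k)).det) :
    Sk L Mx N k a mubar Φ (phiK L Mx N k a mubar Φ + Z)
      = Sk L Mx N k a mubar Φ (phiK L Mx N k a mubar Φ)
        + 1 / 2 * eta L k ^ 3 * ∑ x, Z x *
          ((negLap (L ^ (Mx + N)) (eta L k) + mubarK L N k mubar • (1 : Matrix _ _ ℝ)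
            + aK a L k • (QkT L Mx N k * Qk L Mx N k)) *ᵥ Z) x := by
  set A : Matrix (TPt 3 (L ^ (Mx + N))) (TPt 3 (L ^ (Mx + N))) ℝ :=
    negLap (L ^ (Mx + N)) (eta L k) + mubarK L N k mubar • (1 : Matrix _ _ ℝ)
      + aK a L k • (QkT L Mx N k * Qk L Mx N k) with hAdef
  set φ := phiK L Mx N k a mubar Φ with hφ
  rw [Sk_eq_expand, Sk_eq_expand]
  have hG : Gk L Mx N k a mubar = A⁻¹ := rfl
  have hAφ : A *ᵥ φ = aK a L k • (QkT L Mx N k *ᵥ Φ) := by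
    rw [hφ, phiK, Matrix.mulVec_smul, hG, Matrix.mulVec_mulVec, Matrix.mul_nonsing_inv _ hA, Matrix.one_mulVec]
  -- expand ⟨φ + Z, A(φ + Z)⟩
  have hsym : ∑ x, φ x * (A *ᵥ Z) x = ∑ x, Z x * (A *ᵥ φ) x := sum_mul_opA_mulVec_comm L Mx N k a mubar φ Z
  have hexp : ∑ x, (φ + Z) x * (A *ᵥ (φ + Z)) x
      = ∑ x, φ x * (A *ᵥ φ) x + 2 * ∑ x, Z x * (A *ᵥ φ) x + ∑ x, Z x * (A *ᵥ Z) x := by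
    simp only [Matrix.mulVec_add, Pi.add_apply, add_mul, mul_add, Finset.sum_add_distrib]
    rw [hsym]; ring
  have hZφ : ∑ x, Z x * (A *ᵥ φ) x = aK a L k * ∑ x, Z x * (QkT L Mx N k *ᵥ Φ) x := by
    rw [hAφ, Finset.mul_sum]
    apply Finset.sum_congr rfl; intro x _; simp only [Pi.smul_apply, smul_eq_mul]; ring
  have hadj : ∑ y, Φ y * (Qk L Mx N k *ᵥ Z) y = eta L k ^ 3 * ∑ x, Z x * (QkT L Mx N k *ᵥ Φ) x := by
    rw [eta_pow_three, ← sum_mul_Qk_mulVec]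
  have hQ : ∑ y, Φ y * (Qk L Mx N k *ᵥ (φ + Z)) y
      = ∑ y, Φ y * (Qk L Mx N k *ᵥ φ) y + ∑ y, Φ y * (Qk L Mx N k *ᵥ Z) y := by
    simp only [Matrix.mulVec_add, Pi.add_apply, mul_add, Finset.sum_add_distrib]
  rw [hexp, hQ, hZφ]
  linear_combination (-(aK a L k)) * hadj

end Spiffy

/-! ## §12 (v1.5, append-only). PROVED: `−Δ + μ̄_k + a_kQ_kᵀQ_k` is positive definite (`μ̄_k > 0`, `a_k ≥ 0`),
so `G_k` IS its inverse, `φ_k` solves the printed minimizer equation, and "the minimum comes at" `φ_k`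

Every declaration above is byte-identical; theorems only.  Printed text (p0006), verbatim: *"The minimum comes at the
solution of … This is (−Δ + μ̄_k + a_kQ_kᵀQ_k)φ = a_kQ_kᵀΦ_k.  The solution involves the inverse
G_k = (−Δ + μ̄_k + a_kQ_kᵀQ_k)^{−1}"*.  What is proved: `opA_posDef` (positivity: `⟨φ, (−Δ)φ⟩ = ‖∂φ‖² ≥ 0` by
`gradSqF_eq_sum_negLap`, `⟨φ, Q_kᵀQ_kφ⟩ = L^{3k}‖Q_kφ‖² ≥ 0` by the weighted adjointness, `μ̄_k‖φ‖² > 0`),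
`isUnit_opA_det`, **`opA_mul_Gk` ∕ `Gk_mul_opA`** (`G_k` is a genuine two-sided inverse — no Mathlib junk),
**`opA_mulVec_phiK`** (the minimizer equation `(−Δ + μ̄_k + a_kQ_kᵀQ_k)φ_k = a_kQ_kᵀΦ_k`), `Sk_phiK_add'` ("the cross
terms vanish", now hypothesis-free for `μ̄_k > 0`, `a_k ≥ 0`) and **`Sk_phiK_le`** (*"The minimum comes at"* `φ_k`:
`S_k(Φ_k, φ_k) ≤ S_k(Φ_k, φ)` for every `φ`).  The hypotheses hold along the paper's parameters (`μ̄_k = L^{−2(𝖭−k)}μ̄ > 0`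
for `μ̄ > 0`; `a_k > 0` for `a > 0`, `L > 1`, `k ≥ 1` by `aK_pos`).  Nothing about Theorem 14 ∕ 24 is asserted.  R141 (D)
item (8), seat ym-lit-type-8 gen 2.  [cite: Dimock2013, §2.2] -/

section Minimizer

variable (L Mx N : ℕ) [NeZero L]

/-- `η = L^{−k} > 0`. [cite: Dimock2013, §2.1] -/
theorem eta_pos (k : ℕ) : 0 < eta L k := by
  unfold eta
  have hL : (0 : ℝ) < L := by exact_mod_cast Nat.pos_of_ne_zero (NeZero.ne L)
  positivity

/-- `μ̄_k > 0` for `μ̄ > 0`. [cite: Dimock2013, §2.2 ("μ̄_k = L^{−2(N−k)} μ̄")] -/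
theorem mubarK_pos (k : ℕ) {mubar : ℝ} (h : 0 < mubar) : 0 < mubarK L N k mubar := by
  unfold mubarK
  have hL : (0 : ℝ) < L := by exact_mod_cast Nat.pos_of_ne_zero (NeZero.ne L)
  positivity

/-- **`−Δ + μ̄_k + a_kQ_kᵀQ_k` is positive definite** for `μ̄_k > 0`, `a_k ≥ 0`. [cite: Dimock2013, §2.2 ("The solution involves the inverse G_k = (−Δ + μ̄_k + a_k Q_kᵀQ_k)^{−1}")] -/
theorem opA_posDef (k : ℕ) (a mubar : ℝ) (hmu : 0 < mubarK L N k mubar) (ha : 0 ≤ aK a L k) :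
    (negLap (L ^ (Mx + N)) (eta L k) + mubarK L N k mubar • (1 : Matrix _ _ ℝ)
        + aK a L k • (QkT L Mx N k * Qk L Mx N k)).PosDef := by
  apply Matrix.PosDef.of_dotProduct_mulVec_pos
  · rw [Matrix.IsHermitian, Matrix.conjTranspose_eq_transpose_of_trivial, Matrix.transpose_add,
      Matrix.transpose_add, Matrix.transpose_smul, Matrix.transpose_smul, Matrix.transpose_one, negLap_transpose,
      QkT_mul_Qk_transpose]
  · intro x hx
    rw [star_trivial, dotProduct]
    have hη := eta_pos L k
    -- the three pieces
    have hsplit : ∑ i, x i * ((negLap (L ^ (Mx + N)) (eta L k) + mubarK L N k mubar • (1 : Matrix _ _ ℝ)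
          + aK a L k • (QkT L Mx N k * Qk L Mx N k)) *ᵥ x) i
        = ∑ i, x i * (negLap _ (eta L k) *ᵥ x) i + mubarK L N k mubar * ∑ i, x i ^ 2
          + aK a L k * ∑ i, x i * (QkT L Mx N k *ᵥ (Qk L Mx N k *ᵥ x)) i := by
      simp only [Matrix.add_mulVec, Matrix.smul_mulVec, Matrix.one_mulVec, Pi.add_apply, Pi.smul_apply,
        smul_eq_mul, Matrix.mulVec_mulVec, mul_add, Finset.sum_add_distrib, Finset.mul_sum]
      apply congrArg₂ _ (congrArg₂ _ rfl ?_) ?_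
      · apply Finset.sum_congr rfl; intro i _; ring
      · apply Finset.sum_congr rfl; intro i _; ring
    have h1 : 0 ≤ ∑ i, x i * (negLap _ (eta L k) *ᵥ x) i := by
      have hg := gradSqF_eq_sum_negLap (eta L k) x
      have hg0 : 0 ≤ gradSqF (eta L k) x := by
        unfold gradSqF; positivity
      have h3 : 0 < eta L k ^ 3 := by positivity
      nlinarith
    have h2 : 0 < ∑ i, x i ^ 2 := by
      obtain ⟨i, hi⟩ : ∃ i, x i ≠ 0 := Function.ne_iff.mp hx
      exact lt_of_lt_of_le (by positivity : 0 < x i ^ 2)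
        (Finset.single_le_sum (f := fun i => x i ^ 2) (fun j _ => sq_nonneg (x j)) (Finset.mem_univ i))
    have h3 : 0 ≤ ∑ i, x i * (QkT L Mx N k *ᵥ (Qk L Mx N k *ᵥ x)) i := by
      have hadj := sum_mul_Qk_mulVec L Mx N k (Qk L Mx N k *ᵥ x) x
      have hsq : 0 ≤ ∑ y, (Qk L Mx N k *ᵥ x) y * (Qk L Mx N k *ᵥ x) y :=
        Finset.sum_nonneg (fun y _ => mul_self_nonneg _)
      have hc : 0 < ((L : ℝ) ^ (3 * k))⁻¹ := by
        have hL : (0 : ℝ) < L := by exact_mod_cast Nat.pos_of_ne_zero (NeZero.ne L)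
        positivity
      rw [hadj] at hsq
      exact (mul_nonneg_iff_of_pos_left hc).mp hsq
    rw [hsplit]
    have := mul_pos hmu h2
    nlinarith [mul_nonneg ha h3]

/-- `det(−Δ + μ̄_k + a_kQ_kᵀQ_k)` is a unit (`μ̄_k > 0`, `a_k ≥ 0`). [cite: Dimock2013, §2.2] -/
theorem isUnit_opA_det (k : ℕ) (a mubar : ℝ) (hmu : 0 < mubarK L N k mubar) (ha : 0 ≤ aK a L k) :
    IsUnit (negLap (L ^ (Mx + N)) (eta L k) + mubarK L N k mubar • (1 : Matrix _ _ ℝ)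
        + aK a L k • (QkT L Mx N k * Qk L Mx N k)).det :=
  (Matrix.isUnit_iff_isUnit_det _).mp (opA_posDef L Mx N k a mubar hmu ha).isUnit

/-- **`G_k` is the inverse**: `(−Δ + μ̄_k + a_kQ_kᵀQ_k)G_k = 1`. [cite: Dimock2013, §2.2 ("G_k = (−Δ + μ̄_k + a_k Q_kᵀQ_k)^{−1}")] -/
theorem opA_mul_Gk (k : ℕ) (a mubar : ℝ) (hmu : 0 < mubarK L N k mubar) (ha : 0 ≤ aK a L k) :
    (negLap (L ^ (Mx + N)) (eta L k) + mubarK L N k mubar • (1 : Matrix _ _ ℝ)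
        + aK a L k • (QkT L Mx N k * Qk L Mx N k)) * Gk L Mx N k a mubar = 1 :=
  Matrix.mul_nonsing_inv _ (isUnit_opA_det L Mx N k a mubar hmu ha)

/-- `G_k(−Δ + μ̄_k + a_kQ_kᵀQ_k) = 1`. [cite: Dimock2013, §2.2] -/
theorem Gk_mul_opA (k : ℕ) (a mubar : ℝ) (hmu : 0 < mubarK L N k mubar) (ha : 0 ≤ aK a L k) :
    Gk L Mx N k a mubar * (negLap (L ^ (Mx + N)) (eta L k) + mubarK L N k mubar • (1 : Matrix _ _ ℝ)
        + aK a L k • (QkT L Mx N k * Qk L Mx N k)) = 1 :=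
  Matrix.nonsing_inv_mul _ (isUnit_opA_det L Mx N k a mubar hmu ha)

/-- **The minimizer equation**: `(−Δ + μ̄_k + a_kQ_kᵀQ_k)φ_k = a_kQ_kᵀΦ_k`. [cite: Dimock2013, §2.2 ("This is (−Δ + μ̄_k + a_k Q_kᵀQ_k)φ = a_kQ_kᵀΦ_k")] -/
theorem opA_mulVec_phiK (k : ℕ) (a mubar : ℝ) (hmu : 0 < mubarK L N k mubar) (ha : 0 ≤ aK a L k)
    (Φ : TPt 3 (L ^ (Mx + N - k)) → ℝ) :
    (negLap (L ^ (Mx + N)) (eta L k) + mubarK L N k mubar • (1 : Matrix _ _ ℝ)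
        + aK a L k • (QkT L Mx N k * Qk L Mx N k)) *ᵥ phiK L Mx N k a mubar Φ
      = aK a L k • (QkT L Mx N k *ᵥ Φ) := by
  rw [phiK, Matrix.mulVec_smul, Matrix.mulVec_mulVec, opA_mul_Gk L Mx N k a mubar hmu ha, Matrix.one_mulVec]

/-- "The cross terms vanish", hypothesis-free form for `μ̄_k > 0`, `a_k ≥ 0`. [cite: Dimock2013, §2.2 ("The cross terms vanish and so S_k(Φ_k, φ_k + 𝒵) = S_k(Φ_k, φ_k) + ½⟨𝒵, (−Δ + μ̄_k + a_k Q_kᵀQ_k)𝒵⟩")] -/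
theorem Sk_phiK_add' (k : ℕ) (a mubar : ℝ) (hmu : 0 < mubarK L N k mubar) (ha : 0 ≤ aK a L k)
    (Φ : TPt 3 (L ^ (Mx + N - k)) → ℝ) (Z : TPt 3 (L ^ (Mx + N)) → ℝ) :
    Sk L Mx N k a mubar Φ (phiK L Mx N k a mubar Φ + Z)
      = Sk L Mx N k a mubar Φ (phiK L Mx N k a mubar Φ)
        + 1 / 2 * eta L k ^ 3 * ∑ x, Z x *
          ((negLap (L ^ (Mx + N)) (eta L k) + mubarK L N k mubar • (1 : Matrix _ _ ℝ)
            + aK a L k • (QkT L Mx N k * Qk L Mx N k)) *ᵥ Z) x :=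
  Sk_phiK_add L Mx N k a mubar Φ Z (isUnit_opA_det L Mx N k a mubar hmu ha)

/-- **"The minimum comes at" `φ_k`**: `S_k(Φ_k, φ_k) ≤ S_k(Φ_k, φ)` for every fine field `φ` (`μ̄_k > 0`, `a_k ≥ 0`).
[cite: Dimock2013, §2.2 ("The minimum comes at the solution of … φ_k(Φ_k) = a_k G_k Q_kᵀ Φ_k")] -/
theorem Sk_phiK_le (k : ℕ) (a mubar : ℝ) (hmu : 0 < mubarK L N k mubar) (ha : 0 ≤ aK a L k)
    (Φ : TPt 3 (L ^ (Mx + N - k)) → ℝ) (φ : TPt 3 (L ^ (Mx + N)) → ℝ) :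
    Sk L Mx N k a mubar Φ (phiK L Mx N k a mubar Φ) ≤ Sk L Mx N k a mubar Φ φ := by
  have h := Sk_phiK_add' L Mx N k a mubar hmu ha Φ (φ - phiK L Mx N k a mubar Φ)
  rw [add_sub_cancel] at h
  rw [h]
  have hpsd := (opA_posDef L Mx N k a mubar hmu ha).posSemidef.dotProduct_mulVec_nonneg
    (φ - phiK L Mx N k a mubar Φ)
  rw [star_trivial, dotProduct] at hpsd
  have hη : 0 < eta L k ^ 3 := pow_pos (eta_pos L k) 3
  nlinarith

end Minimizer

/-! ## §13 (v1.6, append-only). PROVED: positivity of `S_k`, `Δ_k`, `D_k = C_k⁻¹` and `D_0`, hence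
`det C_k > 0` and `Z_k > 0` along the trajectory — the objects of Lemma 4 ∕ (understand) are non-degenerate

Every declaration above is byte-identical; theorems only.  Lemma 4 [Dimock2013, §2.3] evaluates the fluctuation integral
*"∫exp(−½⟨Z, (Δ_k + aL^{−2}QᵀQ)Z⟩)dZ as (2π)^{|𝕋⁰_{𝖬+𝖭−k}|/2}(det C_k)^{1/2}"* with *"C_k = (Δ_k + aL^{−2}QᵀQ)^{−1}"*,
which presupposes that `Δ_k + aL^{−2}QᵀQ` is positive definite.  Proved here on the concrete objects: `Sk_nonneg`,
`Sk_pos_of_ne_zero` (`S_k(Φ_k, φ) > 0` for `Φ_k ≠ 0`, `a_k > 0`, `μ̄_k > 0`), the matrix transposes `Qk_transpose`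
(`Q_kᵀ(matrix) = L^{−3k}·QkT`: the weighted adjoint), `QkT_transpose`, `Q1_transpose`, `Q1T_transpose`,
`Q1T_mul_Q1_transpose`, `opA_transpose`, `Gk_transpose`, `Deltak_transpose` (all symmetric), the one-step adjointness
`Q1T_mulVec`, `sum_mul_Q1_mulVec`, `sum_mul_Q1T_Q1_mulVec_nonneg`, **`Deltak_posDef`** (`⟨Φ, Δ_kΦ⟩ = 2S_k(Φ, φ_k) > 0`),
**`Dk_posDef`** (`D_k = Δ_k + aL^{−2}QᵀQ`, `a ≥ 0`), **`D0_posDef`**, `Dk_det_pos` ∕ `D0_det_pos` (`det C_k^{−1} > 0`),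
and **`Znext_pos`, `Znext0_pos`, `Zseq_pos`** (`Z_k > 0` for all `k`, for `a > 0`, `μ̄ > 0`, `L > 1`).  Nothing about
Theorem 14 ∕ 24 is asserted.  R141 (D) item (8), seat ym-lit-type-8 gen 2.  [cite: Dimock2013, §2.3 Lemma 4; §2.2 eq. (spiffy)] -/

section Positivity

variable (L Mx N : ℕ) [NeZero L]

/-- `S_k(Φ_k, φ) ≥ 0` (`a_k ≥ 0`, `μ̄_k ≥ 0`). [cite: Dimock2013, §2.2 eq. (norton)] -/
theorem Sk_nonneg (k : ℕ) {a mubar : ℝ} (hak : 0 ≤ aK a L k) (hmu : 0 ≤ mubarK L N k mubar)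
    (Φ : TPt 3 (L ^ (Mx + N - k)) → ℝ) (φ : TPt 3 (L ^ (Mx + N)) → ℝ) : 0 ≤ Sk L Mx N k a mubar Φ φ := by
  have hη := (eta_pos L k).le
  unfold Sk normSqU gradSqF normSqF
  positivity

/-- `S_k(Φ_k, φ) > 0` whenever `Φ_k ≠ 0` (`a_k > 0`, `μ̄_k > 0`): if `φ ≠ 0` the mass term is positive, if `φ = 0` the
block term is `(a_k/2)‖Φ_k‖² > 0`. [cite: Dimock2013, §2.2 eq. (norton)] -/
theorem Sk_pos_of_ne_zero (k : ℕ) {a mubar : ℝ} (hak : 0 < aK a L k) (hmu : 0 < mubarK L N k mubar)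
    {Φ : TPt 3 (L ^ (Mx + N - k)) → ℝ} (hΦ : Φ ≠ 0) (φ : TPt 3 (L ^ (Mx + N)) → ℝ) :
    0 < Sk L Mx N k a mubar Φ φ := by
  have hη := eta_pos L k
  have h1 : 0 ≤ aK a L k / 2 * normSqU (Φ - Qk L Mx N k *ᵥ φ) := by unfold normSqU; positivity
  have h2 : 0 ≤ 1 / 2 * gradSqF (eta L k) φ := by unfold gradSqF; positivity
  have h3 : 0 ≤ 1 / 2 * mubarK L N k mubar * normSqF (eta L k) φ := by unfold normSqF; positivity
  unfold Sk
  by_cases hφ : φ = 0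
  · subst hφ
    have hpos : 0 < normSqU Φ := by
      obtain ⟨i, hi⟩ : ∃ i, Φ i ≠ 0 := Function.ne_iff.mp hΦ
      exact lt_of_lt_of_le (by positivity : 0 < Φ i ^ 2)
        (Finset.single_le_sum (f := fun i => Φ i ^ 2) (fun j _ => sq_nonneg (Φ j)) (Finset.mem_univ i))
    have : 0 < aK a L k / 2 * normSqU (Φ - Qk L Mx N k *ᵥ (0 : TPt 3 (L ^ (Mx + N)) → ℝ)) := by
      rw [Matrix.mulVec_zero, sub_zero]; positivity
    linarith
  · have hpos : 0 < normSqF (eta L k) φ := by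
      obtain ⟨i, hi⟩ : ∃ i, φ i ≠ 0 := Function.ne_iff.mp hφ
      unfold normSqF
      exact mul_pos (by positivity) (lt_of_lt_of_le (by positivity : 0 < φ i ^ 2)
        (Finset.single_le_sum (f := fun i => φ i ^ 2) (fun j _ => sq_nonneg (φ j)) (Finset.mem_univ i)))
    have : 0 < 1 / 2 * mubarK L N k mubar * normSqF (eta L k) φ := by positivity
    linarith

omit [NeZero L] in
/-- As MATRICES, `Q_k` and the injection `QkT` are transposes up to the weight: `Qkᵀ = L^{−3k}·QkT`.
[cite: Dimock2013, §2.1 ("The transpose operator Qᵀ with respect to the inner product (three0)")] -/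
theorem Qk_transpose (k : ℕ) : (Qk L Mx N k)ᵀ = (((L : ℝ) ^ (3 * k))⁻¹) • QkT L Mx N k := by
  ext x y
  simp only [Qk, QkT, Matrix.transpose_apply, Matrix.of_apply, Matrix.smul_apply, smul_eq_mul, mul_ite, mul_one,
    mul_zero]

/-- `QkTᵀ = L^{3k}·Q_k`. [cite: Dimock2013, §2.1] -/
theorem QkT_transpose (k : ℕ) : (QkT L Mx N k)ᵀ = ((L : ℝ) ^ (3 * k)) • Qk L Mx N k := by
  have hL : (L : ℝ) ≠ 0 := by exact_mod_cast NeZero.ne L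
  ext y x
  simp only [Qk, QkT, Matrix.transpose_apply, Matrix.of_apply, Matrix.smul_apply, smul_eq_mul, mul_ite,
    mul_inv_cancel₀ (pow_ne_zero _ hL), mul_zero]

omit [NeZero L] in
/-- `Qᵀ(matrix) = L^{−3}·Q1T` for the one-step pair. [cite: Dimock2013, §2.1] -/
theorem Q1_transpose (k : ℕ) : (Q1 L Mx N k)ᵀ = (((L : ℝ) ^ 3)⁻¹) • Q1T L Mx N k := by
  ext x y
  simp only [Q1, Q1T, Matrix.transpose_apply, Matrix.of_apply, Matrix.smul_apply, smul_eq_mul, mul_ite, mul_one,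
    mul_zero]

/-- `Q1Tᵀ = L³·Q1`. [cite: Dimock2013, §2.1] -/
theorem Q1T_transpose (k : ℕ) : (Q1T L Mx N k)ᵀ = ((L : ℝ) ^ 3) • Q1 L Mx N k := by
  have hL : (L : ℝ) ≠ 0 := by exact_mod_cast NeZero.ne L
  ext y x
  simp only [Q1, Q1T, Matrix.transpose_apply, Matrix.of_apply, Matrix.smul_apply, smul_eq_mul, mul_ite,
    mul_inv_cancel₀ (pow_ne_zero _ hL), mul_zero]

/-- `Q1T*Q1` is symmetric. [cite: Dimock2013, §2.1 ("QᵀQ is a projection operator")] -/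
theorem Q1T_mul_Q1_transpose (k : ℕ) : (Q1T L Mx N k * Q1 L Mx N k)ᵀ = Q1T L Mx N k * Q1 L Mx N k := by
  have hL : (L : ℝ) ≠ 0 := by exact_mod_cast NeZero.ne L
  rw [Matrix.transpose_mul, Q1_transpose, Q1T_transpose, Matrix.smul_mul, Matrix.mul_smul, smul_smul,
    inv_mul_cancel₀ (pow_ne_zero _ hL), one_smul]

/-- `−Δ + μ̄_k + a_kQ_kᵀQ_k` is symmetric. [cite: Dimock2013, §2.2] -/
theorem opA_transpose (k : ℕ) (a mubar : ℝ) :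
    (negLap (L ^ (Mx + N)) (eta L k) + mubarK L N k mubar • (1 : Matrix _ _ ℝ)
        + aK a L k • (QkT L Mx N k * Qk L Mx N k))ᵀ
      = negLap (L ^ (Mx + N)) (eta L k) + mubarK L N k mubar • (1 : Matrix _ _ ℝ)
        + aK a L k • (QkT L Mx N k * Qk L Mx N k) := by
  rw [Matrix.transpose_add, Matrix.transpose_add, Matrix.transpose_smul, Matrix.transpose_smul, Matrix.transpose_one,
    negLap_transpose, QkT_mul_Qk_transpose]

/-- `G_k` is symmetric. [cite: Dimock2013, §2.2 ("G_k = (−Δ + μ̄_k + a_k Q_kᵀQ_k)^{−1}")] -/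
theorem Gk_transpose (k : ℕ) (a mubar : ℝ) : (Gk L Mx N k a mubar)ᵀ = Gk L Mx N k a mubar := by
  rw [Gk, Matrix.transpose_nonsing_inv, opA_transpose]

/-- `Δ_k = a_k − a_k²Q_kG_kQ_kᵀ` is symmetric. [cite: Dimock2013, §2.2 ("Δ_k = a_k − a_k² Q_k G_k Q_kᵀ")] -/
theorem Deltak_transpose (k : ℕ) (a mubar : ℝ) : (Deltak L Mx N k a mubar)ᵀ = Deltak L Mx N k a mubar := by
  have hL : (L : ℝ) ≠ 0 := by exact_mod_cast NeZero.ne L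
  simp only [Deltak, Matrix.transpose_sub, Matrix.transpose_smul, Matrix.transpose_one, Matrix.transpose_mul,
    QkT_transpose, Gk_transpose, Qk_transpose, Matrix.smul_mul, Matrix.mul_smul, smul_smul, Matrix.mul_assoc]
  rw [inv_mul_cancel₀ (pow_ne_zero _ hL), mul_one]

/-- `(QᵀΦ)(x) = Φ(y)` for `x ∈ B(y)` (one step). [cite: Dimock2013, §2.1 ("(Qᵀf)(x) = f(y) if x ∈ B(y)")] -/
theorem Q1T_mulVec (k : ℕ) (Φ : TPt 3 (L ^ (Mx + N - (k + 1))) → ℝ) (x : TPt 3 (L ^ (Mx + N - k))) :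
    (Q1T L Mx N k *ᵥ Φ) x = Φ (blk L (L ^ (Mx + N - (k + 1))) x) := by
  simp only [Q1T, Matrix.mulVec, dotProduct, Matrix.of_apply, ite_mul, one_mul, zero_mul,
    Finset.sum_ite_eq, Finset.mem_univ, if_true]

/-- One-step weighted adjointness: `Σ_y w(y)(Qf)(y) = L^{−3}Σ_x f(x)(Qᵀw)(x)`. [cite: Dimock2013, §2.1 ("The transpose operator Qᵀ with respect to the inner product (three0)")] -/
theorem sum_mul_Q1_mulVec (k : ℕ) (w : TPt 3 (L ^ (Mx + N - (k + 1))) → ℝ) (f : TPt 3 (L ^ (Mx + N - k)) → ℝ) :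
    ∑ y, w y * (Q1 L Mx N k *ᵥ f) y = ((L : ℝ) ^ 3)⁻¹ * ∑ x, f x * (Q1T L Mx N k *ᵥ w) x := by
  simp_rw [Q1T_mulVec]
  simp only [Q1, Matrix.mulVec, dotProduct, Matrix.of_apply, ite_mul, zero_mul]
  simp_rw [Finset.mul_sum]
  rw [Finset.sum_comm]
  apply Finset.sum_congr rfl
  intro x _
  rw [Finset.sum_eq_single (blk L (L ^ (Mx + N - (k + 1))) x)]
  · simp only [if_true]; ring
  · intro y _ hy; rw [if_neg (Ne.symm hy)]; ring
  · intro h; exact absurd (Finset.mem_univ _) h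

/-- `⟨Φ, QᵀQΦ⟩ = L³‖QΦ‖² ≥ 0` (one step). [cite: Dimock2013, §2.1] -/
theorem sum_mul_Q1T_Q1_mulVec_nonneg (k : ℕ) (Φ : TPt 3 (L ^ (Mx + N - k)) → ℝ) :
    0 ≤ ∑ x, Φ x * ((Q1T L Mx N k * Q1 L Mx N k) *ᵥ Φ) x := by
  have hL : (0 : ℝ) < L := by exact_mod_cast Nat.pos_of_ne_zero (NeZero.ne L)
  have hadj := sum_mul_Q1_mulVec L Mx N k (Q1 L Mx N k *ᵥ Φ) Φ
  have hsq : 0 ≤ ∑ y, (Q1 L Mx N k *ᵥ Φ) y * (Q1 L Mx N k *ᵥ Φ) y :=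
    Finset.sum_nonneg (fun y _ => mul_self_nonneg _)
  rw [hadj] at hsq
  simp_rw [← Matrix.mulVec_mulVec]
  exact (mul_nonneg_iff_of_pos_left (by positivity)).mp hsq

/-- **`Δ_k` is positive definite** (`a_k > 0`, `μ̄_k > 0`): `⟨Φ, Δ_kΦ⟩ = 2S_k(Φ, φ_k) > 0` for `Φ ≠ 0`.
[cite: Dimock2013, §2.2 eq. (spiffy); §2.3 Lemma 4] -/
theorem Deltak_posDef (k : ℕ) {a mubar : ℝ} (hak : 0 < aK a L k) (hmu : 0 < mubarK L N k mubar) :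
    (Deltak L Mx N k a mubar).PosDef := by
  apply Matrix.PosDef.of_dotProduct_mulVec_pos
  · rw [Matrix.IsHermitian, Matrix.conjTranspose_eq_transpose_of_trivial, Deltak_transpose]
  · intro x hx
    rw [star_trivial, dotProduct]
    have h := Sk_phiK_eq_half_Deltak L Mx N k a mubar x
    have hpos := Sk_pos_of_ne_zero L Mx N k hak hmu hx (phiK L Mx N k a mubar x)
    linarith

/-- **`D_k = C_k^{−1} = Δ_k + aL^{−2}QᵀQ` is positive definite** (`a_k > 0`, `μ̄_k > 0`, `a ≥ 0`) — the Gaussian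
integral of Lemma 4 is well defined. [cite: Dimock2013, §2.3 Lemma 4 ("C_k = (Δ_k + (a/L²)QᵀQ)^{−1}")] -/
theorem Dk_posDef (k : ℕ) {a mubar : ℝ} (hak : 0 < aK a L k) (hmu : 0 < mubarK L N k mubar) (ha : 0 ≤ a) :
    (Dk L Mx N k a mubar).PosDef := by
  have hL : (0 : ℝ) < L := by exact_mod_cast Nat.pos_of_ne_zero (NeZero.ne L)
  apply Matrix.PosDef.of_dotProduct_mulVec_pos
  · rw [Matrix.IsHermitian, Matrix.conjTranspose_eq_transpose_of_trivial, Dk, Matrix.transpose_add,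
      Matrix.transpose_smul, Deltak_transpose, Q1T_mul_Q1_transpose]
  · intro x hx
    rw [star_trivial, dotProduct]
    have h1 := (Deltak_posDef L Mx N k hak hmu).dotProduct_mulVec_pos hx
    rw [star_trivial, dotProduct] at h1
    have h2 := sum_mul_Q1T_Q1_mulVec_nonneg L Mx N k x
    have hsplit : ∑ i, x i * (Dk L Mx N k a mubar *ᵥ x) i
        = ∑ i, x i * (Deltak L Mx N k a mubar *ᵥ x) i
          + a * ((L : ℝ) ^ 2)⁻¹ * ∑ i, x i * ((Q1T L Mx N k * Q1 L Mx N k) *ᵥ x) i := by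
      simp only [Dk, Matrix.add_mulVec, Matrix.smul_mulVec, Pi.add_apply, Pi.smul_apply, smul_eq_mul, mul_add,
        Finset.sum_add_distrib, Finset.mul_sum]
      congr 1
      apply Finset.sum_congr rfl; intro i _; ring
    rw [hsplit]
    have : 0 ≤ a * ((L : ℝ) ^ 2)⁻¹ * ∑ i, x i * ((Q1T L Mx N k * Q1 L Mx N k) *ᵥ x) i := by positivity
    linarith

/-- **`D_0 = −Δ + μ̄_0 + aL^{−2}QᵀQ` is positive definite** (`μ̄_0 > 0`, `a ≥ 0`). [cite: Dimock2013, §2.3 Lemma 4 (k = 0)] -/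
theorem D0_posDef {a mubar : ℝ} (hmu : 0 < mubarK L N 0 mubar) (ha : 0 ≤ a) : (D0 L Mx N a mubar).PosDef := by
  have hL : (0 : ℝ) < L := by exact_mod_cast Nat.pos_of_ne_zero (NeZero.ne L)
  apply Matrix.PosDef.of_dotProduct_mulVec_pos
  · rw [Matrix.IsHermitian, Matrix.conjTranspose_eq_transpose_of_trivial, D0, Matrix.transpose_add,
      Matrix.transpose_add, Matrix.transpose_smul, Matrix.transpose_smul, Matrix.transpose_one, negLap_transpose,
      Q1T_mul_Q1_transpose]
  · intro x hx
    rw [star_trivial, dotProduct]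
    have hsplit : ∑ i, x i * (D0 L Mx N a mubar *ᵥ x) i
        = ∑ i, x i * (negLap _ 1 *ᵥ x) i + mubarK L N 0 mubar * ∑ i, x i ^ 2
          + a * ((L : ℝ) ^ 2)⁻¹ * ∑ i, x i * ((Q1T L Mx N 0 * Q1 L Mx N 0) *ᵥ x) i := by
      simp only [D0, Matrix.add_mulVec, Matrix.smul_mulVec, Matrix.one_mulVec, Pi.add_apply, Pi.smul_apply,
        smul_eq_mul, mul_add, Finset.sum_add_distrib, Finset.mul_sum]
      apply congrArg₂ _ (congrArg₂ _ rfl ?_) ?_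
      · apply Finset.sum_congr rfl; intro i _; ring
      · apply Finset.sum_congr rfl; intro i _; ring
    have h1 : 0 ≤ ∑ i, x i * (negLap _ (1 : ℝ) *ᵥ x) i := by
      have hg := gradSqF_eq_sum_negLap (1 : ℝ) x
      have hg0 : 0 ≤ gradSqF 1 x := by unfold gradSqF; positivity
      linarith
    have h2 : 0 < ∑ i, x i ^ 2 := by
      obtain ⟨i, hi⟩ : ∃ i, x i ≠ 0 := Function.ne_iff.mp hx
      exact lt_of_lt_of_le (by positivity : 0 < x i ^ 2)
        (Finset.single_le_sum (f := fun i => x i ^ 2) (fun j _ => sq_nonneg (x j)) (Finset.mem_univ i))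
    have h3 := sum_mul_Q1T_Q1_mulVec_nonneg L Mx N 0 x
    rw [hsplit]
    have := mul_pos hmu h2
    have : 0 ≤ a * ((L : ℝ) ^ 2)⁻¹ * ∑ i, x i * ((Q1T L Mx N 0 * Q1 L Mx N 0) *ᵥ x) i := by positivity
    linarith

/-- `det D_k = det C_k^{−1} > 0`. [cite: Dimock2013, §2.3 Lemma 4 ("(det C_k)^{1/2}")] -/
theorem Dk_det_pos (k : ℕ) {a mubar : ℝ} (hak : 0 < aK a L k) (hmu : 0 < mubarK L N k mubar) (ha : 0 ≤ a) :
    0 < (Dk L Mx N k a mubar).det :=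
  (Dk_posDef L Mx N k hak hmu ha).det_pos

/-- `det D_0 > 0`. [cite: Dimock2013, §2.3 Lemma 4 (k = 0)] -/
theorem D0_det_pos {a mubar : ℝ} (hmu : 0 < mubarK L N 0 mubar) (ha : 0 ≤ a) : 0 < (D0 L Mx N a mubar).det :=
  (D0_posDef L Mx N hmu ha).det_pos

/-- **`Z_{k+1} > 0` whenever `Z_k > 0`** (`a > 0`, `a_k > 0`, `μ̄_k > 0`). [cite: Dimock2013, §2.3 Lemma 4 / Lemma 5 ("Z_{k+1} = Z_k 𝒩^{−1}_{a,𝕋¹} (2π)^{|𝕋⁰|/2} (det C_k)^{1/2}")] -/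
theorem Znext_pos (k : ℕ) {a mubar Z : ℝ} (ha : 0 < a) (hak : 0 < aK a L k) (hmu : 0 < mubarK L N k mubar)
    (hZ : 0 < Z) : 0 < Znext L Mx N k a mubar Z := by
  unfold Znext
  have h1 := gaussNorm_pos ha (Fintype.card (TPt 3 (L ^ (Mx + N - (k + 1)))))
  have h2 : 0 < ((Dk L Mx N k a mubar).det)⁻¹ := inv_pos.mpr (Dk_det_pos L Mx N k hak hmu ha.le)
  have h3 : 0 < (2 * Real.pi) ^ ((Fintype.card (TPt 3 (L ^ (Mx + N - k))) : ℝ) / 2) :=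
    Real.rpow_pos_of_pos (by positivity) _
  have h4 := Real.rpow_pos_of_pos h2 (1 / 2 : ℝ)
  positivity

/-- `Z_1 > 0` (`a > 0`, `μ̄_0 > 0`). [cite: Dimock2013, §2.3 Lemma 4 (k = 0); Dimock2013BalabanIII, Theorem 1 item 1 eq. (14)] -/
theorem Znext0_pos {a mubar : ℝ} (ha : 0 < a) (hmu : 0 < mubarK L N 0 mubar) : 0 < Znext0 L Mx N a mubar := by
  unfold Znext0
  have h1 := gaussNorm_pos ha (Fintype.card (TPt 3 (L ^ (Mx + N - (0 + 1)))))
  have h2 : 0 < ((D0 L Mx N a mubar).det)⁻¹ := inv_pos.mpr (D0_det_pos L Mx N hmu ha.le)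
  have h3 : 0 < (2 * Real.pi) ^ ((Fintype.card (TPt 3 (L ^ (Mx + N - 0))) : ℝ) / 2) :=
    Real.rpow_pos_of_pos (by positivity) _
  have h4 := Real.rpow_pos_of_pos h2 (1 / 2 : ℝ)
  positivity

/-- **`Z_k > 0` for every `k`** along the trajectory (`a > 0`, `μ̄ > 0`, `L > 1`). [cite: Dimock2013, §2.3 Lemmas 4–5; Dimock2013BalabanIII, Theorem 1 item 1 eq. (14) ("Z_0 = 1")] -/
theorem Zseq_pos {a mubar : ℝ} (ha : 0 < a) (hmubar : 0 < mubar) (hL : 1 < L) :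
    ∀ k, 0 < Zseq L Mx N a mubar k
  | 0 => by simp
  | 1 => by
    rw [Zseq_one]
    exact Znext0_pos L Mx N ha (mubarK_pos L N 0 hmubar)
  | k + 2 => by
    rw [Zseq_succ_succ]
    exact Znext_pos L Mx N (k + 1) ha (aK_pos ha hL (by omega)) (mubarK_pos L N (k + 1) hmubar)
      (Zseq_pos ha hmubar hL (k + 1))

end Positivity

end Literature.MathematicalPhysics.QuantumFieldTheory.Dimock2011to13.SmallFieldTheoremPrinted

end
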